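import Summits.HodgeConjecture.HodgeConjecture.Cruxes.H413.Lines.F0_T1InnerFormTraceIdentityKit
import HarnessLib

-- EDITION HISTORY ed. 1.19c₂′ → ed. 1.23 (51 `--` lines, 8 345 B, sha16 6be0a4eee3f9f65d): MOVED VERBATIM to the companion
-- `Lines/F0_T1InnerFormTraceIdentity_docarchive.md` § «ed. 1.24b» (F0P3a-plan (g6), RULING #119 (5): doc-only condensation; no declaration touched).

/-!
(ed. 1.24b SPLIT EDITION, RULING #118 (3) ∕ LEAD WORD #121: §0–§3.9 — groups, `ComparisonKit`, pins, `IsPinned`, `LawsT1`, κ values — are the module `Lines/F0_T1InnerFormTraceIdentityKit.lean`, imported below; THIS file keeps §4 the REGISTERED stubs, §5 the anchor and the HEAD, byte-identical.)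
# FLOOR-0 ENGINE, term T1 — LINE `F0-T1InnerFormTraceIdentity`: the trace formula for the anisotropic inner form `G′ = U(V)` and its
# stabilisation against `G = U(3)`, `H = U(2) × U(1)` — STATEMENT LAYER (ed. 1.24a₀)

Cell hodgecm-mathlib, FLOOR 0; crux item H413 = stmt-HodgeConjecture-24833 (route `HCCMUnconditional`).  HONEST LABEL: **HC_CM is proved only modulo
the printed citations until rung 0 closes**; T1 is the engine's critical path, honest label **PROGRAMME**; this file changes no floor and closes nothing.
The module narrative (what the integrator consumes, the typing layers, T1a–T1g with page locators, the REUSE MAP, the edition log, the docstring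
archive) is the CARD `Lines/F0_T1InnerFormTraceIdentity.md`.  CONTRACT: `ComparisonKit` is DATA over `UnitaryGroup.cmDatum L 3 H` (no kit asserted to
exist); `IsPinned` = the kit's concrete anchors, one NAMED pin per conjunct, only ever APPENDED; `LawsT1` = the printed identities read over the kit; §5
REALISES a pinned kit from the stubs with the printed transfer facts as HYPOTHESES; the byte-stable HEAD `engineT1_of_stubs` composes realisation with
`InnerFormStableTraceIdentity ∧ …Nonvacuous` [Rogawski1990, Thm. 14.6.1 (14.6.1) p. 241].  API: `Lines/F0_T1InnerFormTraceIdentityAPI.lean`.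
(print: Rogawski1990, §§14.1–14.6 pp. 232–243; §4.3 pp. 43–44; §4.9 pp. 54–55; §5.4 pp. 72–77)  (print: Gelbart1975, §9–10)
-/

-- the mandated namespace has the single-problem summit's repeated segment, as in every `Cruxes/…/Lines/*.lean` of this sub-problem
set_option linter.dupNamespace false

noncomputable section

namespace Summit.HodgeConjecture.HodgeConjecture.Cruxes.H413.F0T1InnerFormTraceIdentity

open MeasureTheory Measure NumberField IsDedekindDomain
open Literature.NumberTheory.Automorphic
open Literature.AlgebraicGeometry.ShimuraVarieties (hermForm)
open scoped ENNReal NNReal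

variable (L : Type) [Field L] [NumberField L] [IsCMField L]

variable (H : Matrix (Fin 3) (Fin 3) L)
  (μ : Measure (UnitaryGroup.cmDatum L 3 H).automorphicQuotient) [(UnitaryGroup.cmDatum L 3 H).IsAutomorphicMeasure μ]

/-! ## §4 The three REGISTERED STUBS — concrete, closed, tree tokens only (`sorry` lived ONLY here; since ed. 1.10 all three are closed by name) -/

/-- **Stub S1 statement (T1a, the spectral side's bottom layer)**: for anisotropic `H`, automorphic `μ` and an inversion-invariant Haar `ν` on
`U(H)(𝔸_{L⁺})`, a ℂ-linear functional `θ` on `C_c(U(H)(𝔸))` with `θ(f′ ⋆ f′^*) = Σ_i ‖R(f′) e_i‖²` (Gelbart's Lemma 10.6 form of «the trace of `ρ(f′)` on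
`L(G′)`»; ★ CLOSED, see `stub_T1a_traceFunctional`; full text: companion § ed. 1.24b). (print: Rogawski1990, §14.5 p. 237) (print: Gelbart1975, (9.11), Lemma 10.6) -/
def StubT1aTraceFunctional (H : Matrix (Fin 3) (Fin 3) L) [MeasurableSpace (UnitaryGroup.cmDatum L 3 H).Adelic]
    [BorelSpace (UnitaryGroup.cmDatum L 3 H).Adelic]
    (μ : Measure (UnitaryGroup.cmDatum L 3 H).automorphicQuotient) [(UnitaryGroup.cmDatum L 3 H).IsAutomorphicMeasure μ]
    (ν : Measure (UnitaryGroup.cmDatum L 3 H).Adelic) [ν.IsHaarMeasure] [ν.IsInvInvariant] : Prop :=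
  (∀ x : Fin 3 → L, hermForm (cmConjRingHom L) H x x = 0 → x = 0) →
    ∃ θ : CompactlySupportedContinuousMap (UnitaryGroup.cmDatum L 3 H).Adelic ℂ →ₗ[ℂ] ℂ,
      ∀ (f' F' : CompactlySupportedContinuousMap (UnitaryGroup.cmDatum L 3 H).Adelic ℂ),
        (∀ x, F' x = mulConv ν (⇑f') (mulStar (⇑f')) x) →
        ∀ {ι : Type} [Countable ι] (b : HilbertBasis ι ℂ ((UnitaryGroup.cmDatum L 3 H).L2 μ)),
          HasSum (fun i => (‖((UnitaryGroup.cmDatum L 3 H).rightRegular μ).integratedOperator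
              ((UnitaryGroup.cmDatum L 3 H).isUnitary_rightRegular μ)
              ((UnitaryGroup.cmDatum L 3 H).isStronglyContinuous_rightRegular_holds μ) ν f' (b i)‖ ^ 2 : ℝ))
            (θ F').re ∧ (θ F').im = 0

/-- **Anchor fact A2 (T1a) — IN THE TREE, cited by name, NOT a stub**: for anisotropic `H` every discrete automorphic representation of `U(H)(𝔸_{L⁺})`
has FINITE multiplicity in `L²` (★ `UnitaryGroup.multiplicity_lt_top_of_mem_discreteSpectrum_cmDatum`). (print: Rogawski1990, §14.5 p. 237) (print: GelfandGraevPiatetskiShapiro1969, Ch. 1 §2.3) -/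
def FactT1aMultiplicityFinite (H : Matrix (Fin 3) (Fin 3) L)
    (μ : Measure (UnitaryGroup.cmDatum L 3 H).automorphicQuotient) [(UnitaryGroup.cmDatum L 3 H).IsAutomorphicMeasure μ] : Prop :=
  (∀ x : Fin 3 → L, hermForm (cmConjRingHom L) H x x = 0 → x = 0) →
    multiplicity_lt_top_of_mem_discreteSpectrum (UnitaryGroup.cmDatum L 3 H) μ

/-- **Stub S2 statement (T1g, the transfer's bottom layer: `S = ∅`)** [Rogawski1990, §14.2 p. 232]: for an anisotropic HERMITIAN `H` and EVERY finite place
`v` of `L⁺` the local unitary groups of `H` and of the split form `Φ₃` are isomorphic as topological groups (odd dimension; split `v`: both `≅ GL₃(L⁺_v)`) — the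
`ψ_v` through which `f′_v → f_v` is the identity off `S₀` (★ CLOSED, see `stub_T1g_locallyQuasiSplit`; full text: companion § ed. 1.24b).
(print: Rogawski1990, §14.2 p. 232; §1.9) (print: Jacobowitz1962, Thm. 3.1) -/
def StubT1gLocallyQuasiSplit (H : Matrix (Fin 3) (Fin 3) L) : Prop :=
  (∀ x : Fin 3 → L, hermForm (cmConjRingHom L) H x x = 0 → x = 0) → (H.map (cmConjRingHom L)).transpose = H →
    ∀ v : HeightOneSpectrum (𝓞 ↥(maximalRealSubfield L)),
      Nonempty ((UnitaryGroup.cmDatum L 3 H).Local v ≃ₜ*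
        (UnitaryGroup.cmDatum L 3 (Matrix.of fun i j : Fin 3 => if i.val + j.val + 1 = 3 then (1 : L) else 0)).Local v)

/-- **Stub S3 statement (T1c infrastructure)**: the QUASI-SPLIT unitary groups `U(Φ_N)`, `N ≤ 3`, have an automorphic (finite, invariant,
inner-regular, open-positive) measure on `U(Φ_N)(L⁺)\U(Φ_N)(𝔸_{L⁺})` — finite covolume by reduction theory (★ CLOSED for all `N`, see
`stub_T1c_splitFormAutomorphicMeasure`; full text: companion § ed. 1.24b). (print: Borel1963, §5) (print: PlatonovRapinchuk1994, Thm. 4.17) (print: Rogawski1990, Ch. 9–10) -/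
def StubT1cSplitFormAutomorphicMeasure : Prop :=
  ∀ N : ℕ, N ≤ 3 → ∃ μ' : Measure (UnitaryGroup.cmDatum L N (Matrix.of fun i j : Fin N => if i.val + j.val + 1 = N then (1 : L) else 0)).automorphicQuotient,
    (UnitaryGroup.cmDatum L N (Matrix.of fun i j : Fin N => if i.val + j.val + 1 = N then (1 : L) else 0)).IsAutomorphicMeasure μ'

variable (H : Matrix (Fin 3) (Fin 3) L) [MeasurableSpace (UnitaryGroup.cmDatum L 3 H).Adelic] [BorelSpace (UnitaryGroup.cmDatum L 3 H).Adelic]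
  (μ : Measure (UnitaryGroup.cmDatum L 3 H).automorphicQuotient) [(UnitaryGroup.cmDatum L 3 H).IsAutomorphicMeasure μ]
  (ν : Measure (UnitaryGroup.cmDatum L 3 H).Adelic) [ν.IsHaarMeasure] [ν.IsInvInvariant]

/-- ★ CLOSED (ed. 1.6) by `Theorems/F0P3aStubS1TraceFunctional.lean` (F0P3a-p01, p793187). stub **S1** `stub_T1a_traceFunctional` — REGISTERED
(route: companion § ed. 1.24b). [cite: Rogawski1990, §14.5 p. 237] [cite: Gelbart1975, Lemma 10.6] -/
theorem stub_T1a_traceFunctional : StubT1aTraceFunctional L H μ ν :=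
  F0P3aStubS1TraceFunctional.stubS1_holds L H μ ν

omit [MeasurableSpace (UnitaryGroup.cmDatum L 3 H).Adelic] [BorelSpace (UnitaryGroup.cmDatum L 3 H).Adelic] in
/-- ★ anchor fact **A2** FOLDED (ed. 1.9) from `Theorems/F0P3aFactA2Multiplicity.lean` (F0P3a-p08, p794843; proof = ★
`UnitaryGroup.multiplicity_lt_top_of_mem_discreteSpectrum_cmDatum`). [cite: GelfandGraevPiatetskiShapiro1969, Ch. 1 §2.3] [cite: Rogawski1990, §14.5 p. 237] -/
theorem factT1a_multiplicityFinite : FactT1aMultiplicityFinite L H μ :=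
  F0P3aFactA2Multiplicity.factT1a_multiplicityFinite L H μ

omit [MeasurableSpace (UnitaryGroup.cmDatum L 3 H).Adelic] [BorelSpace (UnitaryGroup.cmDatum L 3 H).Adelic] in
/-- ★ CLOSED (ed. 1.7) by `Theorems/F0P3aStubS2LocallyQuasiSplit.lean` (F0P3a-p03, p793633). stub **S2** `stub_T1g_locallyQuasiSplit` — REGISTERED
(route: companion § ed. 1.24b). [cite: Rogawski1990, §14.2 p. 232 (i)–(iii); §1.9] [cite: Jacobowitz1962, Thm. 3.1] -/
theorem stub_T1g_locallyQuasiSplit : StubT1gLocallyQuasiSplit L H :=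
  F0P3aStubS2LocallyQuasiSplit.stubT1gLocallyQuasiSplit_holds L H

/-- ★ CLOSED (ed. 1.10) by `Theorems/F0P3aStubS3SplitFormMeasure.lean` ed. 2 (F0P3a-p04 `stubS3_holds`, indeed `stubS3_all : ∀ N`). stub **S3**
`stub_T1c_splitFormAutomorphicMeasure` — REGISTERED (route: companion § ed. 1.24b). [cite: Borel1963, §5] [cite: PlatonovRapinchuk1994, Thm. 4.17] -/
theorem stub_T1c_splitFormAutomorphicMeasure : StubT1cSplitFormAutomorphicMeasure L :=
  F0P3aStubS3SplitFormMeasure.stubS3_holds L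

/-! ## §5 Compositions (kernel-checked, no `sorry` below this line) -/

omit [NumberField L] [IsCMField L] in
/-- `splitForm` is the inlined matrix of the stub statements. [folklore] -/
theorem splitForm_eq (N : ℕ) :
    splitForm L N = Matrix.of fun i j : Fin N => if i.val + j.val + 1 = N then (1 : L) else 0 := rfl

/-! ### §5.1 (ed. 1.19b₀) The ANCHOR WITNESS — the realising data as a structure, one lemma per pin group ∕ law -/

omit [ν.IsInvInvariant] in
/-- **(ed. 1.19b₀) (viii′)∕(viii″)∕(viii⁗) THE ABSORBED ADELIC FAMILY** — for anisotropic `H`, ONE adelic orbital measure family `μA` over the rational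
classes, admissible at every class, `Φ_{μA}(·, f′)` finitely supported, with the weight-free O-expansion `θ_{G′}(f′) = ∑ᶠ_{𝒪_st} ∑_{[γ] ∈ 𝒪_st} Φ_{μA}([γ], f′)`
(★ (O-H) `UnitaryGroup.exists_weight_diagTrace_eq_finsum_orbitalSum_of_anisotropic` re-weighted; full text: companion § ed. 1.24b).
[cite: Rogawski1990, §14.5 p. 237] [cite: Gelbart1975, (9.11) and Lemma 10.6] -/
theorem exists_absorbedAdelicFamily (hanis : IsAnisotropic L H) :
    letI : ∀ g : GpAdelic L H, MeasurableSpace (GpAdelic L H ⧸ Subgroup.centralizer ({g} : Set (GpAdelic L H))) := fun _ => borel _;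
    ∃ μA : UnitaryGroup.AdelicOrbitalMeasureFamily L 3 H,
      (∀ c : ConjClasses (UnitaryGroup.cmDatum L 3 H).Rational,
          SMulInvariantMeasure (GpAdelic L H) _ (μA c) ∧ IsFiniteMeasureOnCompacts (μA c) ∧ μA c ≠ 0) ∧
      (∀ f' : TestGp L H, (Function.support (UnitaryGroup.adelicClassOrbitalIntegral L 3 H μA f')).Finite) ∧
      (∀ f' : TestGp L H, UnitaryGroup.diagTrace L 3 H μ ν hanis f' =
        ∑ᶠ st : Literature.NumberTheory.Rogawski1990.StableClass (cmConjRingHom L) H,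
          st.orbitalSum (UnitaryGroup.adelicClassOrbitalIntegral L 3 H μA f')) := by
  classical
  letI instOS : ∀ g : GpAdelic L H, MeasurableSpace (GpAdelic L H ⧸ Subgroup.centralizer ({g} : Set (GpAdelic L H))) := fun _ => borel _
  haveI : ∀ g : GpAdelic L H, BorelSpace (GpAdelic L H ⧸ Subgroup.centralizer ({g} : Set (GpAdelic L H))) := fun _ => ⟨rfl⟩
  obtain ⟨μ₀, hμ₀, a, ha, hJ⟩ := UnitaryGroup.exists_weight_diagTrace_eq_finsum_orbitalSum_of_anisotropic L 3 H μ ν hanis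
  obtain ⟨μA, hμAdef⟩ : ∃ μA : UnitaryGroup.AdelicOrbitalMeasureFamily L 3 H, μA = fun c => ENNReal.ofReal (a c) • μ₀ c := ⟨_, rfl⟩
  have hΦμ : ∀ (F : TestGp L H) (c : ConjClasses (UnitaryGroup.cmDatum L 3 H).Rational),
      UnitaryGroup.adelicClassOrbitalIntegral L 3 H μA F c = (a c : ℂ) * UnitaryGroup.adelicClassOrbitalIntegral L 3 H μ₀ F c := by
    intro F c
    simp only [hμAdef, UnitaryGroup.adelicClassOrbitalIntegral, classOrbitalIntegralAlong, orbitalIntegral, integral_smul_measure,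
      ENNReal.toReal_ofReal (ha c).le, Complex.real_smul]
  have hμA : ∀ c : ConjClasses (UnitaryGroup.cmDatum L 3 H).Rational,
      SMulInvariantMeasure (GpAdelic L H) _ (μA c) ∧ IsFiniteMeasureOnCompacts (μA c) ∧ μA c ≠ 0 := by
    intro c
    obtain ⟨h₁, h₂, h₃⟩ := hμ₀ c
    subst hμAdef
    refine ⟨inferInstance, IsFiniteMeasureOnCompacts.smul (μ₀ c) ENNReal.ofReal_ne_top, ?_⟩
    rw [← Measure.measure_univ_ne_zero, Measure.smul_apply, smul_eq_mul]
    exact mul_ne_zero (ENNReal.ofReal_pos.mpr (ha c)).ne' (Measure.measure_univ_ne_zero.mpr h₃)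
  have hfun : ∀ f' : TestGp L H, (fun c => (a c : ℂ) * UnitaryGroup.adelicClassOrbitalIntegral L 3 H μ₀ f' c) =
      UnitaryGroup.adelicClassOrbitalIntegral L 3 H μA f' := fun f' => (funext (hΦμ f')).symm
  refine ⟨μA, hμA, fun f' => ?_, fun f' => ?_⟩
  · -- (viii⁗): finite support of `Φ_{μA}(·, f′)` on the rational classes (★ (O-H), weights absorbed)
    obtain ⟨hfin, -⟩ := hJ f'
    rwa [hfun f'] at hfin
  · -- (viii″)∕T1a (`hJ`'s summand lambda is typed over `ConjClasses (unitaryGroup σ H)`: rewrite by `congrArg`, not `rw`)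
    obtain ⟨-, hEq⟩ := hJ f'
    exact hEq.trans (finsum_congr fun st => congrArg (fun Ψ => Literature.NumberTheory.Rogawski1990.StableClass.orbitalSum Ψ st) (hfun f'))

-- (ed. 1.24) `exists_absorbedAdelicFamily_ofLocal` (ed. 1.19b₂∕1.23) is SUPERSEDED by ★ `UnitaryGroup.exists_absorbedFamily_ofLocal_patched` (leaf) and removed.

section Anchor

variable [∀ v : HeightOneSpectrum (𝓞 ↥(maximalRealSubfield L)), MeasurableSpace (HLocal L v)] [∀ v : HeightOneSpectrum (𝓞 ↥(maximalRealSubfield L)), BorelSpace (HLocal L v)]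
  [∀ v : HeightOneSpectrum (𝓞 ↥(maximalRealSubfield L)), MeasurableSpace (GpLocal L H v)] [∀ v : HeightOneSpectrum (𝓞 ↥(maximalRealSubfield L)), BorelSpace (GpLocal L H v)]
  [MeasurableSpace (GpInf L H)] [BorelSpace (GpInf L H)] [MeasurableSpace (GInf L)] [BorelSpace (GInf L)]
  [MeasurableSpace (HInf L)] [BorelSpace (HInf L)]

/-- **(ed. 1.19b₀) the archimedean TORUS COHERENCE clauses** (W′)(W)(W_H)(C′)(C)(C′G)(C_H) of ★ `ArchTransfersExistCanonical` — the body of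
`ComparisonKit.ArchCoherence` after its `∃ t′ t t_H`, VERBATIM, over FREE families and torus measures, so that the anchor witness states it by NAME and
`IsPinned` (xii) is `⟨t′, t, t_H, hcoh⟩` (full text: companion § ed. 1.24b). (print: Rogawski1990, §14.3 p. 234; §4.3 p. 43; §3.2–3.3) -/
def ArchTorusCoherence (hanis : IsAnisotropic L H)
    (mGi : letI : ∀ γ : GpInf L H, MeasurableSpace (GpInf L H ⧸ Subgroup.centralizer ({γ} : Set (GpInf L H))) := fun _ => borel _;
      OrbitalMeasureFamily (GpInf L H))
    (mqi : letI : ∀ γ : GInf L, MeasurableSpace (GInf L ⧸ Subgroup.centralizer ({γ} : Set (GInf L))) := fun _ => borel _;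
      OrbitalMeasureFamily (GInf L))
    (mHi : letI : ∀ a : HInf L, MeasurableSpace (HInf L ⧸ Subgroup.centralizer ({a} : Set (HInf L))) := fun _ => borel _;
      OrbitalMeasureFamily (HInf L))
    (νGi : Measure (GpInf L H)) (νqi : Measure (GInf L)) (νHi : Measure (HInf L))
    [IsFiniteMeasureOnCompacts νGi] [νGi.IsMulRightInvariant] [IsFiniteMeasureOnCompacts νqi] [νqi.IsMulRightInvariant]
    [IsFiniteMeasureOnCompacts νHi] [νHi.IsMulRightInvariant]
    (t' : ∀ γ' : GpInf L H, Measure ↥(Subgroup.centralizer ({γ'} : Set (GpInf L H))))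
    (t : ∀ γ : GInf L, Measure ↥(Subgroup.centralizer ({γ} : Set (GInf L))))
    (tH : ∀ γH : HInf L, Measure ↥(Subgroup.centralizer ({γH} : Set (HInf L)))) : Prop :=
  letI : ∀ γ : GpInf L H, MeasurableSpace (GpInf L H ⧸ Subgroup.centralizer ({γ} : Set (GpInf L H))) := fun _ => borel _
  haveI : ∀ γ : GpInf L H, BorelSpace (GpInf L H ⧸ Subgroup.centralizer ({γ} : Set (GpInf L H))) := fun _ => ⟨rfl⟩
  letI : ∀ γ : GInf L, MeasurableSpace (GInf L ⧸ Subgroup.centralizer ({γ} : Set (GInf L))) := fun _ => borel _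
  haveI : ∀ γ : GInf L, BorelSpace (GInf L ⧸ Subgroup.centralizer ({γ} : Set (GInf L))) := fun _ => ⟨rfl⟩
  letI : ∀ a : HInf L, MeasurableSpace (HInf L ⧸ Subgroup.centralizer ({a} : Set (HInf L))) := fun _ => borel _
  haveI : ∀ a : HInf L, BorelSpace (HInf L ⧸ Subgroup.centralizer ({a} : Set (HInf L))) := fun _ => ⟨rfl⟩
  -- (W′)(W)(W_H): Weil form for the given Haar measures
  mGi.IsQuotientOf (fun γ => Literature.NumberTheory.Rogawski1990.IsRegularElt (γ.val : GL (Fin 3) (NumberField.mixedEmbedding.mixedSpace L))) νGi t' ∧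
    mqi.IsQuotientOf (fun γ => Literature.NumberTheory.Rogawski1990.IsRegularElt (γ.val : GL (Fin 3) (NumberField.mixedEmbedding.mixedSpace L))) νqi t ∧
    mHi.IsQuotientOf (Literature.NumberTheory.Rogawski1990.IsArchGRegular L) νHi tH ∧
  -- (C′): compatibility under stable conjugacy inside `G′_∞`
  (∀ (γ₁ γ₂ : GpInf L H)
      (h₁ : Literature.NumberTheory.Rogawski1990.IsRegularElt (γ₁.val : GL (Fin 3) (NumberField.mixedEmbedding.mixedSpace L)))
      (hc : Literature.NumberTheory.Rogawski1990.Corresponds (UnitaryGroup.conjMixed (↥(maximalRealSubfield L)) L (IsCMField.complexConj L))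
        (UnitaryGroup.archFormOf L 3 H) (UnitaryGroup.archFormOf L 3 H) γ₁ γ₂),
      Measure.map ⇑(UnitaryGroup.archStableCentralizerEquiv L (Literature.NumberTheory.Automorphic.Godement.det_ne_zero_of_anisotropic L H hanis)
        (Literature.NumberTheory.Automorphic.Godement.det_ne_zero_of_anisotropic L H hanis) hc h₁) (t' γ₁) = t' γ₂) ∧
  -- (C): compatibility under stable conjugacy inside `G_∞`
  (∀ (γ₁ γ₂ : GInf L)
      (h₁ : Literature.NumberTheory.Rogawski1990.IsRegularElt (γ₁.val : GL (Fin 3) (NumberField.mixedEmbedding.mixedSpace L)))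
      (hc : Literature.NumberTheory.Rogawski1990.Corresponds (UnitaryGroup.conjMixed (↥(maximalRealSubfield L)) L (IsCMField.complexConj L))
        (UnitaryGroup.archFormOf L 3 (Matrix.of fun i j : Fin 3 => if i.val + j.val + 1 = 3 then (1 : L) else 0))
        (UnitaryGroup.archFormOf L 3 (Matrix.of fun i j : Fin 3 => if i.val + j.val + 1 = 3 then (1 : L) else 0)) γ₁ γ₂),
      Measure.map ⇑(UnitaryGroup.archStableCentralizerEquiv L (UnitaryGroup.isUnit_antidiagOne_det L 3).ne_zero
        (UnitaryGroup.isUnit_antidiagOne_det L 3).ne_zero hc h₁) (t γ₁) = t γ₂) ∧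
  -- (C′G): compatibility under the inner twist `G′_∞ ↔ G_∞`
  (∀ (γ' : GpInf L H) (γ : GInf L)
      (h' : Literature.NumberTheory.Rogawski1990.IsRegularElt (γ'.val : GL (Fin 3) (NumberField.mixedEmbedding.mixedSpace L)))
      (hc : Literature.NumberTheory.Rogawski1990.Corresponds (UnitaryGroup.conjMixed (↥(maximalRealSubfield L)) L (IsCMField.complexConj L))
        (UnitaryGroup.archFormOf L 3 H)
        (UnitaryGroup.archFormOf L 3 (Matrix.of fun i j : Fin 3 => if i.val + j.val + 1 = 3 then (1 : L) else 0)) γ' γ),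
      Measure.map ⇑(UnitaryGroup.archStableCentralizerEquiv L (Literature.NumberTheory.Automorphic.Godement.det_ne_zero_of_anisotropic L H hanis)
        (UnitaryGroup.isUnit_antidiagOne_det L 3).ne_zero hc h') (t' γ') = t γ) ∧
  -- (C_H): compatibility along the endoscopic embedding `ι_∞ : H_∞ → G_∞` at the `G`-regular elements
  (∀ γH : HInf L, Literature.NumberTheory.Rogawski1990.IsArchGRegular L γH →
      Measure.map ⇑(Literature.NumberTheory.Rogawski1990.endoEmbArchCentralizer L γH) (tH γH) =
        t (Literature.NumberTheory.Rogawski1990.endoEmbArch L γH))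

open scoped Classical in
/-- **(ed. 1.19b₀) ANCHOR WITNESS for `(G′, G, H)`** — the data that REALISE the anchored kit, with their ★ clauses, as ONE structure (ψ∕S₀; `S_bad`, `Δ_v`
and the CANONICAL local families; the archimedean families and torus measures; `μ₃`; the absorbed family `μA` and the stable weight `α`; since ed. 1.24b the
singular transfer members).  Nothing is asserted: existence is `anchorWitness_nonempty` (field table: companion § ed. 1.24b). (print: Rogawski1990, §14.1–14.2 p. 232; §14.5 p. 237; §4.9
Prop. 4.9.1 p. 55) -/
structure AnchorWitness
    (νH : ∀ v : HeightOneSpectrum (𝓞 ↥(maximalRealSubfield L)), Measure (HLocal L v)) (νG : ∀ v : HeightOneSpectrum (𝓞 ↥(maximalRealSubfield L)), Measure (GpLocal L H v))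
    [∀ v, IsFiniteMeasureOnCompacts (νH v)] [∀ v, (νH v).IsMulRightInvariant]
    [∀ v, IsFiniteMeasureOnCompacts (νG v)] [∀ v, (νG v).IsMulRightInvariant]
    (νGi : Measure (GpInf L H)) (νqi : Measure (GInf L)) (νHi : Measure (HInf L))
    [IsFiniteMeasureOnCompacts νGi] [νGi.IsMulRightInvariant] [IsFiniteMeasureOnCompacts νqi] [νqi.IsMulRightInvariant]
    [IsFiniteMeasureOnCompacts νHi] [νHi.IsMulRightInvariant]
    (Tinf : Literature.NumberTheory.Rogawski1990.ArchTransferFactor L H) (hanis : IsAnisotropic L H) where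
  /-- (x) the local identifications `ψ_v : G′_v ≅ G_v` (class-preserving, level-matching off `S₀`) [§14.1–14.2 p. 232] -/
  ψ₀ : ∀ v : HeightOneSpectrum (𝓞 ↥(maximalRealSubfield L)),
    (UnitaryGroup.cmDatum L 3 H).Local v ≃ₜ* (UnitaryGroup.cmDatum L 3 (Matrix.of fun i j : Fin 3 => if i.val + j.val + 1 = 3 then (1 : L) else 0)).Local v
  /-- (x) the exceptional finite set `S₀` of the level matching -/
  S₀ : Finset (HeightOneSpectrum (𝓞 ↥(maximalRealSubfield L)))
  /-- (xi′) the bad set `S_bad` of the joint transfer fact [Prop. 4.9.1 (b)] -/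
  Sbad : Finset (HeightOneSpectrum (𝓞 ↥(maximalRealSubfield L)))
  /-- (xi′) the local transfer factors `Δ_v` [§4.9 p. 54] -/
  Δ : ∀ v : HeightOneSpectrum (𝓞 ↥(maximalRealSubfield L)), Literature.NumberTheory.Rogawski1990.LocalTransferFactor L H v
  /-- (xi′) the orbital measure families `m^H_v` [§4.3 pp. 43–44] -/
  mH : letI : ∀ (v : HeightOneSpectrum (𝓞 ↥(maximalRealSubfield L))) (a : HLocal L v),
        MeasurableSpace (HLocal L v ⧸ Subgroup.centralizer ({a} : Set (HLocal L v))) := fun _ _ => borel _;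
    ∀ v, OrbitalMeasureFamily (HLocal L v)
  /-- (xi′) the orbital measure families `m^{G′}_v` [§4.3 pp. 43–44] -/
  mG : letI : ∀ (v : HeightOneSpectrum (𝓞 ↥(maximalRealSubfield L))) (γ : (UnitaryGroup.cmDatum L 3 H).Local v),
        MeasurableSpace ((UnitaryGroup.cmDatum L 3 H).Local v ⧸
          Subgroup.centralizer ({γ} : Set ((UnitaryGroup.cmDatum L 3 H).Local v))) := fun _ _ => borel _;
    ∀ v, OrbitalMeasureFamily ((UnitaryGroup.cmDatum L 3 H).Local v)
  /-- (xi″) the orbital measure family `m^H_∞` [§14.3 p. 234] -/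
  mHi : letI : ∀ a : HInf L, MeasurableSpace (HInf L ⧸ Subgroup.centralizer ({a} : Set (HInf L))) := fun _ => borel _;
    OrbitalMeasureFamily (HInf L)
  /-- (ix′)∕(xi″) the orbital measure family `m^{G′}_∞` [§14.2 p. 233; §14.3 p. 234] -/
  mGi : letI : ∀ γ : GpInf L H, MeasurableSpace (GpInf L H ⧸ Subgroup.centralizer ({γ} : Set (GpInf L H))) := fun _ => borel _;
    OrbitalMeasureFamily (GpInf L H)
  /-- (ix′) the orbital measure family `m_∞` on `G_∞ = U(Φ₃)_∞` [§14.2 p. 233] -/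
  mqi : letI : ∀ γ : GInf L, MeasurableSpace (GInf L ⧸ Subgroup.centralizer ({γ} : Set (GInf L))) := fun _ => borel _;
    OrbitalMeasureFamily (GInf L)
  /-- (xii) the torus measures `t′_γ′` on the centralizers in `G′_∞` [§4.3 p. 43] -/
  t' : ∀ γ' : GpInf L H, Measure ↥(Subgroup.centralizer ({γ'} : Set (GpInf L H)))
  /-- (xii) the torus measures `t_γ` on the centralizers in `G_∞` -/
  t : ∀ γ : GInf L, Measure ↥(Subgroup.centralizer ({γ} : Set (GInf L)))
  /-- (xii) the torus measures `t_{γ_H}` on the centralizers in `H_∞` -/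
  tH : ∀ γH : HInf L, Measure ↥(Subgroup.centralizer ({γH} : Set (HInf L)))
  /-- (iii) the automorphic measure on `U(Φ₃)(L⁺)\U(Φ₃)(𝔸)` (stub S3) -/
  μ₃ : Measure (UnitaryGroup.cmDatum L 3 (Matrix.of fun i j : Fin 3 => if i.val + j.val + 1 = 3 then (1 : L) else 0)).automorphicQuotient
  /-- (viii′) ONE adelic orbital measure family on `U(H)(𝔸)` over the rational classes, the (O-H) weights absorbed [§14.5 p. 237] -/
  μA : letI : ∀ g : GpAdelic L H, MeasurableSpace (GpAdelic L H ⧸ Subgroup.centralizer ({g} : Set (GpAdelic L H))) := fun _ => borel _;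
    UnitaryGroup.AdelicOrbitalMeasureFamily L 3 H
  /-- (iii) `μ₃` IS automorphic -/
  hμ₃ : (UnitaryGroup.cmDatum L 3 (Matrix.of fun i j : Fin 3 => if i.val + j.val + 1 = 3 then (1 : L) else 0)).IsAutomorphicMeasure μ₃
  /-- (x-corr) `ψ_v` preserves classes: `γ′ ↔ ψ_v γ′` -/
  hcorr : ∀ v (γ' : (UnitaryGroup.cmDatum L 3 H).Local v),
    Literature.NumberTheory.Rogawski1990.Corresponds (UnitaryGroup.conjLocal L (IsCMField.complexConj L) v)
      ((UnitaryGroup.adelicForm L 3 H).map (UnitaryGroup.adeleToLocal L v))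
      ((UnitaryGroup.adelicForm L 3 (Matrix.of fun i j : Fin 3 => if i.val + j.val + 1 = 3 then (1 : L) else 0)).map (UnitaryGroup.adeleToLocal L v))
      γ' (ψ₀ v γ')
  /-- (x-corr) `ψ_v⁻¹` preserves classes: `ψ_v⁻¹ γ ↔ γ` -/
  hcorr' : ∀ v (γ : (UnitaryGroup.cmDatum L 3 (Matrix.of fun i j : Fin 3 => if i.val + j.val + 1 = 3 then (1 : L) else 0)).Local v),
    Literature.NumberTheory.Rogawski1990.Corresponds (UnitaryGroup.conjLocal L (IsCMField.complexConj L) v)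
      ((UnitaryGroup.adelicForm L 3 H).map (UnitaryGroup.adeleToLocal L v))
      ((UnitaryGroup.adelicForm L 3 (Matrix.of fun i j : Fin 3 => if i.val + j.val + 1 = 3 then (1 : L) else 0)).map (UnitaryGroup.adeleToLocal L v))
      ((ψ₀ v).symm γ) γ
  /-- (x) level matching off `S₀`: `ψ_v(g) ∈ K_v ↔ g ∈ K′_v` -/
  hψ₀ : ∀ v ∉ S₀, ∀ g, ψ₀ v g ∈ UnitaryGroup.cmLocalIntegralLevel L 3 (Matrix.of fun i j : Fin 3 => if i.val + j.val + 1 = 3 then (1 : L) else 0) v ↔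
    g ∈ UnitaryGroup.cmLocalIntegralLevel L 3 H v
  /-- (xi′)∕(xi‴) per finite `v`: local transfer datum, unit transfer off `S_bad`, and both families CANONICAL for `νH_v`, `νG_v` — the per-`v` body of ★
  `GlobalTransferWithFundamentalLemmaCanonical` VERBATIM [Prop. 4.9.1 (a)(b); (4.3.1); §1.7] -/
  hloc : letI : ∀ (v : HeightOneSpectrum (𝓞 ↥(maximalRealSubfield L))) (a : HLocal L v),
        MeasurableSpace (HLocal L v ⧸ Subgroup.centralizer ({a} : Set (HLocal L v))) := fun _ _ => borel _;
    haveI : ∀ (v : HeightOneSpectrum (𝓞 ↥(maximalRealSubfield L))) (a : HLocal L v),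
        BorelSpace (HLocal L v ⧸ Subgroup.centralizer ({a} : Set (HLocal L v))) := fun _ _ => ⟨rfl⟩;
    letI : ∀ (v : HeightOneSpectrum (𝓞 ↥(maximalRealSubfield L))) (γ : (UnitaryGroup.cmDatum L 3 H).Local v),
        MeasurableSpace ((UnitaryGroup.cmDatum L 3 H).Local v ⧸
          Subgroup.centralizer ({γ} : Set ((UnitaryGroup.cmDatum L 3 H).Local v))) := fun _ _ => borel _;
    haveI : ∀ (v : HeightOneSpectrum (𝓞 ↥(maximalRealSubfield L))) (γ : (UnitaryGroup.cmDatum L 3 H).Local v),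
        BorelSpace ((UnitaryGroup.cmDatum L 3 H).Local v ⧸
          Subgroup.centralizer ({γ} : Set ((UnitaryGroup.cmDatum L 3 H).Local v))) := fun _ _ => ⟨rfl⟩;
    ∀ v, Literature.NumberTheory.Rogawski1990.IsLocalTransferDatum L H v (Δ v) (mH v) (mG v) ∧
      (v ∉ Sbad → Literature.NumberTheory.Rogawski1990.IsLocalUnitTransfer L H v (Δ v) (mH v) (mG v)) ∧
      (mH v).IsCanonical (Literature.NumberTheory.Rogawski1990.IsLocalGRegular L v) (νH v) ∧
      (mG v).IsCanonical (fun γ => Literature.NumberTheory.Rogawski1990.IsRegularElt (γ.val : GL (Fin 3) (UnitaryGroup.LocalRing L v))) (νG v)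
  /-- (xi″) `Δ_v = 1` for almost all `v` [(4.3.3) p. 44] -/
  hae : Literature.NumberTheory.Rogawski1990.IsAlmostEverywhereTrivial L H Δ
  /-- (xi″) the product formula with `Tinf.Δ` [§8.2 p. 113; §14.6 p. 241] -/
  hpf : Literature.NumberTheory.Rogawski1990.SatisfiesProductFormula L H Δ Tinf.Δ
  /-- (xv) (ed. 1.21) the per-regular-`γ₀` stabilisation package of `Δ` — the last conjunct of ★ `GlobalTransferWithStabilisationPackage`'s body at
  `hanis` [Prop. 3.3.1 p. 22; (4.3.3) p. 44; (5.4.5) pp. 72–74] -/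
  hpkg : ∀ γ₀ : (UnitaryGroup.cmDatum L 3 H).Rational, Literature.NumberTheory.Rogawski1990.IsRegularElt (γ₀.val : GL (Fin 3) L) →
      ∃ (A : Type) (_ : AddCommGroup A) (𝓡 : Subgroup (AddChar A ℂ)) (_ : Fintype 𝓡) (obs : Literature.NumberTheory.Rogawski1990.MatchingAdeleG₂ L H H γ₀ → A)
        (e : {𝒪H : Literature.NumberTheory.Rogawski1990.StableClassH (cmConjRingHom L) (splitForm L 2) (splitForm L 1) //
            𝒪H.TransfersTo H Literature.NumberTheory.Rogawski1990.endoForm_antidiagOne (Literature.NumberTheory.Rogawski1990.stableClassOf (cmConjRingHom L) H γ₀)} ≃ {χ : 𝓡 // χ ≠ 1}),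
        (∀ p : Literature.NumberTheory.Rogawski1990.MatchingAdeleG₂ L H H γ₀, (∀ κ ∈ 𝓡, κ (obs p) = 1) ↔ ∃ γ, p.IsRationalOver γ) ∧
        ∀ (γH : (UnitaryGroup.cmDatum L 2 (splitForm L 2)).Rational × (UnitaryGroup.cmDatum L 1 (splitForm L 1)).Rational)
          (hγ : Literature.NumberTheory.Rogawski1990.IsNormPair L H γH γ₀),
          Literature.NumberTheory.Rogawski1990.GlobalKappaFormula L H Δ Tinf.Δ (fun p : Literature.NumberTheory.Rogawski1990.MatchingAdele L H γH => obs (Literature.NumberTheory.Rogawski1990.MatchingAdele.toSelf hγ p))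
            ((e ⟨Literature.NumberTheory.Rogawski1990.stableClassHOf (cmConjRingHom L) _ _ γH, hγ⟩).1 : AddChar A ℂ)
  /-- (ix′)∕(xi″) at `∞`: admissibility of `m^{G′}_∞`, `m_∞`, `m^H_∞`, non-degeneracy of `Tinf`, existence of the inner and Δ_∞-transfers — the first six
  clauses of ★ `ArchTransfersExistCanonical`'s body VERBATIM over the fields [(14.2.1) p. 232; §14.3 p. 234] -/
  harch : letI : ∀ γ : GpInf L H, MeasurableSpace (GpInf L H ⧸ Subgroup.centralizer ({γ} : Set (GpInf L H))) := fun _ => borel _;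
    haveI : ∀ γ : GpInf L H, BorelSpace (GpInf L H ⧸ Subgroup.centralizer ({γ} : Set (GpInf L H))) := fun _ => ⟨rfl⟩;
    letI : ∀ γ : GInf L, MeasurableSpace (GInf L ⧸ Subgroup.centralizer ({γ} : Set (GInf L))) := fun _ => borel _;
    haveI : ∀ γ : GInf L, BorelSpace (GInf L ⧸ Subgroup.centralizer ({γ} : Set (GInf L))) := fun _ => ⟨rfl⟩;
    letI : ∀ a : HInf L, MeasurableSpace (HInf L ⧸ Subgroup.centralizer ({a} : Set (HInf L))) := fun _ => borel _;
    haveI : ∀ a : HInf L, BorelSpace (HInf L ⧸ Subgroup.centralizer ({a} : Set (HInf L))) := fun _ => ⟨rfl⟩;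
    mGi.IsAdmissibleOn (fun γ => Literature.NumberTheory.Rogawski1990.IsRegularElt (γ.val : GL (Fin 3) (NumberField.mixedEmbedding.mixedSpace L))) ∧
      mqi.IsAdmissibleOn (fun γ => Literature.NumberTheory.Rogawski1990.IsRegularElt (γ.val : GL (Fin 3) (NumberField.mixedEmbedding.mixedSpace L))) ∧
      mHi.IsAdmissibleOn (Literature.NumberTheory.Rogawski1990.IsArchGRegular L) ∧
      Literature.NumberTheory.Rogawski1990.IsArchNondegenerate L H Tinf ∧
      Literature.NumberTheory.Rogawski1990.IsArchInnerTransferExists L H mGi mqi (Literature.NumberTheory.Rogawski1990.ArchSmooth L 3 H)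
        (Literature.NumberTheory.Rogawski1990.ArchSmooth L 3 (Matrix.of fun i j : Fin 3 => if i.val + j.val + 1 = 3 then (1 : L) else 0)) ∧
      Literature.NumberTheory.Rogawski1990.IsArchDeltaTransferExists L H Tinf mHi mGi (Literature.NumberTheory.Rogawski1990.ArchSmooth L 3 H)
        (Literature.NumberTheory.Rogawski1990.ArchSmooth₂ L)
  /-- (xii) the torus coherence (W′)(W)(W_H)(C′)(C)(C′G)(C_H) of `t′, t, t_H` with the archimedean families — the last seven clauses of ★
  `ArchTransfersExistCanonical`'s body, by the NAME `ArchTorusCoherence` [§14.3 p. 234; §4.3 p. 43] -/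
  hcoh : ArchTorusCoherence L H hanis mGi mqi mHi νGi νqi νHi t' t tH
  /-- (viii′-2) `μA` is admissible at EVERY rational class [§14.5 p. 237] -/
  hμA : letI : ∀ g : GpAdelic L H, MeasurableSpace (GpAdelic L H ⧸ Subgroup.centralizer ({g} : Set (GpAdelic L H))) := fun _ => borel _;
    ∀ c : ConjClasses (UnitaryGroup.cmDatum L 3 H).Rational,
      SMulInvariantMeasure (GpAdelic L H) _ (μA c) ∧ IsFiniteMeasureOnCompacts (μA c) ∧ μA c ≠ 0
  /-- (viii⁗) finite support of `Φ_{μA}(·, f′)` on the rational classes -/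
  hsupp : letI : ∀ g : GpAdelic L H, MeasurableSpace (GpAdelic L H ⧸ Subgroup.centralizer ({g} : Set (GpAdelic L H))) := fun _ => borel _;
    ∀ f' : TestGp L H, (Function.support (UnitaryGroup.adelicClassOrbitalIntegral L 3 H μA f')).Finite
  /-- (viii″)∕T1a the WEIGHT-FREE O-expansion of `θ_{G′} = diagTrace` over the stable classes [§14.5 pp. 237–238] -/
  hJeq : letI : ∀ g : GpAdelic L H, MeasurableSpace (GpAdelic L H ⧸ Subgroup.centralizer ({g} : Set (GpAdelic L H))) := fun _ => borel _;
    ∀ f' : TestGp L H, UnitaryGroup.diagTrace L 3 H μ ν hanis f' =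
      ∑ᶠ st : Literature.NumberTheory.Rogawski1990.StableClass (cmConjRingHom L) H,
        st.orbitalSum (UnitaryGroup.adelicClassOrbitalIntegral L 3 H μA f')
  /-- (xiv) (ed. 1.19b₁) `mG` is normalised off a finite set at every regular rational class [§4.3 pp. 43–44] -/
  hnorm : letI : ∀ (v : HeightOneSpectrum (𝓞 ↥(maximalRealSubfield L))) (γ : (UnitaryGroup.cmDatum L 3 H).Local v),
        MeasurableSpace ((UnitaryGroup.cmDatum L 3 H).Local v ⧸
          Subgroup.centralizer ({γ} : Set ((UnitaryGroup.cmDatum L 3 H).Local v))) := fun _ _ => borel _;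
    ∀ c : ConjClasses (UnitaryGroup.cmDatum L 3 H).Rational,
      Literature.NumberTheory.Rogawski1990.IsRegularElt ((Quotient.out c).val : GL (Fin 3) L) →
        ∃ S₀ : Finset (HeightOneSpectrum (𝓞 ↥(maximalRealSubfield L))),
          UnitaryGroup.IsNormalisedOff L 3 H mG ((UnitaryGroup.cmDatum L 3 H).toAdelic (Quotient.out c)) S₀
  /-- (viii⁵) (ed. 1.23) the stable-class weight `α = a(𝒪_st) > 0` of the β-pin [§4.3 (4.3.2) p. 44; §5.4 (5.4.1) p. 72] -/
  α : Literature.NumberTheory.Rogawski1990.StableClass (cmConjRingHom L) H → ℝ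
  /-- (viii′)∕(viii⁵) positivity of the stable-class weight -/
  hα : ∀ 𝒪, 0 < α 𝒪
  /-- (viii⁵) (ed. 1.23; sharpens (viii‴) of ed. 1.19b₂) the STABLE β-socket: at the regular classes `μA c = α(𝒪_st c) • ofLocal mG mGi c` [§4.3 pp. 43–44; §5.4 p. 72] -/
  hβ : letI : ∀ g : GpAdelic L H, MeasurableSpace (GpAdelic L H ⧸ Subgroup.centralizer ({g} : Set (GpAdelic L H))) := fun _ => borel _;
    letI : ∀ γ : GpInf L H, MeasurableSpace (GpInf L H ⧸ Subgroup.centralizer ({γ} : Set (GpInf L H))) := fun _ => borel _;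
    letI : ∀ (v : HeightOneSpectrum (𝓞 ↥(maximalRealSubfield L))) (γ : (UnitaryGroup.cmDatum L 3 H).Local v),
        MeasurableSpace ((UnitaryGroup.cmDatum L 3 H).Local v ⧸
          Subgroup.centralizer ({γ} : Set ((UnitaryGroup.cmDatum L 3 H).Local v))) := fun _ _ => borel _;
    ∀ c : ConjClasses (UnitaryGroup.cmDatum L 3 H).Rational,
      Literature.NumberTheory.Rogawski1990.IsRegularElt ((Quotient.out c).val : GL (Fin 3) L) →
        μA c = ENNReal.ofReal (α (Literature.NumberTheory.Rogawski1990.StableClass.ofConjClass c)) •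
          UnitaryGroup.AdelicOrbitalMeasureFamily.ofLocal L 3 H mG mGi c
  /-- (vii-c) (ed. 1.24a (F-0)) `ψ_v` is matrix conjugation `g ↦ S⁻¹ g S` [§14.1 p. 232] -/
  hconjS : ∀ v : HeightOneSpectrum (𝓞 ↥(maximalRealSubfield L)), ∃ S : GL (Fin 3) (UnitaryGroup.LocalRing L v),
    ∀ g : (UnitaryGroup.cmDatum L 3 H).Local v, ((ψ₀ v g).val : GL (Fin 3) (UnitaryGroup.LocalRing L v)) = S⁻¹ * g.val * S
  /-- (xii-s) (ed. 1.24a (F-0)) the archimedean MATRIX of ★ `ArchTransfersExistCanonicalSingular` BY NAME at the fields: (i)–(vi), (W′)(W)(W_H),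
  (C′)(C)(C′G)(C_H) and the central-value clauses (S-c) [Lemma 14.5.2 (c)] ∕ (S-d) [§14.5 p. 239] (`.centralH_vanish` ∕ `.central_value`) -/
  hACS : letI : ∀ γ : GpInf L H, MeasurableSpace (GpInf L H ⧸ Subgroup.centralizer ({γ} : Set (GpInf L H))) := fun _ => borel _
    haveI : ∀ γ : GpInf L H, BorelSpace (GpInf L H ⧸ Subgroup.centralizer ({γ} : Set (GpInf L H))) := fun _ => ⟨rfl⟩
    letI : ∀ γ : GInf L, MeasurableSpace (GInf L ⧸ Subgroup.centralizer ({γ} : Set (GInf L))) := fun _ => borel _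
    haveI : ∀ γ : GInf L, BorelSpace (GInf L ⧸ Subgroup.centralizer ({γ} : Set (GInf L))) := fun _ => ⟨rfl⟩
    letI : ∀ a : HInf L, MeasurableSpace (HInf L ⧸ Subgroup.centralizer ({a} : Set (HInf L))) := fun _ => borel _
    haveI : ∀ a : HInf L, BorelSpace (HInf L ⧸ Subgroup.centralizer ({a} : Set (HInf L))) := fun _ => ⟨rfl⟩
    Literature.NumberTheory.Rogawski1990.ArchCanonicalSingularMatrix L H Tinf νGi νqi νHi hanis mGi mqi mHi t' t tH
  /-- (xv-s) (ed. 1.24, F0P3a-plan RULING #115 (F1′)) the SINGULAR local members `m^{G′,s}_v` of the singular elliptic transfer package [§14.5 p. 239; Kottwitz1988 Thm. 1] -/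
  mGs : letI : ∀ (v : HeightOneSpectrum (𝓞 ↥(maximalRealSubfield L))) (γ : (UnitaryGroup.cmDatum L 3 H).Local v),
        MeasurableSpace ((UnitaryGroup.cmDatum L 3 H).Local v ⧸
          Subgroup.centralizer ({γ} : Set ((UnitaryGroup.cmDatum L 3 H).Local v))) := fun _ _ => borel _;
    ∀ v, OrbitalMeasureFamily ((UnitaryGroup.cmDatum L 3 H).Local v)
  /-- (xv-s) the singular archimedean members `m^{G′,s}_∞` on `G′_∞` -/
  mGis : letI : ∀ γ : GpInf L H, MeasurableSpace (GpInf L H ⧸ Subgroup.centralizer ({γ} : Set (GpInf L H))) := fun _ => borel _;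
    OrbitalMeasureFamily (GpInf L H)
  /-- (xv-s) the singular archimedean members `m^s_∞` on `G_∞ = U(Φ₃)_∞` -/
  mqis : letI : ∀ γ : GInf L, MeasurableSpace (GInf L ⧸ Subgroup.centralizer ({γ} : Set (GInf L))) := fun _ => borel _;
    OrbitalMeasureFamily (GInf L)
  /-- (xv-s) the six clauses (ADM)(NORM)(CEN)(K7-s)(ST-∞)(κ-MASS) of ★ `SingularEllipticTransferCanonical` for the members, read against the REGULAR data
  (★ `SingularTransferMembers`; paths `.1` ADM, `.2.1` NORM, `.2.2.1` CEN, `.2.2.2.1` K7-s, `.2.2.2.2.1` ST-∞, `.2.2.2.2.2` κ-MASS) [Lemma 14.5.2 (b); Kottwitz1988 Thm. 1, Prop. 2] -/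
  hS :
    letI : ∀ (v : HeightOneSpectrum (𝓞 ↥(maximalRealSubfield L))) (γ : (UnitaryGroup.cmDatum L 3 H).Local v),
        MeasurableSpace ((UnitaryGroup.cmDatum L 3 H).Local v ⧸
          Subgroup.centralizer ({γ} : Set ((UnitaryGroup.cmDatum L 3 H).Local v))) := fun _ _ => borel _;
    haveI : ∀ (v : HeightOneSpectrum (𝓞 ↥(maximalRealSubfield L))) (γ : (UnitaryGroup.cmDatum L 3 H).Local v),
        BorelSpace ((UnitaryGroup.cmDatum L 3 H).Local v ⧸
          Subgroup.centralizer ({γ} : Set ((UnitaryGroup.cmDatum L 3 H).Local v))) := fun _ _ => ⟨rfl⟩;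
    letI : ∀ g : GpAdelic L H, MeasurableSpace (GpAdelic L H ⧸ Subgroup.centralizer ({g} : Set (GpAdelic L H))) := fun _ => borel _;
    haveI : ∀ g : GpAdelic L H, BorelSpace (GpAdelic L H ⧸ Subgroup.centralizer ({g} : Set (GpAdelic L H))) := fun _ => ⟨rfl⟩;
    letI : ∀ γ : GpInf L H, MeasurableSpace (GpInf L H ⧸ Subgroup.centralizer ({γ} : Set (GpInf L H))) := fun _ => borel _;
    haveI : ∀ γ : GpInf L H, BorelSpace (GpInf L H ⧸ Subgroup.centralizer ({γ} : Set (GpInf L H))) := fun _ => ⟨rfl⟩;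
    letI : ∀ γ : GInf L, MeasurableSpace (GInf L ⧸ Subgroup.centralizer ({γ} : Set (GInf L))) := fun _ => borel _;
    haveI : ∀ γ : GInf L, BorelSpace (GInf L ⧸ Subgroup.centralizer ({γ} : Set (GInf L))) := fun _ => ⟨rfl⟩;
    letI : ∀ (v : HeightOneSpectrum (𝓞 ↥(maximalRealSubfield L))) (a : HLocal L v),
        MeasurableSpace (HLocal L v ⧸ Subgroup.centralizer ({a} : Set (HLocal L v))) := fun _ _ => borel _;
    haveI : ∀ (v : HeightOneSpectrum (𝓞 ↥(maximalRealSubfield L))) (a : HLocal L v),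
        BorelSpace (HLocal L v ⧸ Subgroup.centralizer ({a} : Set (HLocal L v))) := fun _ _ => ⟨rfl⟩;
    letI : ∀ a : HInf L, MeasurableSpace (HInf L ⧸ Subgroup.centralizer ({a} : Set (HInf L))) := fun _ => borel _;
    haveI : ∀ a : HInf L, BorelSpace (HInf L ⧸ Subgroup.centralizer ({a} : Set (HInf L))) := fun _ => ⟨rfl⟩;
    letI : ∀ γ : GpAdelic L H, MeasurableSpace (↥(Subgroup.centralizer ({γ} : Set (GpAdelic L H))) ⧸
        ((UnitaryGroup.cmDatum L 3 H).quotientSubgroup ⊓ Subgroup.centralizer ({γ} : Set (GpAdelic L H))).subgroupOf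
          (Subgroup.centralizer ({γ} : Set (GpAdelic L H)))) := fun _ => borel _;
    haveI : ∀ γ : GpAdelic L H, BorelSpace (↥(Subgroup.centralizer ({γ} : Set (GpAdelic L H))) ⧸
        ((UnitaryGroup.cmDatum L 3 H).quotientSubgroup ⊓ Subgroup.centralizer ({γ} : Set (GpAdelic L H))).subgroupOf
          (Subgroup.centralizer ({γ} : Set (GpAdelic L H)))) := fun _ => ⟨rfl⟩;
    haveI hCcl : ∀ γ : GpAdelic L H, IsClosed ((Subgroup.centralizer ({γ} : Set (GpAdelic L H)) : Subgroup (GpAdelic L H)) : Set (GpAdelic L H)) :=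
      fun γ => UnitaryGroup.isClosed_centralizer_cmDatum L 3 H γ;
    haveI : ∀ γ : GpAdelic L H, (Measure.count : Measure ↥(((UnitaryGroup.cmDatum L 3 H).quotientSubgroup ⊓
        Subgroup.centralizer ({γ} : Set (GpAdelic L H))).subgroupOf (Subgroup.centralizer ({γ} : Set (GpAdelic L H))))).IsHaarMeasure :=
      fun γ => UnitaryGroup.isHaarMeasure_count_quotientSubgroup_inf_centralizer_subgroupOf L 3 H γ;
    haveI : ν.IsMulRightInvariant := by
      have h : ν.inv.IsMulRightInvariant := inferInstance
      rwa [Measure.inv_eq_self] at h;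
    Literature.NumberTheory.Rogawski1990.SingularTransferMembers L H Tinf ν Δ mH mG mGi mqi mHi mGs mGis mqis
  /-- (viii⁵∕viii⁵-s) (ed. 1.24) the β-socket at EVERY rational class for the PATCHED families «regular ↦ canonical member, non-regular ↦ singular member»:
  `μA c = α(𝒪_st c) • ofLocal m^{G′,p} m^{G′,p}_∞ c` [§4.3 (4.3.1)–(4.3.2); §5.4 (5.4.1); §14.5 p. 239] -/
  hβp : letI : ∀ g : GpAdelic L H, MeasurableSpace (GpAdelic L H ⧸ Subgroup.centralizer ({g} : Set (GpAdelic L H))) := fun _ => borel _;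
    letI : ∀ γ : GpInf L H, MeasurableSpace (GpInf L H ⧸ Subgroup.centralizer ({γ} : Set (GpInf L H))) := fun _ => borel _;
    letI : ∀ (v : HeightOneSpectrum (𝓞 ↥(maximalRealSubfield L))) (γ : (UnitaryGroup.cmDatum L 3 H).Local v),
        MeasurableSpace ((UnitaryGroup.cmDatum L 3 H).Local v ⧸
          Subgroup.centralizer ({γ} : Set ((UnitaryGroup.cmDatum L 3 H).Local v))) := fun _ _ => borel _;
    ∀ c : ConjClasses (UnitaryGroup.cmDatum L 3 H).Rational,
      μA c = ENNReal.ofReal (α (Literature.NumberTheory.Rogawski1990.StableClass.ofConjClass c)) •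
        UnitaryGroup.AdelicOrbitalMeasureFamily.ofLocal L 3 H
          (fun v c' => if Literature.NumberTheory.Rogawski1990.IsRegularElt ((Quotient.out c').val : GL (Fin 3) (UnitaryGroup.LocalRing L v)) then mG v c' else mGs v c')
          (fun c' => if Literature.NumberTheory.Rogawski1990.IsRegularElt ((Quotient.out c').val : GL (Fin 3) (NumberField.mixedEmbedding.mixedSpace L)) then mGi c' else mGis c') c
  /-- (viii⁵-s∕viii⁵-c) the β-socket at the NON-regular classes reads the singular members: `μA c = α(𝒪_st c) • ofLocal m^{G′,s} m^{G′,s}_∞ c` -/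
  hβs : letI : ∀ g : GpAdelic L H, MeasurableSpace (GpAdelic L H ⧸ Subgroup.centralizer ({g} : Set (GpAdelic L H))) := fun _ => borel _;
    letI : ∀ γ : GpInf L H, MeasurableSpace (GpInf L H ⧸ Subgroup.centralizer ({γ} : Set (GpInf L H))) := fun _ => borel _;
    letI : ∀ (v : HeightOneSpectrum (𝓞 ↥(maximalRealSubfield L))) (γ : (UnitaryGroup.cmDatum L 3 H).Local v),
        MeasurableSpace ((UnitaryGroup.cmDatum L 3 H).Local v ⧸
          Subgroup.centralizer ({γ} : Set ((UnitaryGroup.cmDatum L 3 H).Local v))) := fun _ _ => borel _;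
    ∀ c : ConjClasses (UnitaryGroup.cmDatum L 3 H).Rational,
      ¬ Literature.NumberTheory.Rogawski1990.IsRegularElt ((Quotient.out c).val : GL (Fin 3) L) →
        μA c = ENNReal.ofReal (α (Literature.NumberTheory.Rogawski1990.StableClass.ofConjClass c)) •
          UnitaryGroup.AdelicOrbitalMeasureFamily.ofLocal L 3 H mGs mGis c
  /-- (ed. 1.24) `H` is hermitian — carried for the singular-class anchors (split-singular ⇒ non-regular, ★ `not_isRegularElt_of_mul_sub_eq_zero`) -/
  hH : IsHermitianCM L H

namespace AnchorWitness

variable {L H μ ν}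
variable {νH : ∀ v : HeightOneSpectrum (𝓞 ↥(maximalRealSubfield L)), Measure (HLocal L v)} {νG : ∀ v : HeightOneSpectrum (𝓞 ↥(maximalRealSubfield L)), Measure (GpLocal L H v)}
  [∀ v, IsFiniteMeasureOnCompacts (νH v)] [∀ v, (νH v).IsMulRightInvariant]
  [∀ v, IsFiniteMeasureOnCompacts (νG v)] [∀ v, (νG v).IsMulRightInvariant]
  {νGi : Measure (GpInf L H)} {νqi : Measure (GInf L)} {νHi : Measure (HInf L)}
  [IsFiniteMeasureOnCompacts νGi] [νGi.IsMulRightInvariant] [IsFiniteMeasureOnCompacts νqi] [νqi.IsMulRightInvariant]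
  [IsFiniteMeasureOnCompacts νHi] [νHi.IsMulRightInvariant]
  {Tinf : Literature.NumberTheory.Rogawski1990.ArchTransferFactor L H} {hanis : IsAnisotropic L H}
  (w : AnchorWitness L H μ ν νH νG νGi νqi νHi Tinf hanis)

open scoped Classical in
/-- **(ed. 1.24, RULING #115 (F1′)) THE PATCHED LOCAL FAMILIES `m^{G′,p}_v`**: the canonical member at the regular classes, the singular package's member at the
others; the KIT reads these. [cite: Rogawski1990, §4.3 (4.3.1) p. 43; §14.5 p. 239] -/
def mGp : letI : ∀ (v : HeightOneSpectrum (𝓞 ↥(maximalRealSubfield L))) (γ : (UnitaryGroup.cmDatum L 3 H).Local v),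
        MeasurableSpace ((UnitaryGroup.cmDatum L 3 H).Local v ⧸
          Subgroup.centralizer ({γ} : Set ((UnitaryGroup.cmDatum L 3 H).Local v))) := fun _ _ => borel _;
    ∀ v, OrbitalMeasureFamily ((UnitaryGroup.cmDatum L 3 H).Local v) :=
  fun v c' => if Literature.NumberTheory.Rogawski1990.IsRegularElt ((Quotient.out c').val : GL (Fin 3) (UnitaryGroup.LocalRing L v)) then w.mG v c' else w.mGs v c'

open scoped Classical in
/-- **(ed. 1.24) THE PATCHED ARCHIMEDEAN FAMILY `m^{G′,p}_∞`** on `G′_∞`. [cite: Rogawski1990, §14.2 (14.2.1) p. 232; §14.5 p. 239] -/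
def mGip : letI : ∀ γ : GpInf L H, MeasurableSpace (GpInf L H ⧸ Subgroup.centralizer ({γ} : Set (GpInf L H))) := fun _ => borel _;
    OrbitalMeasureFamily (GpInf L H) :=
  fun c' => if Literature.NumberTheory.Rogawski1990.IsRegularElt ((Quotient.out c').val : GL (Fin 3) (NumberField.mixedEmbedding.mixedSpace L)) then w.mGi c' else w.mGis c'

open scoped Classical in
/-- **(ed. 1.24) THE PATCHED ARCHIMEDEAN FAMILY `m^p_∞`** on `G_∞ = U(Φ₃)_∞`. [cite: Rogawski1990, §14.2 (14.2.1) p. 232; §14.5 p. 239] -/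
def mqip : letI : ∀ γ : GInf L, MeasurableSpace (GInf L ⧸ Subgroup.centralizer ({γ} : Set (GInf L))) := fun _ => borel _;
    OrbitalMeasureFamily (GInf L) :=
  fun c' => if Literature.NumberTheory.Rogawski1990.IsRegularElt ((Quotient.out c').val : GL (Fin 3) (NumberField.mixedEmbedding.mixedSpace L)) then w.mqi c' else w.mqis c'

/-- `m^{G′,p}_v = m^{G′}_v` at the regular classes. [cite: Rogawski1990, §4.3 (4.3.1) p. 43] -/
theorem mGp_of_isRegularElt (v : HeightOneSpectrum (𝓞 ↥(maximalRealSubfield L))) (c' : ConjClasses ((UnitaryGroup.cmDatum L 3 H).Local v))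
    (hc : Literature.NumberTheory.Rogawski1990.IsRegularElt ((Quotient.out c').val : GL (Fin 3) (UnitaryGroup.LocalRing L v))) : w.mGp v c' = w.mG v c' := if_pos hc

/-- `m^{G′,p}_v = m^{G′,s}_v` off the regular classes. [cite: Rogawski1990, §14.5 p. 239] -/
theorem mGp_of_not_isRegularElt (v : HeightOneSpectrum (𝓞 ↥(maximalRealSubfield L))) (c' : ConjClasses ((UnitaryGroup.cmDatum L 3 H).Local v))
    (hc : ¬ Literature.NumberTheory.Rogawski1990.IsRegularElt ((Quotient.out c').val : GL (Fin 3) (UnitaryGroup.LocalRing L v))) : w.mGp v c' = w.mGs v c' := if_neg hc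

/-- `m^{G′,p}_∞ = m^{G′}_∞` at the regular classes. [cite: Rogawski1990, §14.2 (14.2.1) p. 232] -/
theorem mGip_of_isRegularElt (c' : ConjClasses (GpInf L H)) (hc : Literature.NumberTheory.Rogawski1990.IsRegularElt ((Quotient.out c').val : GL (Fin 3) (NumberField.mixedEmbedding.mixedSpace L))) : w.mGip c' = w.mGi c' := if_pos hc

/-- `m^{G′,p}_∞ = m^{G′,s}_∞` off the regular classes. [cite: Rogawski1990, §14.5 p. 239] -/
theorem mGip_of_not_isRegularElt (c' : ConjClasses (GpInf L H)) (hc : ¬ Literature.NumberTheory.Rogawski1990.IsRegularElt ((Quotient.out c').val : GL (Fin 3) (NumberField.mixedEmbedding.mixedSpace L))) : w.mGip c' = w.mGis c' := if_neg hc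

/-- `m^p_∞ = m_∞` at the regular classes. [cite: Rogawski1990, §14.2 (14.2.1) p. 232] -/
theorem mqip_of_isRegularElt (c' : ConjClasses (GInf L)) (hc : Literature.NumberTheory.Rogawski1990.IsRegularElt ((Quotient.out c').val : GL (Fin 3) (NumberField.mixedEmbedding.mixedSpace L))) : w.mqip c' = w.mqi c' := if_pos hc

/-- `m^p_∞ = m^s_∞` off the regular classes. [cite: Rogawski1990, §14.5 p. 239] -/
theorem mqip_of_not_isRegularElt (c' : ConjClasses (GInf L)) (hc : ¬ Literature.NumberTheory.Rogawski1990.IsRegularElt ((Quotient.out c').val : GL (Fin 3) (NumberField.mixedEmbedding.mixedSpace L))) : w.mqip c' = w.mqis c' := if_neg hc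

/-- **(ed. 1.24) `Cs` — the κ-MASS constant of the singular package as a function of the datum** `(γ₀, e₁, e₂, γH)` (★ `SingularTransferMembers.kappaConst`;
`1` off the (κ-MASS) hypotheses). [cite: Rogawski1990, §14.5 Lemma 14.5.2 (b) p. 239; Prop. 8.2.1 (a) p. 117] -/
def Cs (γ₀ : (UnitaryGroup.cmDatum L 3 H).Rational) (e₁ e₂ : L)
    (γH : (UnitaryGroup.cmDatum L 2 (splitForm L 2)).Rational × (UnitaryGroup.cmDatum L 1 (splitForm L 1)).Rational) : ℝ := by
    letI : ∀ (v : HeightOneSpectrum (𝓞 ↥(maximalRealSubfield L))) (γ : (UnitaryGroup.cmDatum L 3 H).Local v),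
        MeasurableSpace ((UnitaryGroup.cmDatum L 3 H).Local v ⧸
          Subgroup.centralizer ({γ} : Set ((UnitaryGroup.cmDatum L 3 H).Local v))) := fun _ _ => borel _
    haveI : ∀ (v : HeightOneSpectrum (𝓞 ↥(maximalRealSubfield L))) (γ : (UnitaryGroup.cmDatum L 3 H).Local v),
        BorelSpace ((UnitaryGroup.cmDatum L 3 H).Local v ⧸
          Subgroup.centralizer ({γ} : Set ((UnitaryGroup.cmDatum L 3 H).Local v))) := fun _ _ => ⟨rfl⟩
    letI : ∀ g : GpAdelic L H, MeasurableSpace (GpAdelic L H ⧸ Subgroup.centralizer ({g} : Set (GpAdelic L H))) := fun _ => borel _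
    haveI : ∀ g : GpAdelic L H, BorelSpace (GpAdelic L H ⧸ Subgroup.centralizer ({g} : Set (GpAdelic L H))) := fun _ => ⟨rfl⟩
    letI : ∀ γ : GpInf L H, MeasurableSpace (GpInf L H ⧸ Subgroup.centralizer ({γ} : Set (GpInf L H))) := fun _ => borel _
    haveI : ∀ γ : GpInf L H, BorelSpace (GpInf L H ⧸ Subgroup.centralizer ({γ} : Set (GpInf L H))) := fun _ => ⟨rfl⟩
    letI : ∀ γ : GInf L, MeasurableSpace (GInf L ⧸ Subgroup.centralizer ({γ} : Set (GInf L))) := fun _ => borel _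
    haveI : ∀ γ : GInf L, BorelSpace (GInf L ⧸ Subgroup.centralizer ({γ} : Set (GInf L))) := fun _ => ⟨rfl⟩
    letI : ∀ (v : HeightOneSpectrum (𝓞 ↥(maximalRealSubfield L))) (a : HLocal L v),
        MeasurableSpace (HLocal L v ⧸ Subgroup.centralizer ({a} : Set (HLocal L v))) := fun _ _ => borel _
    haveI : ∀ (v : HeightOneSpectrum (𝓞 ↥(maximalRealSubfield L))) (a : HLocal L v),
        BorelSpace (HLocal L v ⧸ Subgroup.centralizer ({a} : Set (HLocal L v))) := fun _ _ => ⟨rfl⟩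
    letI : ∀ a : HInf L, MeasurableSpace (HInf L ⧸ Subgroup.centralizer ({a} : Set (HInf L))) := fun _ => borel _
    haveI : ∀ a : HInf L, BorelSpace (HInf L ⧸ Subgroup.centralizer ({a} : Set (HInf L))) := fun _ => ⟨rfl⟩
    letI : ∀ γ : GpAdelic L H, MeasurableSpace (↥(Subgroup.centralizer ({γ} : Set (GpAdelic L H))) ⧸
        ((UnitaryGroup.cmDatum L 3 H).quotientSubgroup ⊓ Subgroup.centralizer ({γ} : Set (GpAdelic L H))).subgroupOf
          (Subgroup.centralizer ({γ} : Set (GpAdelic L H)))) := fun _ => borel _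
    haveI : ∀ γ : GpAdelic L H, BorelSpace (↥(Subgroup.centralizer ({γ} : Set (GpAdelic L H))) ⧸
        ((UnitaryGroup.cmDatum L 3 H).quotientSubgroup ⊓ Subgroup.centralizer ({γ} : Set (GpAdelic L H))).subgroupOf
          (Subgroup.centralizer ({γ} : Set (GpAdelic L H)))) := fun _ => ⟨rfl⟩
    haveI hCcl : ∀ γ : GpAdelic L H, IsClosed ((Subgroup.centralizer ({γ} : Set (GpAdelic L H)) : Subgroup (GpAdelic L H)) : Set (GpAdelic L H)) :=
      fun γ => UnitaryGroup.isClosed_centralizer_cmDatum L 3 H γ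
    haveI : ∀ γ : GpAdelic L H, (Measure.count : Measure ↥(((UnitaryGroup.cmDatum L 3 H).quotientSubgroup ⊓
        Subgroup.centralizer ({γ} : Set (GpAdelic L H))).subgroupOf (Subgroup.centralizer ({γ} : Set (GpAdelic L H))))).IsHaarMeasure :=
      fun γ => UnitaryGroup.isHaarMeasure_count_quotientSubgroup_inf_centralizer_subgroupOf L 3 H γ
    haveI : ν.IsMulRightInvariant := by
      have h : ν.inv.IsMulRightInvariant := inferInstance
      rwa [Measure.inv_eq_self] at h
    exact w.hS.kappaConst γ₀ e₁ e₂ γH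

/-- `Cs > 0`. [cite: Rogawski1990, §14.5 Lemma 14.5.2 (b) p. 239] -/
theorem Cs_pos (γ₀ : (UnitaryGroup.cmDatum L 3 H).Rational) (e₁ e₂ : L)
    (γH : (UnitaryGroup.cmDatum L 2 (splitForm L 2)).Rational × (UnitaryGroup.cmDatum L 1 (splitForm L 1)).Rational) : 0 < w.Cs γ₀ e₁ e₂ γH := by
    letI : ∀ (v : HeightOneSpectrum (𝓞 ↥(maximalRealSubfield L))) (γ : (UnitaryGroup.cmDatum L 3 H).Local v),
        MeasurableSpace ((UnitaryGroup.cmDatum L 3 H).Local v ⧸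
          Subgroup.centralizer ({γ} : Set ((UnitaryGroup.cmDatum L 3 H).Local v))) := fun _ _ => borel _
    haveI : ∀ (v : HeightOneSpectrum (𝓞 ↥(maximalRealSubfield L))) (γ : (UnitaryGroup.cmDatum L 3 H).Local v),
        BorelSpace ((UnitaryGroup.cmDatum L 3 H).Local v ⧸
          Subgroup.centralizer ({γ} : Set ((UnitaryGroup.cmDatum L 3 H).Local v))) := fun _ _ => ⟨rfl⟩
    letI : ∀ g : GpAdelic L H, MeasurableSpace (GpAdelic L H ⧸ Subgroup.centralizer ({g} : Set (GpAdelic L H))) := fun _ => borel _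
    haveI : ∀ g : GpAdelic L H, BorelSpace (GpAdelic L H ⧸ Subgroup.centralizer ({g} : Set (GpAdelic L H))) := fun _ => ⟨rfl⟩
    letI : ∀ γ : GpInf L H, MeasurableSpace (GpInf L H ⧸ Subgroup.centralizer ({γ} : Set (GpInf L H))) := fun _ => borel _
    haveI : ∀ γ : GpInf L H, BorelSpace (GpInf L H ⧸ Subgroup.centralizer ({γ} : Set (GpInf L H))) := fun _ => ⟨rfl⟩
    letI : ∀ γ : GInf L, MeasurableSpace (GInf L ⧸ Subgroup.centralizer ({γ} : Set (GInf L))) := fun _ => borel _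
    haveI : ∀ γ : GInf L, BorelSpace (GInf L ⧸ Subgroup.centralizer ({γ} : Set (GInf L))) := fun _ => ⟨rfl⟩
    letI : ∀ (v : HeightOneSpectrum (𝓞 ↥(maximalRealSubfield L))) (a : HLocal L v),
        MeasurableSpace (HLocal L v ⧸ Subgroup.centralizer ({a} : Set (HLocal L v))) := fun _ _ => borel _
    haveI : ∀ (v : HeightOneSpectrum (𝓞 ↥(maximalRealSubfield L))) (a : HLocal L v),
        BorelSpace (HLocal L v ⧸ Subgroup.centralizer ({a} : Set (HLocal L v))) := fun _ _ => ⟨rfl⟩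
    letI : ∀ a : HInf L, MeasurableSpace (HInf L ⧸ Subgroup.centralizer ({a} : Set (HInf L))) := fun _ => borel _
    haveI : ∀ a : HInf L, BorelSpace (HInf L ⧸ Subgroup.centralizer ({a} : Set (HInf L))) := fun _ => ⟨rfl⟩
    letI : ∀ γ : GpAdelic L H, MeasurableSpace (↥(Subgroup.centralizer ({γ} : Set (GpAdelic L H))) ⧸
        ((UnitaryGroup.cmDatum L 3 H).quotientSubgroup ⊓ Subgroup.centralizer ({γ} : Set (GpAdelic L H))).subgroupOf
          (Subgroup.centralizer ({γ} : Set (GpAdelic L H)))) := fun _ => borel _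
    haveI : ∀ γ : GpAdelic L H, BorelSpace (↥(Subgroup.centralizer ({γ} : Set (GpAdelic L H))) ⧸
        ((UnitaryGroup.cmDatum L 3 H).quotientSubgroup ⊓ Subgroup.centralizer ({γ} : Set (GpAdelic L H))).subgroupOf
          (Subgroup.centralizer ({γ} : Set (GpAdelic L H)))) := fun _ => ⟨rfl⟩
    haveI hCcl : ∀ γ : GpAdelic L H, IsClosed ((Subgroup.centralizer ({γ} : Set (GpAdelic L H)) : Subgroup (GpAdelic L H)) : Set (GpAdelic L H)) :=
      fun γ => UnitaryGroup.isClosed_centralizer_cmDatum L 3 H γ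
    haveI : ∀ γ : GpAdelic L H, (Measure.count : Measure ↥(((UnitaryGroup.cmDatum L 3 H).quotientSubgroup ⊓
        Subgroup.centralizer ({γ} : Set (GpAdelic L H))).subgroupOf (Subgroup.centralizer ({γ} : Set (GpAdelic L H))))).IsHaarMeasure :=
      fun γ => UnitaryGroup.isHaarMeasure_count_quotientSubgroup_inf_centralizer_subgroupOf L 3 H γ
    haveI : ν.IsMulRightInvariant := by
      have h : ν.inv.IsMulRightInvariant := inferInstance
      rwa [Measure.inv_eq_self] at h
    exact w.hS.kappaConst_pos γ₀ e₁ e₂ γH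

/-- **(ed. 1.24) (xi′)∕(xi‴) FOR THE PATCHED LOCAL FAMILIES** — the field `hloc` moved along ★ `UnitaryGroupPatchedFamiliesTransport` (the regular-class
predicates read regular members only; `mGp = mG` there by `if_pos`). [cite: Rogawski1990, §4.9 Prop. 4.9.1 p. 55; §4.3 (4.3.1) p. 43] -/
theorem hlocP :
    letI : ∀ (v : HeightOneSpectrum (𝓞 ↥(maximalRealSubfield L))) (a : HLocal L v),
        MeasurableSpace (HLocal L v ⧸ Subgroup.centralizer ({a} : Set (HLocal L v))) := fun _ _ => borel _;
    haveI : ∀ (v : HeightOneSpectrum (𝓞 ↥(maximalRealSubfield L))) (a : HLocal L v),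
        BorelSpace (HLocal L v ⧸ Subgroup.centralizer ({a} : Set (HLocal L v))) := fun _ _ => ⟨rfl⟩;
    letI : ∀ (v : HeightOneSpectrum (𝓞 ↥(maximalRealSubfield L))) (γ : (UnitaryGroup.cmDatum L 3 H).Local v),
        MeasurableSpace ((UnitaryGroup.cmDatum L 3 H).Local v ⧸
          Subgroup.centralizer ({γ} : Set ((UnitaryGroup.cmDatum L 3 H).Local v))) := fun _ _ => borel _;
    haveI : ∀ (v : HeightOneSpectrum (𝓞 ↥(maximalRealSubfield L))) (γ : (UnitaryGroup.cmDatum L 3 H).Local v),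
        BorelSpace ((UnitaryGroup.cmDatum L 3 H).Local v ⧸
          Subgroup.centralizer ({γ} : Set ((UnitaryGroup.cmDatum L 3 H).Local v))) := fun _ _ => ⟨rfl⟩;
    ∀ v, Literature.NumberTheory.Rogawski1990.IsLocalTransferDatum L H v (w.Δ v) (w.mH v) (w.mGp v) ∧
      (v ∉ w.Sbad → Literature.NumberTheory.Rogawski1990.IsLocalUnitTransfer L H v (w.Δ v) (w.mH v) (w.mGp v)) ∧
      (w.mH v).IsCanonical (Literature.NumberTheory.Rogawski1990.IsLocalGRegular L v) (νH v) ∧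
      (w.mGp v).IsCanonical (fun γ => Literature.NumberTheory.Rogawski1990.IsRegularElt (γ.val : GL (Fin 3) (UnitaryGroup.LocalRing L v))) (νG v) := by
    letI : ∀ (v : HeightOneSpectrum (𝓞 ↥(maximalRealSubfield L))) (a : HLocal L v),
        MeasurableSpace (HLocal L v ⧸ Subgroup.centralizer ({a} : Set (HLocal L v))) := fun _ _ => borel _
    haveI : ∀ (v : HeightOneSpectrum (𝓞 ↥(maximalRealSubfield L))) (a : HLocal L v),
        BorelSpace (HLocal L v ⧸ Subgroup.centralizer ({a} : Set (HLocal L v))) := fun _ _ => ⟨rfl⟩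
    letI : ∀ (v : HeightOneSpectrum (𝓞 ↥(maximalRealSubfield L))) (γ : (UnitaryGroup.cmDatum L 3 H).Local v),
        MeasurableSpace ((UnitaryGroup.cmDatum L 3 H).Local v ⧸
          Subgroup.centralizer ({γ} : Set ((UnitaryGroup.cmDatum L 3 H).Local v))) := fun _ _ => borel _
    haveI : ∀ (v : HeightOneSpectrum (𝓞 ↥(maximalRealSubfield L))) (γ : (UnitaryGroup.cmDatum L 3 H).Local v),
        BorelSpace ((UnitaryGroup.cmDatum L 3 H).Local v ⧸
          Subgroup.centralizer ({γ} : Set ((UnitaryGroup.cmDatum L 3 H).Local v))) := fun _ _ => ⟨rfl⟩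
    intro v
    obtain ⟨h₁, h₂, h₃, h₄⟩ := w.hloc v
    exact ⟨UnitaryGroup.isLocalTransferDatum_of_eqOn_regular L H v (w.Δ v) (w.mH v) (fun c hc => w.mGp_of_isRegularElt v c hc) h₁,
      fun hv => UnitaryGroup.isLocalUnitTransfer_of_eqOn_regular L H v (w.Δ v) (w.mH v) (fun c hc => w.mGp_of_isRegularElt v c hc) (h₂ hv), h₃,
      OrbitalMeasureFamily.isCanonical_of_eqOn (νG v) (fun c hc => w.mGp_of_isRegularElt v c hc) h₄⟩

/-- **(ed. 1.24) (ix′)∕(xi″) AT `∞` FOR THE PATCHED ARCHIMEDEAN FAMILIES** — the field `harch` moved along ★ `UnitaryGroupPatchedFamiliesTransport`.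
[cite: Rogawski1990, §14.2 (14.2.1) p. 232; §14.3 p. 234] -/
theorem harchP :
    letI : ∀ γ : GpInf L H, MeasurableSpace (GpInf L H ⧸ Subgroup.centralizer ({γ} : Set (GpInf L H))) := fun _ => borel _;
    haveI : ∀ γ : GpInf L H, BorelSpace (GpInf L H ⧸ Subgroup.centralizer ({γ} : Set (GpInf L H))) := fun _ => ⟨rfl⟩;
    letI : ∀ γ : GInf L, MeasurableSpace (GInf L ⧸ Subgroup.centralizer ({γ} : Set (GInf L))) := fun _ => borel _;
    haveI : ∀ γ : GInf L, BorelSpace (GInf L ⧸ Subgroup.centralizer ({γ} : Set (GInf L))) := fun _ => ⟨rfl⟩;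
    letI : ∀ a : HInf L, MeasurableSpace (HInf L ⧸ Subgroup.centralizer ({a} : Set (HInf L))) := fun _ => borel _;
    haveI : ∀ a : HInf L, BorelSpace (HInf L ⧸ Subgroup.centralizer ({a} : Set (HInf L))) := fun _ => ⟨rfl⟩;
    w.mGip.IsAdmissibleOn (fun γ => Literature.NumberTheory.Rogawski1990.IsRegularElt (γ.val : GL (Fin 3) (NumberField.mixedEmbedding.mixedSpace L))) ∧
      w.mqip.IsAdmissibleOn (fun γ => Literature.NumberTheory.Rogawski1990.IsRegularElt (γ.val : GL (Fin 3) (NumberField.mixedEmbedding.mixedSpace L))) ∧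
      w.mHi.IsAdmissibleOn (Literature.NumberTheory.Rogawski1990.IsArchGRegular L) ∧
      Literature.NumberTheory.Rogawski1990.IsArchNondegenerate L H Tinf ∧
      Literature.NumberTheory.Rogawski1990.IsArchInnerTransferExists L H w.mGip w.mqip (Literature.NumberTheory.Rogawski1990.ArchSmooth L 3 H)
        (Literature.NumberTheory.Rogawski1990.ArchSmooth L 3 (Matrix.of fun i j : Fin 3 => if i.val + j.val + 1 = 3 then (1 : L) else 0)) ∧
      Literature.NumberTheory.Rogawski1990.IsArchDeltaTransferExists L H Tinf w.mHi w.mGip (Literature.NumberTheory.Rogawski1990.ArchSmooth L 3 H)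
        (Literature.NumberTheory.Rogawski1990.ArchSmooth₂ L) := by
    letI : ∀ γ : GpInf L H, MeasurableSpace (GpInf L H ⧸ Subgroup.centralizer ({γ} : Set (GpInf L H))) := fun _ => borel _
    haveI : ∀ γ : GpInf L H, BorelSpace (GpInf L H ⧸ Subgroup.centralizer ({γ} : Set (GpInf L H))) := fun _ => ⟨rfl⟩
    letI : ∀ γ : GInf L, MeasurableSpace (GInf L ⧸ Subgroup.centralizer ({γ} : Set (GInf L))) := fun _ => borel _
    haveI : ∀ γ : GInf L, BorelSpace (GInf L ⧸ Subgroup.centralizer ({γ} : Set (GInf L))) := fun _ => ⟨rfl⟩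
    letI : ∀ a : HInf L, MeasurableSpace (HInf L ⧸ Subgroup.centralizer ({a} : Set (HInf L))) := fun _ => borel _
    haveI : ∀ a : HInf L, BorelSpace (HInf L ⧸ Subgroup.centralizer ({a} : Set (HInf L))) := fun _ => ⟨rfl⟩
    obtain ⟨h₁, h₂, h₃, h₄, h₅, h₆⟩ := w.harch
    exact ⟨OrbitalMeasureFamily.isAdmissibleOn_of_eqOn (fun c hc => w.mGip_of_isRegularElt c hc) h₁,
      OrbitalMeasureFamily.isAdmissibleOn_of_eqOn (fun c hc => w.mqip_of_isRegularElt c hc) h₂, h₃, h₄,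
      (UnitaryGroup.isArchInnerTransferExists_iff_of_eqOn_regular L H (fun c hc => w.mGip_of_isRegularElt c hc)
        (fun c hc => w.mqip_of_isRegularElt c hc) _ _).1 h₅,
      (UnitaryGroup.isArchDeltaTransferExists_iff_of_eqOn_regular L H Tinf w.mHi (fun c hc => w.mGip_of_isRegularElt c hc) _ _).1 h₆⟩

/-- **(ed. 1.24) (xii) THE TORUS COHERENCE FOR THE PATCHED ARCHIMEDEAN FAMILIES** — (W′)(W) by ★ `OrbitalMeasureFamily.isQuotientOf_of_eqOn`, the rest verbatim.
[cite: Rogawski1990, §14.3 p. 234; §4.3 p. 43] -/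
theorem hcohP : ArchTorusCoherence L H hanis w.mGip w.mqip w.mHi νGi νqi νHi w.t' w.t w.tH := by
    letI : ∀ γ : GpInf L H, MeasurableSpace (GpInf L H ⧸ Subgroup.centralizer ({γ} : Set (GpInf L H))) := fun _ => borel _
    haveI : ∀ γ : GpInf L H, BorelSpace (GpInf L H ⧸ Subgroup.centralizer ({γ} : Set (GpInf L H))) := fun _ => ⟨rfl⟩
    letI : ∀ γ : GInf L, MeasurableSpace (GInf L ⧸ Subgroup.centralizer ({γ} : Set (GInf L))) := fun _ => borel _
    haveI : ∀ γ : GInf L, BorelSpace (GInf L ⧸ Subgroup.centralizer ({γ} : Set (GInf L))) := fun _ => ⟨rfl⟩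
    letI : ∀ a : HInf L, MeasurableSpace (HInf L ⧸ Subgroup.centralizer ({a} : Set (HInf L))) := fun _ => borel _
    haveI : ∀ a : HInf L, BorelSpace (HInf L ⧸ Subgroup.centralizer ({a} : Set (HInf L))) := fun _ => ⟨rfl⟩
    obtain ⟨h₁, h₂, h₃⟩ := w.hcoh
    exact ⟨OrbitalMeasureFamily.isQuotientOf_of_eqOn νGi w.t' (fun c hc => w.mGip_of_isRegularElt c hc) h₁,
      OrbitalMeasureFamily.isQuotientOf_of_eqOn νqi w.t (fun c hc => w.mqip_of_isRegularElt c hc) h₂, h₃⟩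

/-- **(ed. 1.24) (xiv) FOR THE PATCHED LOCAL FAMILIES** — ★ `isNormalisedOff_congr_point` (the class of `(γ_c)_v` is regular for regular `γ_c`).
[cite: Rogawski1990, §4.3 pp. 43–44] -/
theorem hnormP : letI : ∀ (v : HeightOneSpectrum (𝓞 ↥(maximalRealSubfield L))) (γ : (UnitaryGroup.cmDatum L 3 H).Local v),
        MeasurableSpace ((UnitaryGroup.cmDatum L 3 H).Local v ⧸
          Subgroup.centralizer ({γ} : Set ((UnitaryGroup.cmDatum L 3 H).Local v))) := fun _ _ => borel _;
    ∀ c : ConjClasses (UnitaryGroup.cmDatum L 3 H).Rational,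
      Literature.NumberTheory.Rogawski1990.IsRegularElt ((Quotient.out c).val : GL (Fin 3) L) →
        ∃ S₀ : Finset (HeightOneSpectrum (𝓞 ↥(maximalRealSubfield L))),
          UnitaryGroup.IsNormalisedOff L 3 H w.mGp ((UnitaryGroup.cmDatum L 3 H).toAdelic (Quotient.out c)) S₀ := by
    letI : ∀ (v : HeightOneSpectrum (𝓞 ↥(maximalRealSubfield L))) (γ : (UnitaryGroup.cmDatum L 3 H).Local v),
        MeasurableSpace ((UnitaryGroup.cmDatum L 3 H).Local v ⧸
          Subgroup.centralizer ({γ} : Set ((UnitaryGroup.cmDatum L 3 H).Local v))) := fun _ _ => borel _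
    intro c hc
    obtain ⟨S₀, hS₀⟩ := w.hnorm c hc
    exact ⟨S₀, UnitaryGroup.isNormalisedOff_congr_point L w.mG w.mGp _ S₀
      (fun v => w.mGp_of_isRegularElt v _ (Literature.NumberTheory.Rogawski1990.isRegularElt_out_mk_toLocal_toAdelic L H (Quotient.out c) hc v)) hS₀⟩

/-- **(ed. 1.24) (viii⁵) THE β-SOCKET FOR THE KIT'S (PATCHED) FAMILIES AT EVERY CLASS** (`hβp` read through the `mGp`∕`mGip` abbreviations).
[cite: Rogawski1990, §4.3 (4.3.1)–(4.3.2) pp. 43–44; §5.4 (5.4.1) p. 72] -/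
theorem hβP : letI : ∀ g : GpAdelic L H, MeasurableSpace (GpAdelic L H ⧸ Subgroup.centralizer ({g} : Set (GpAdelic L H))) := fun _ => borel _;
    letI : ∀ γ : GpInf L H, MeasurableSpace (GpInf L H ⧸ Subgroup.centralizer ({γ} : Set (GpInf L H))) := fun _ => borel _;
    letI : ∀ (v : HeightOneSpectrum (𝓞 ↥(maximalRealSubfield L))) (γ : (UnitaryGroup.cmDatum L 3 H).Local v),
        MeasurableSpace ((UnitaryGroup.cmDatum L 3 H).Local v ⧸
          Subgroup.centralizer ({γ} : Set ((UnitaryGroup.cmDatum L 3 H).Local v))) := fun _ _ => borel _;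
    ∀ c : ConjClasses (UnitaryGroup.cmDatum L 3 H).Rational,
      w.μA c = ENNReal.ofReal (w.α (Literature.NumberTheory.Rogawski1990.StableClass.ofConjClass c)) •
        UnitaryGroup.AdelicOrbitalMeasureFamily.ofLocal L 3 H w.mGp w.mGip c :=
  w.hβp

/-- **(ed. 1.24) `Cs` IS the (κ-MASS) constant** — the identity of ★ `SingularTransferMembers.kappaConst_spec` for the SINGULAR members, its Δ-transfer hypotheses
taken at the KIT's (patched) families and moved by ★ `UnitaryGroupPatchedFamiliesTransport`. [cite: Rogawski1990, §14.5 Lemma 14.5.2 (b) p. 239; Prop. 8.2.1 (a) p. 117] -/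
theorem Cs_spec (γ₀ : (UnitaryGroup.cmDatum L 3 H).Rational) (e₁ e₂ : L) (hne : e₁ ≠ e₂)
    (hprod : (((γ₀.val : GL (Fin 3) L) : Matrix (Fin 3) (Fin 3) L) - e₁ • (1 : Matrix (Fin 3) (Fin 3) L)) *
        (((γ₀.val : GL (Fin 3) L) : Matrix (Fin 3) (Fin 3) L) - e₂ • (1 : Matrix (Fin 3) (Fin 3) L)) = 0)
    (hnc : ¬ ∃ ζ : L, ((γ₀.val : GL (Fin 3) L) : Matrix (Fin 3) (Fin 3) L) = ζ • (1 : Matrix (Fin 3) (Fin 3) L))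
    (hchar : ((γ₀.val : GL (Fin 3) L) : Matrix (Fin 3) (Fin 3) L).charpoly = (Polynomial.X - Polynomial.C e₁) ^ 2 * (Polynomial.X - Polynomial.C e₂))
    (γH : (UnitaryGroup.cmDatum L 2 (splitForm L 2)).Rational × (UnitaryGroup.cmDatum L 1 (splitForm L 1)).Rational)
    (hγH1 : ((γH.1.val : GL (Fin 2) L) : Matrix (Fin 2) (Fin 2) L) = e₁ • (1 : Matrix (Fin 2) (Fin 2) L))
    (hγH2 : ((γH.2.val : GL (Fin 1) L) : Matrix (Fin 1) (Fin 1) L) 0 0 = e₂)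
    (T : UnitaryGroup.PureTensor L 3 H) (TH : UnitaryGroup.PureTensor₂ L (splitForm L 2) (splitForm L 1))
    (hT : T.IsTest) (hTH : TH.IsUnramified₂) (hsm : ∀ v ∈ TH.S, Literature.NumberTheory.Rogawski1990.IsLocSmooth (TH.loc v))
    (hsa : Literature.NumberTheory.Rogawski1990.ArchSmooth₂ L TH.arch)
    (hloc : letI : ∀ (v : HeightOneSpectrum (𝓞 ↥(maximalRealSubfield L))) (a : HLocal L v),
        MeasurableSpace (HLocal L v ⧸ Subgroup.centralizer ({a} : Set (HLocal L v))) := fun _ _ => borel _;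
      letI : ∀ (v : HeightOneSpectrum (𝓞 ↥(maximalRealSubfield L))) (γ : (UnitaryGroup.cmDatum L 3 H).Local v),
        MeasurableSpace ((UnitaryGroup.cmDatum L 3 H).Local v ⧸
          Subgroup.centralizer ({γ} : Set ((UnitaryGroup.cmDatum L 3 H).Local v))) := fun _ _ => borel _;
      ∀ v, Literature.NumberTheory.Rogawski1990.IsLocalDeltaTransfer L H v (w.Δ v) (w.mH v) (w.mGp v) (TH.loc v) (T.loc v))
    (harch : letI : ∀ a : HInf L, MeasurableSpace (HInf L ⧸ Subgroup.centralizer ({a} : Set (HInf L))) := fun _ => borel _;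
      letI : ∀ γ : GpInf L H, MeasurableSpace (GpInf L H ⧸ Subgroup.centralizer ({γ} : Set (GpInf L H))) := fun _ => borel _;
      Literature.NumberTheory.Rogawski1990.IsArchDeltaTransfer L H Tinf w.mHi w.mGip TH.arch T.arch) :
    letI : ∀ g : GpAdelic L H, MeasurableSpace (GpAdelic L H ⧸ Subgroup.centralizer ({g} : Set (GpAdelic L H))) := fun _ => borel _;
    letI : ∀ γ : GpInf L H, MeasurableSpace (GpInf L H ⧸ Subgroup.centralizer ({γ} : Set (GpInf L H))) := fun _ => borel _;
    letI : ∀ (v : HeightOneSpectrum (𝓞 ↥(maximalRealSubfield L))) (γ : (UnitaryGroup.cmDatum L 3 H).Local v),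
        MeasurableSpace ((UnitaryGroup.cmDatum L 3 H).Local v ⧸
          Subgroup.centralizer ({γ} : Set ((UnitaryGroup.cmDatum L 3 H).Local v))) := fun _ _ => borel _;
    Literature.NumberTheory.Rogawski1990.adelicStableOrbitalSum (Literature.NumberTheory.Rogawski1990.MatchingAdeleG₂.classes L H H γ₀)
        (UnitaryGroup.OrbitalMeasureFamily.ofLocalAdelic L 3 H w.mGs w.mGis) T.eval =
      (w.Cs γ₀ e₁ e₂ γH : ℂ) * TH.eval ((UnitaryGroup.cmDatum L 2 (splitForm L 2)).toAdelic γH.1, (UnitaryGroup.cmDatum L 1 (splitForm L 1)).toAdelic γH.2) := by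
    letI : ∀ (v : HeightOneSpectrum (𝓞 ↥(maximalRealSubfield L))) (γ : (UnitaryGroup.cmDatum L 3 H).Local v),
        MeasurableSpace ((UnitaryGroup.cmDatum L 3 H).Local v ⧸
          Subgroup.centralizer ({γ} : Set ((UnitaryGroup.cmDatum L 3 H).Local v))) := fun _ _ => borel _
    haveI : ∀ (v : HeightOneSpectrum (𝓞 ↥(maximalRealSubfield L))) (γ : (UnitaryGroup.cmDatum L 3 H).Local v),
        BorelSpace ((UnitaryGroup.cmDatum L 3 H).Local v ⧸
          Subgroup.centralizer ({γ} : Set ((UnitaryGroup.cmDatum L 3 H).Local v))) := fun _ _ => ⟨rfl⟩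
    letI : ∀ g : GpAdelic L H, MeasurableSpace (GpAdelic L H ⧸ Subgroup.centralizer ({g} : Set (GpAdelic L H))) := fun _ => borel _
    haveI : ∀ g : GpAdelic L H, BorelSpace (GpAdelic L H ⧸ Subgroup.centralizer ({g} : Set (GpAdelic L H))) := fun _ => ⟨rfl⟩
    letI : ∀ γ : GpInf L H, MeasurableSpace (GpInf L H ⧸ Subgroup.centralizer ({γ} : Set (GpInf L H))) := fun _ => borel _
    haveI : ∀ γ : GpInf L H, BorelSpace (GpInf L H ⧸ Subgroup.centralizer ({γ} : Set (GpInf L H))) := fun _ => ⟨rfl⟩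
    letI : ∀ γ : GInf L, MeasurableSpace (GInf L ⧸ Subgroup.centralizer ({γ} : Set (GInf L))) := fun _ => borel _
    haveI : ∀ γ : GInf L, BorelSpace (GInf L ⧸ Subgroup.centralizer ({γ} : Set (GInf L))) := fun _ => ⟨rfl⟩
    letI : ∀ (v : HeightOneSpectrum (𝓞 ↥(maximalRealSubfield L))) (a : HLocal L v),
        MeasurableSpace (HLocal L v ⧸ Subgroup.centralizer ({a} : Set (HLocal L v))) := fun _ _ => borel _
    haveI : ∀ (v : HeightOneSpectrum (𝓞 ↥(maximalRealSubfield L))) (a : HLocal L v),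
        BorelSpace (HLocal L v ⧸ Subgroup.centralizer ({a} : Set (HLocal L v))) := fun _ _ => ⟨rfl⟩
    letI : ∀ a : HInf L, MeasurableSpace (HInf L ⧸ Subgroup.centralizer ({a} : Set (HInf L))) := fun _ => borel _
    haveI : ∀ a : HInf L, BorelSpace (HInf L ⧸ Subgroup.centralizer ({a} : Set (HInf L))) := fun _ => ⟨rfl⟩
    letI : ∀ γ : GpAdelic L H, MeasurableSpace (↥(Subgroup.centralizer ({γ} : Set (GpAdelic L H))) ⧸
        ((UnitaryGroup.cmDatum L 3 H).quotientSubgroup ⊓ Subgroup.centralizer ({γ} : Set (GpAdelic L H))).subgroupOf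
          (Subgroup.centralizer ({γ} : Set (GpAdelic L H)))) := fun _ => borel _
    haveI : ∀ γ : GpAdelic L H, BorelSpace (↥(Subgroup.centralizer ({γ} : Set (GpAdelic L H))) ⧸
        ((UnitaryGroup.cmDatum L 3 H).quotientSubgroup ⊓ Subgroup.centralizer ({γ} : Set (GpAdelic L H))).subgroupOf
          (Subgroup.centralizer ({γ} : Set (GpAdelic L H)))) := fun _ => ⟨rfl⟩
    haveI hCcl : ∀ γ : GpAdelic L H, IsClosed ((Subgroup.centralizer ({γ} : Set (GpAdelic L H)) : Subgroup (GpAdelic L H)) : Set (GpAdelic L H)) :=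
      fun γ => UnitaryGroup.isClosed_centralizer_cmDatum L 3 H γ
    haveI : ∀ γ : GpAdelic L H, (Measure.count : Measure ↥(((UnitaryGroup.cmDatum L 3 H).quotientSubgroup ⊓
        Subgroup.centralizer ({γ} : Set (GpAdelic L H))).subgroupOf (Subgroup.centralizer ({γ} : Set (GpAdelic L H))))).IsHaarMeasure :=
      fun γ => UnitaryGroup.isHaarMeasure_count_quotientSubgroup_inf_centralizer_subgroupOf L 3 H γ
    haveI : ν.IsMulRightInvariant := by
      have h : ν.inv.IsMulRightInvariant := inferInstance
      rwa [Measure.inv_eq_self] at h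
    have hloc' := fun v => (UnitaryGroup.isLocalDeltaTransfer_iff_of_eqOn_regular L H v (w.Δ v) (w.mH v)
      (fun c hc => w.mGp_of_isRegularElt v c hc) (TH.loc v) (T.loc v)).2 (hloc v)
    have harch' := (UnitaryGroup.isArchDeltaTransfer_iff_of_eqOn_regular L H Tinf w.mHi (fun c hc => w.mGip_of_isRegularElt c hc) TH.arch T.arch).2 harch
    exact w.hS.kappaConst_spec γ₀ e₁ e₂ hne hprod hnc hchar γH hγH1 hγH2 T TH hT hTH hsm hsa hloc' harch'

/-- **(ed. 1.24) the (κ-MASS) identity FOR THE KIT'S FAMILIES** (`ofLocalAdelic 𝔨.mG 𝔨.mGi`): `Cs_spec` moved by the (β) bridge ★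
`adelicStableOrbitalSum_ofLocalAdelic_congr_of_not_isRegularElt` (every matching class of the non-regular `γ₀` is non-regular placewise).
[cite: Rogawski1990, §14.5 Lemma 14.5.2 (b) p. 239; §5.4 (5.4.3) pp. 72–73] -/
theorem Cs_spec_kit (γ₀ : (UnitaryGroup.cmDatum L 3 H).Rational) (e₁ e₂ : L) (hne : e₁ ≠ e₂)
    (hprod : (((γ₀.val : GL (Fin 3) L) : Matrix (Fin 3) (Fin 3) L) - e₁ • (1 : Matrix (Fin 3) (Fin 3) L)) *
        (((γ₀.val : GL (Fin 3) L) : Matrix (Fin 3) (Fin 3) L) - e₂ • (1 : Matrix (Fin 3) (Fin 3) L)) = 0)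
    (hnc : ¬ ∃ ζ : L, ((γ₀.val : GL (Fin 3) L) : Matrix (Fin 3) (Fin 3) L) = ζ • (1 : Matrix (Fin 3) (Fin 3) L))
    (hchar : ((γ₀.val : GL (Fin 3) L) : Matrix (Fin 3) (Fin 3) L).charpoly = (Polynomial.X - Polynomial.C e₁) ^ 2 * (Polynomial.X - Polynomial.C e₂))
    (γH : (UnitaryGroup.cmDatum L 2 (splitForm L 2)).Rational × (UnitaryGroup.cmDatum L 1 (splitForm L 1)).Rational)
    (hγH1 : ((γH.1.val : GL (Fin 2) L) : Matrix (Fin 2) (Fin 2) L) = e₁ • (1 : Matrix (Fin 2) (Fin 2) L))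
    (hγH2 : ((γH.2.val : GL (Fin 1) L) : Matrix (Fin 1) (Fin 1) L) 0 0 = e₂)
    (T : UnitaryGroup.PureTensor L 3 H) (TH : UnitaryGroup.PureTensor₂ L (splitForm L 2) (splitForm L 1))
    (hT : T.IsTest) (hTH : TH.IsUnramified₂) (hsm : ∀ v ∈ TH.S, Literature.NumberTheory.Rogawski1990.IsLocSmooth (TH.loc v))
    (hsa : Literature.NumberTheory.Rogawski1990.ArchSmooth₂ L TH.arch)
    (hloc : letI : ∀ (v : HeightOneSpectrum (𝓞 ↥(maximalRealSubfield L))) (a : HLocal L v),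
        MeasurableSpace (HLocal L v ⧸ Subgroup.centralizer ({a} : Set (HLocal L v))) := fun _ _ => borel _;
      letI : ∀ (v : HeightOneSpectrum (𝓞 ↥(maximalRealSubfield L))) (γ : (UnitaryGroup.cmDatum L 3 H).Local v),
        MeasurableSpace ((UnitaryGroup.cmDatum L 3 H).Local v ⧸
          Subgroup.centralizer ({γ} : Set ((UnitaryGroup.cmDatum L 3 H).Local v))) := fun _ _ => borel _;
      ∀ v, Literature.NumberTheory.Rogawski1990.IsLocalDeltaTransfer L H v (w.Δ v) (w.mH v) (w.mGp v) (TH.loc v) (T.loc v))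
    (harch : letI : ∀ a : HInf L, MeasurableSpace (HInf L ⧸ Subgroup.centralizer ({a} : Set (HInf L))) := fun _ => borel _;
      letI : ∀ γ : GpInf L H, MeasurableSpace (GpInf L H ⧸ Subgroup.centralizer ({γ} : Set (GpInf L H))) := fun _ => borel _;
      Literature.NumberTheory.Rogawski1990.IsArchDeltaTransfer L H Tinf w.mHi w.mGip TH.arch T.arch) :
    letI : ∀ g : GpAdelic L H, MeasurableSpace (GpAdelic L H ⧸ Subgroup.centralizer ({g} : Set (GpAdelic L H))) := fun _ => borel _;
    letI : ∀ γ : GpInf L H, MeasurableSpace (GpInf L H ⧸ Subgroup.centralizer ({γ} : Set (GpInf L H))) := fun _ => borel _;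
    letI : ∀ (v : HeightOneSpectrum (𝓞 ↥(maximalRealSubfield L))) (γ : (UnitaryGroup.cmDatum L 3 H).Local v),
        MeasurableSpace ((UnitaryGroup.cmDatum L 3 H).Local v ⧸
          Subgroup.centralizer ({γ} : Set ((UnitaryGroup.cmDatum L 3 H).Local v))) := fun _ _ => borel _;
    Literature.NumberTheory.Rogawski1990.adelicStableOrbitalSum (Literature.NumberTheory.Rogawski1990.MatchingAdeleG₂.classes L H H γ₀)
        (UnitaryGroup.OrbitalMeasureFamily.ofLocalAdelic L 3 H w.mGp w.mGip) T.eval =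
      (w.Cs γ₀ e₁ e₂ γH : ℂ) * TH.eval ((UnitaryGroup.cmDatum L 2 (splitForm L 2)).toAdelic γH.1, (UnitaryGroup.cmDatum L 1 (splitForm L 1)).toAdelic γH.2) := by
    letI : ∀ (v : HeightOneSpectrum (𝓞 ↥(maximalRealSubfield L))) (γ : (UnitaryGroup.cmDatum L 3 H).Local v),
        MeasurableSpace ((UnitaryGroup.cmDatum L 3 H).Local v ⧸
          Subgroup.centralizer ({γ} : Set ((UnitaryGroup.cmDatum L 3 H).Local v))) := fun _ _ => borel _
    haveI : ∀ (v : HeightOneSpectrum (𝓞 ↥(maximalRealSubfield L))) (γ : (UnitaryGroup.cmDatum L 3 H).Local v),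
        BorelSpace ((UnitaryGroup.cmDatum L 3 H).Local v ⧸
          Subgroup.centralizer ({γ} : Set ((UnitaryGroup.cmDatum L 3 H).Local v))) := fun _ _ => ⟨rfl⟩
    letI : ∀ g : GpAdelic L H, MeasurableSpace (GpAdelic L H ⧸ Subgroup.centralizer ({g} : Set (GpAdelic L H))) := fun _ => borel _
    haveI : ∀ g : GpAdelic L H, BorelSpace (GpAdelic L H ⧸ Subgroup.centralizer ({g} : Set (GpAdelic L H))) := fun _ => ⟨rfl⟩
    letI : ∀ γ : GpInf L H, MeasurableSpace (GpInf L H ⧸ Subgroup.centralizer ({γ} : Set (GpInf L H))) := fun _ => borel _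
    haveI : ∀ γ : GpInf L H, BorelSpace (GpInf L H ⧸ Subgroup.centralizer ({γ} : Set (GpInf L H))) := fun _ => ⟨rfl⟩
    letI : ∀ γ : GInf L, MeasurableSpace (GInf L ⧸ Subgroup.centralizer ({γ} : Set (GInf L))) := fun _ => borel _
    haveI : ∀ γ : GInf L, BorelSpace (GInf L ⧸ Subgroup.centralizer ({γ} : Set (GInf L))) := fun _ => ⟨rfl⟩
    letI : ∀ (v : HeightOneSpectrum (𝓞 ↥(maximalRealSubfield L))) (a : HLocal L v),
        MeasurableSpace (HLocal L v ⧸ Subgroup.centralizer ({a} : Set (HLocal L v))) := fun _ _ => borel _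
    haveI : ∀ (v : HeightOneSpectrum (𝓞 ↥(maximalRealSubfield L))) (a : HLocal L v),
        BorelSpace (HLocal L v ⧸ Subgroup.centralizer ({a} : Set (HLocal L v))) := fun _ _ => ⟨rfl⟩
    letI : ∀ a : HInf L, MeasurableSpace (HInf L ⧸ Subgroup.centralizer ({a} : Set (HInf L))) := fun _ => borel _
    haveI : ∀ a : HInf L, BorelSpace (HInf L ⧸ Subgroup.centralizer ({a} : Set (HInf L))) := fun _ => ⟨rfl⟩
    letI : ∀ γ : GpAdelic L H, MeasurableSpace (↥(Subgroup.centralizer ({γ} : Set (GpAdelic L H))) ⧸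
        ((UnitaryGroup.cmDatum L 3 H).quotientSubgroup ⊓ Subgroup.centralizer ({γ} : Set (GpAdelic L H))).subgroupOf
          (Subgroup.centralizer ({γ} : Set (GpAdelic L H)))) := fun _ => borel _
    haveI : ∀ γ : GpAdelic L H, BorelSpace (↥(Subgroup.centralizer ({γ} : Set (GpAdelic L H))) ⧸
        ((UnitaryGroup.cmDatum L 3 H).quotientSubgroup ⊓ Subgroup.centralizer ({γ} : Set (GpAdelic L H))).subgroupOf
          (Subgroup.centralizer ({γ} : Set (GpAdelic L H)))) := fun _ => ⟨rfl⟩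
    haveI hCcl : ∀ γ : GpAdelic L H, IsClosed ((Subgroup.centralizer ({γ} : Set (GpAdelic L H)) : Subgroup (GpAdelic L H)) : Set (GpAdelic L H)) :=
      fun γ => UnitaryGroup.isClosed_centralizer_cmDatum L 3 H γ
    haveI : ∀ γ : GpAdelic L H, (Measure.count : Measure ↥(((UnitaryGroup.cmDatum L 3 H).quotientSubgroup ⊓
        Subgroup.centralizer ({γ} : Set (GpAdelic L H))).subgroupOf (Subgroup.centralizer ({γ} : Set (GpAdelic L H))))).IsHaarMeasure :=
      fun γ => UnitaryGroup.isHaarMeasure_count_quotientSubgroup_inf_centralizer_subgroupOf L 3 H γ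
    haveI : ν.IsMulRightInvariant := by
      have h : ν.inv.IsMulRightInvariant := inferInstance
      rwa [Measure.inv_eq_self] at h
    have hloc' := fun v => (UnitaryGroup.isLocalDeltaTransfer_iff_of_eqOn_regular L H v (w.Δ v) (w.mH v)
      (fun c hc => w.mGp_of_isRegularElt v c hc) (TH.loc v) (T.loc v)).2 (hloc v)
    have harch' := (UnitaryGroup.isArchDeltaTransfer_iff_of_eqOn_regular L H Tinf w.mHi (fun c hc => w.mGip_of_isRegularElt c hc) TH.arch T.arch).2 harch
    rw [UnitaryGroup.adelicStableOrbitalSum_ofLocalAdelic_congr_of_not_isRegularElt L H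
      (Literature.NumberTheory.Rogawski1990.not_isRegularElt_of_mul_sub_eq_zero w.hH
        (Literature.NumberTheory.Automorphic.Godement.det_ne_zero_of_anisotropic L H hanis) γ₀ hne hprod hnc)
      (fun v c hc => w.mGp_of_not_isRegularElt v c hc) (fun c hc => w.mGip_of_not_isRegularElt c hc)
      ((w.hS.1 γ₀ (Literature.NumberTheory.Rogawski1990.not_isRegularElt_of_mul_sub_eq_zero w.hH
        (Literature.NumberTheory.Automorphic.Godement.det_ne_zero_of_anisotropic L H hanis) γ₀ hne hprod hnc)).1) T.eval]
    exact w.hS.kappaConst_spec γ₀ e₁ e₂ hne hprod hnc hchar γH hγH1 hγH2 T TH hT hTH hsm hsa hloc' harch'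

open scoped Classical in
/-- **(ed. 1.24b) THE ANCHORED `SJ_G` DATUM** = ★ `anchoredSJG` (trichotomy: REGULAR `α·κ_G·Φ^{st,𝐀}_G(out 𝒪)` ∕ CENTRAL `α·f(ζ•1 ⊗ 1)` ∕ split-SINGULAR
`(α∕2)·Φ^{e,𝐀}_G` Kottwitz-signed ∕ else `0`) at the witness's own weights `α`, `anchorKappaG` and transported families. [Rogawski1990, Thm. 14.5.1 (a) p. 238; §5.4 (5.4.3) pp. 72–73] -/
def sjG (𝒪 : Literature.NumberTheory.Rogawski1990.StableClass (cmConjRingHom L) H) (f : TestG L) : ℂ :=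
  letI : ∀ g : GAdelic L, MeasurableSpace (GAdelic L ⧸ Subgroup.centralizer ({g} : Set (GAdelic L))) := fun _ => borel _
  letI : ∀ a : GInf L, MeasurableSpace (GInf L ⧸ Subgroup.centralizer ({a} : Set (GInf L))) := fun _ => borel _
  letI : ∀ (v : HeightOneSpectrum (𝓞 ↥(maximalRealSubfield L))) (γ : (UnitaryGroup.cmDatum L 3 H).Local v),
      MeasurableSpace ((UnitaryGroup.cmDatum L 3 H).Local v ⧸ Subgroup.centralizer ({γ} : Set ((UnitaryGroup.cmDatum L 3 H).Local v))) :=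
    fun _ _ => borel _
  haveI : ∀ (v : HeightOneSpectrum (𝓞 ↥(maximalRealSubfield L))) (γ : (UnitaryGroup.cmDatum L 3 H).Local v),
      BorelSpace ((UnitaryGroup.cmDatum L 3 H).Local v ⧸ Subgroup.centralizer ({γ} : Set ((UnitaryGroup.cmDatum L 3 H).Local v))) :=
    fun _ _ => ⟨rfl⟩
  letI : ∀ (v : HeightOneSpectrum (𝓞 ↥(maximalRealSubfield L))) (γ : (UnitaryGroup.cmDatum L 3 (splitForm L 3)).Local v),
      MeasurableSpace ((UnitaryGroup.cmDatum L 3 (splitForm L 3)).Local v ⧸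
        Subgroup.centralizer ({γ} : Set ((UnitaryGroup.cmDatum L 3 (splitForm L 3)).Local v))) := fun _ _ => borel _
  haveI : ∀ (v : HeightOneSpectrum (𝓞 ↥(maximalRealSubfield L))) (γ : (UnitaryGroup.cmDatum L 3 (splitForm L 3)).Local v),
      BorelSpace ((UnitaryGroup.cmDatum L 3 (splitForm L 3)).Local v ⧸
        Subgroup.centralizer ({γ} : Set ((UnitaryGroup.cmDatum L 3 (splitForm L 3)).Local v))) := fun _ _ => ⟨rfl⟩
  Literature.NumberTheory.Rogawski1990.anchoredSJG (Godement.det_ne_zero_of_anisotropic L H hanis) w.α (anchorKappaG L H)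
    (UnitaryGroup.OrbitalMeasureFamily.ofLocalAdelic L 3 (splitForm L 3)
      (fun v => (w.mGp v).transport (w.ψ₀ v).toMulEquiv (w.ψ₀ v).continuous (w.ψ₀ v).symm.continuous) w.mqip) 𝒪 ⇑f

/-- **(ED 1.24, O7) THE ANCHORED `SJ_H` DATUM** = ★ `anchoredSJH`: at a SCALAR-PAIR class `[(ζ•1₂, u•1₁)]`, `ζ ≠ u` (central `U(2)`-block, image split-singular
non-central) `m_H · f^H(γH♮ ⊗ 1)` with `m_H = α(t 𝒪H) · Cs(out (t 𝒪H)) ζ u γH♮` [Lemma 14.5.2 (b); Prop. 10.1.2 (a)]; at a `G`-REGULAR class `κ_H(𝒪H) ·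
Φ^{st,𝐀}_H(out 𝒪H; ofLocalAdelicPair m^H m^H_∞; f^H)` (ED ≤ 1.24a₀) [Thm. 14.5.1 (a); (5.4.3)]; `0` elsewhere (the central-IMAGE class `[(ζ•1₂, ζ•1₁)]` included).
[Rogawski1990, Thm. 14.5.1 (a) p. 238; Lemma 14.5.2 (b) p. 238; Prop. 10.1.2 (a) p. 146; §5.4 (5.4.3) pp. 72–73] -/
def sjH (𝒪H : Literature.NumberTheory.Rogawski1990.StableClassH (cmConjRingHom L) (splitForm L 2) (splitForm L 1)) (fH : TestH L) : ℂ :=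
  letI : ∀ h : HAdelic L, MeasurableSpace (HAdelic L ⧸ Subgroup.centralizer ({h} : Set (HAdelic L))) := fun _ => borel _
  letI : ∀ a : HInf L, MeasurableSpace (HInf L ⧸ Subgroup.centralizer ({a} : Set (HInf L))) := fun _ => borel _
  haveI : ∀ a : HInf L, BorelSpace (HInf L ⧸ Subgroup.centralizer ({a} : Set (HInf L))) := fun _ => ⟨rfl⟩
  letI : ∀ (v : HeightOneSpectrum (𝓞 ↥(maximalRealSubfield L))) (a : HLocal L v),
      MeasurableSpace (HLocal L v ⧸ Subgroup.centralizer ({a} : Set (HLocal L v))) := fun _ _ => borel _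
  haveI : ∀ (v : HeightOneSpectrum (𝓞 ↥(maximalRealSubfield L))) (a : HLocal L v),
      BorelSpace (HLocal L v ⧸ Subgroup.centralizer ({a} : Set (HLocal L v))) := fun _ _ => ⟨rfl⟩
  Literature.NumberTheory.Rogawski1990.anchoredSJH H w.α w.Cs (anchorKappaH L H w.α)
    (UnitaryGroup.OrbitalMeasureFamily.ofLocalAdelicPair L (splitForm L 2) (splitForm L 1) w.mH w.mHi) 𝒪H fH

open scoped Classical in
/-- **(ed. 1.19b₀) THE ANCHORED KIT READ OFF AN ANCHOR WITNESS** — `θ_{G′} := diagTrace`, `mult :=` the `L²`-multiplicity, `μG := μ₃`, `ψ := ψ_v`, `Smooth :=`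
pure smooth tensors, `Transfer f′ f :=` placewise transfer along `ψ_v⁻¹` with `IsArchInnerTransfer m^{G′}_∞ m_∞` at `∞`, `TransferH f′ f^H := GlobalTransferAwayH (S₀ ∪
S_bad) f′ f^H ∧` Δ_v-transfers at every finite `v` `∧ IsArchDeltaTransfer Tinf m^H_∞ m^{G′}_∞` at `∞`, the transfer data FIELDS, `StClass := StableClass`, `J 𝒪 f′ :=
𝒪.orbitalSum (Φ_{μA} f′)`, `eSt := Equiv.refl`, `α := w.α` (ed. 1.23; `1` before), and (eds. 1.19c₁∕c₂) the SJ data `SJG := w.sjG`, `StClassH := ★ StableClassH`, `SJH := w.sjH`, `transfersTo :=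
★ StableClassH.TransfersTo`, `eStH := Equiv.refl`, (ed. 1.20∕1.23) `κG := anchorKappaG`, `κH := anchorKappaH w.α`; the `Sθ`∕`M`-terms and the packet data remain recorded PLACEHOLDERS.
(print: Rogawski1990, §14.1–14.2 p. 232; §14.5 p. 237) -/
def kit : ComparisonKit L H μ :=
  letI : ∀ g : GpAdelic L H, MeasurableSpace (GpAdelic L H ⧸ Subgroup.centralizer ({g} : Set (GpAdelic L H))) := fun _ => borel _
  { traceGp := UnitaryGroup.diagTrace L 3 H μ ν hanis
    mult := fun P => (((UnitaryGroup.cmDatum L 3 H).rightRegular μ).multiplicity P.space.toContRep).toNat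
    μG := w.μ₃
    ψ := w.ψ₀
    Smooth := fun f' => ∃ T : UnitaryGroup.PureTensor L 3 H, T.IsTest ∧ ⇑f' = T.eval
    Transfer := fun f' f =>
      ∃ (T : UnitaryGroup.PureTensor L 3 H) (T' : UnitaryGroup.PureTensor L 3 (splitForm L 3)),
        (T.IsTest ∧ T'.IsTest) ∧ ⇑f' = T.eval ∧ ⇑f = T'.eval ∧ (∀ v, T'.loc v = T.loc v ∘ (w.ψ₀ v).symm) ∧
        Literature.NumberTheory.Rogawski1990.IsArchInnerTransfer L H w.mGip w.mqip T.arch T'.arch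
    TransferH := fun f' fH => UnitaryGroup.GlobalTransferAwayH L (w.S₀ ∪ w.Sbad) f' fH ∧
      ∃ (T : UnitaryGroup.PureTensor L 3 H) (TH : UnitaryGroup.PureTensor₂ L (splitForm L 2) (splitForm L 1)),
        (T.IsTest ∧ TH.IsUnramified₂ ∧ (∀ v ∈ TH.S, Literature.NumberTheory.Rogawski1990.IsLocSmooth (TH.loc v)) ∧
          Literature.NumberTheory.Rogawski1990.ArchSmooth₂ L TH.arch) ∧
        ⇑f' = T.eval ∧ ⇑fH = TH.eval ∧
        (∀ v, Literature.NumberTheory.Rogawski1990.IsLocalDeltaTransfer L H v (w.Δ v) (w.mH v) (w.mGp v) (TH.loc v) (T.loc v)) ∧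
        Literature.NumberTheory.Rogawski1990.IsArchDeltaTransfer L H Tinf w.mHi w.mGip TH.arch T.arch
    Δ := w.Δ
    mH := w.mH
    mG := w.mGp
    mHi := w.mHi
    mGi := w.mGip
    mqi := w.mqip
    μA := w.μA
    StClass := Literature.NumberTheory.Rogawski1990.StableClass (cmConjRingHom L) H
    J := fun c f' => c.orbitalSum (UnitaryGroup.adelicClassOrbitalIntegral L 3 H w.μA f')
    eSt := Equiv.refl _
    α := w.α
    SJG := w.sjG
    StClassH := Literature.NumberTheory.Rogawski1990.StableClassH (cmConjRingHom L) (splitForm L 2) (splitForm L 1)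
    SJH := w.sjH
    transfersTo := fun 𝒪H 𝒪 => 𝒪H.TransfersTo H Literature.NumberTheory.Rogawski1990.endoForm_antidiagOne 𝒪
    eStH := Equiv.refl _
    κG := anchorKappaG L H
    κH := anchorKappaH L H w.α
    SθG := fun _ => 0
    SθH := fun _ => 0
    SθM := fun _ => 0
    SJM := fun _ => 0
    SθMH := fun _ => 0
    SJMH := fun _ => 0
    PacketG := PUnit
    PacketH := PUnit
    nG := fun _ => 0
    nH := fun _ => 0
    trG := fun _ _ => 0
    trH := fun _ _ => 0 }

/-- **pin (xii″) for the anchored kit** (regular classes) = ★ `anchoredSJG_eq_of_isRegularElt`. [cite: Rogawski1990, Thm. 14.5.1 (a) p. 238; §5.4 (5.4.3) pp. 72–73] -/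
theorem pinSJG : w.kit.PinSJG w.kit.κG := by
  letI : ∀ g : GAdelic L, MeasurableSpace (GAdelic L ⧸ Subgroup.centralizer ({g} : Set (GAdelic L))) := fun _ => borel _
  intro 𝒪 γ₀ he hreg f
  exact Literature.NumberTheory.Rogawski1990.anchoredSJG_eq_of_isRegularElt _ w.α (anchorKappaG L H) _ he hreg ⇑f

/-- **pin (xii-f) for the anchored kit** = ★ `finite_support_anchoredSJG` (every non-zero branch makes `𝒞_𝐀(out 𝒪)` meet `tsupport f`; ★ K6-γ).
[cite: Rogawski1990, §14.5 p. 238; §4.3 p. 44] -/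
theorem pinSJGFinite : w.kit.PinSJGFinite := by
  letI : ∀ g : GAdelic L, MeasurableSpace (GAdelic L ⧸ Subgroup.centralizer ({g} : Set (GAdelic L))) := fun _ => borel _
  intro f
  exact Literature.NumberTheory.Rogawski1990.finite_support_anchoredSJG hanis _ w.α (anchorKappaG L H) _ f.hasCompactSupport

/-- **(ed. 1.24b) pin (xii‴-c) for the anchored kit** (central classes) = ★ `anchoredSJG_eq_of_coe_eq_smul_one`. [cite: Rogawski1990, Prop. 10.1.2 (b)(2) p. 146] -/
theorem pinSJGCentral : w.kit.PinSJGCentral := by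
  letI : ∀ g : GAdelic L, MeasurableSpace (GAdelic L ⧸ Subgroup.centralizer ({g} : Set (GAdelic L))) := fun _ => borel _
  intro 𝒪 γ₀ γ ζ he hζ hγ f
  exact Literature.NumberTheory.Rogawski1990.anchoredSJG_eq_of_coe_eq_smul_one _ w.α (anchorKappaG L H) _ he hζ hγ ⇑f

/-- **(ed. 1.24b) pin (xii″-s, SIGNED) for the anchored kit** (split-singular non-central classes; `H` hermitian) = ★ `anchoredSJG_eq_of_mul_sub_smul_eq_zero`.
[cite: Rogawski1990, Prop. 10.1.2 (b)(1) p. 146; §4.1 (4.1.2) p. 40] -/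
theorem pinSJGSingular : w.kit.PinSJGSingular := by
  letI : ∀ g : GAdelic L, MeasurableSpace (GAdelic L ⧸ Subgroup.centralizer ({g} : Set (GAdelic L))) := fun _ => borel _
  intro 𝒪 γ₀ a b he hab hγ hnc f
  exact Literature.NumberTheory.Rogawski1990.anchoredSJG_eq_of_mul_sub_smul_eq_zero w.hH _ w.α (anchorKappaG L H) _ he hab hγ hnc ⇑f

/-- **(ed. 1.19c₁) pin (xiii-c) for the anchored kit**: `eStH = id`, `transfersTo := StableClassH.TransfersTo` — by `Iff.rfl`. [cite: Rogawski1990, Thm. 14.5.1 (a) p. 238] -/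
theorem pinTransfersTo : w.kit.PinTransfersTo w.kit.eStH := by
  intro 𝒪H 𝒪
  exact Iff.rfl

/-- **(ed. 1.19c₁∕1.20) pin (κ) for the anchored kit**: `κ_G(𝒪) = (n + 1)⁻¹ > 0`, `κ_H(𝒪H) ∈ {2 κ_G(𝒪), 2} > 0` (`anchorKappaG_pos`, `anchorKappaH_pos`).
[cite: Rogawski1990, §5.4 (5.4.3) p. 72] -/
theorem pinKappa : w.kit.PinKappa w.kit.κG w.kit.κH :=
  ⟨fun 𝒪 => anchorKappaG_pos L H 𝒪, fun 𝒪H => anchorKappaH_pos L H w.hα 𝒪H⟩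

/-- **(ed. 1.20) pin (κ-v) for the anchored kit**: `κ_G = anchorKappaG` is the pinned value by `rfl` (`transfersTo := StableClassH.TransfersTo`, `eStH = eSt = id`);
`κ_H = anchorKappaH w.α` takes the pinned value `2·α(𝒪)·(#+1)⁻¹` at every transferring class by `anchorKappaH_eq_of_transfersTo`. [cite: Rogawski1990, §5.4 (5.4.3)–(5.4.5) pp. 72–73] -/
theorem pinKappaValues : w.kit.PinKappaValues w.kit.κG w.kit.κH :=
  ⟨fun _ => rfl, fun _ _ h𝒪 => anchorKappaH_eq_of_transfersTo L H w.α h𝒪⟩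

/-- **(ed. 1.21) pin (xv) for the anchored kit**: the stabilisation package is the witness field `hpkg` (the last conjunct of `hGT₄`'s body at `hanis`),
read for `kit.Δ := w.Δ`. [cite: Rogawski1990, §3.3 Prop. 3.3.1 p. 22; §4.3 (4.3.3) p. 44; §5.4 (5.4.5) pp. 72–74] -/
theorem pinStabilisationPackage : w.kit.PinStabilisationPackage Tinf := w.hpkg

/-- **(ed. 1.23) pin (viii⁵) for the anchored kit**: `eSt = id`, `kit.α = w.α`, `kit.μA = w.μA` — the witness field `hβ` (the strengthened
`exists_absorbedAdelicFamily_ofLocal`: ★ (c5) + ★ (c4)). [cite: Rogawski1990, §4.3 (4.3.1)–(4.3.2) pp. 43–44; §5.4 (5.4.1) p. 72] -/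
theorem pinStableBeta : w.kit.PinStableBeta := fun c _ => w.hβP c

/-- **pin (xiii-0) for the anchored kit** (★ `anchoredSJH_eq_zero_of_not_isSemisimple`: a class with non-semisimple image transfers to nothing in the
anisotropic `G′` and is not `G`-regular). [cite: Rogawski1990, Thm. 14.5.1 (a) p. 238; §14.5 p. 237] -/
theorem pinSJHOffSemisimple : w.kit.PinSJHOffSemisimple := by
  letI : ∀ h : HAdelic L, MeasurableSpace (HAdelic L ⧸ Subgroup.centralizer ({h} : Set (HAdelic L))) := fun _ => borel _
  exact fun _ fH hns => Literature.NumberTheory.Rogawski1990.anchoredSJH_eq_zero_of_not_isSemisimple hanis hns fH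

/-- **pin (c-s) for the anchored kit** (★ `anchoredSJH_eq_zero_of_charpoly_fst_eq`). [cite: Rogawski1990, Lemma 14.5.2 (a) p. 238] -/
theorem pinSingularHRegularVanish : w.kit.PinSingularHRegularVanish := by
  letI : ∀ h : HAdelic L, MeasurableSpace (HAdelic L ⧸ Subgroup.centralizer ({h} : Set (HAdelic L))) := fun _ => borel _
  exact fun _ _ fH _ _ _ _ _ _ he hab hchar h2 _ => Literature.NumberTheory.Rogawski1990.anchoredSJH_eq_zero_of_charpoly_fst_eq he hab hchar h2 fH

/-- **pin (xiii‴-cc) for the anchored kit** (★ `exists_anchoredSJH_eq_mul_of_fst_eq_smul_one`: `κ := m_H` off the central image, `κ := 0` on it).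
[cite: Rogawski1990, Prop. 10.1.2 (a) p. 146; Lemma 14.5.2 (c) p. 238] -/
theorem pinSJHCentralImage : w.kit.PinSJHCentralImage := by
  letI : ∀ h : HAdelic L, MeasurableSpace (HAdelic L ⧸ Subgroup.centralizer ({h} : Set (HAdelic L))) := fun _ => borel _
  exact fun _ _ _ _ he h1 _ _ => Literature.NumberTheory.Rogawski1990.exists_anchoredSJH_eq_mul_of_fst_eq_smul_one he h1

/-- **pin (xiii″) for the anchored kit** (★ `anchoredSJH_eq_of_isGRegular`: a `G`-regular class is not a scalar pair, and the value at `out 𝒪H` is the value at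
every representative, ★ `adelicStableOrbitalIntegralH_out_eq`). [cite: Rogawski1990, Thm. 14.5.1 (a) p. 238; §5.4 Prop. 5.4.1 p. 72] -/
theorem pinSJH : w.kit.PinSJH w.kit.eStH w.kit.κH := by
  letI : ∀ h : HAdelic L, MeasurableSpace (HAdelic L ⧸ Subgroup.centralizer ({h} : Set (HAdelic L))) := fun _ => borel _
  intro 𝒪H γH he hreg fH
  have he' : 𝒪H = Literature.NumberTheory.Rogawski1990.stableClassHOf (cmConjRingHom L) (splitForm L 2) (splitForm L 1) γH := he
  show w.sjH 𝒪H fH = _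
  unfold sjH
  exact Literature.NumberTheory.Rogawski1990.anchoredSJH_eq_of_isGRegular he' hreg fH

/-- **pin (xiii-f) for the anchored kit** (★ `finite_support_anchoredSJH`: the `G`-regular support ∪ the scalar-pair classes met by `f^H`).
[cite: Rogawski1990, §14.5 p. 238; §5.4 pp. 72–73] -/
theorem pinSJHFinite : w.kit.PinSJHFinite := by
  letI : ∀ h : HAdelic L, MeasurableSpace (HAdelic L ⧸ Subgroup.centralizer ({h} : Set (HAdelic L))) := fun _ => borel _
  exact fun fH => Literature.NumberTheory.Rogawski1990.finite_support_anchoredSJH fH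

/-- **(xiii″-s∕κ)(i) for the anchored kit** (★ `anchoredSJH_eq_of_transfersTo`): at `𝒪H = 𝒪′_st(a•1₂, b•1₁) ↦ 𝒪`, `a ≠ b`, `SJ_H(𝒪H, f^H) = m_H · f^H(γH ⊗ 1)`
with `m_H = α(𝒪) · Cs (out 𝒪) a b γH`. [cite: Rogawski1990, Prop. 10.1.2 (a) p. 146; Lemma 14.5.2 (b) p. 238] -/
theorem sjH_eq_of_transfersTo {𝒪H : Literature.NumberTheory.Rogawski1990.StableClassH (cmConjRingHom L) (splitForm L 2) (splitForm L 1)}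
    {𝒪 : Literature.NumberTheory.Rogawski1990.StableClass (cmConjRingHom L) H}
    {γH : (UnitaryGroup.cmDatum L 2 (splitForm L 2)).Rational × (UnitaryGroup.cmDatum L 1 (splitForm L 1)).Rational} {a b : L}
    (he : 𝒪H = Literature.NumberTheory.Rogawski1990.stableClassHOf (cmConjRingHom L) (splitForm L 2) (splitForm L 1) γH) (hab : a ≠ b)
    (h1 : ((γH.1.val : GL (Fin 2) L) : Matrix (Fin 2) (Fin 2) L) = a • (1 : Matrix (Fin 2) (Fin 2) L))
    (h2 : ((γH.2.val : GL (Fin 1) L) : Matrix (Fin 1) (Fin 1) L) = b • (1 : Matrix (Fin 1) (Fin 1) L))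
    (hT : 𝒪H.TransfersTo H Literature.NumberTheory.Rogawski1990.endoForm_antidiagOne 𝒪) (fH : TestH L) :
    w.kit.SJH 𝒪H fH = ((w.α 𝒪 * w.Cs (Quotient.out (s := Literature.NumberTheory.Rogawski1990.stableConjSetoid _ _) 𝒪) a b γH : ℝ) : ℂ) *
      fH (((UnitaryGroup.cmDatum L 2 (splitForm L 2)).toAdelic γH.1, (UnitaryGroup.cmDatum L 1 (splitForm L 1)).toAdelic γH.2)) := by
  letI : ∀ h : HAdelic L, MeasurableSpace (HAdelic L ⧸ Subgroup.centralizer ({h} : Set (HAdelic L))) := fun _ => borel _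
  exact Literature.NumberTheory.Rogawski1990.anchoredSJH_eq_of_transfersTo he hab h1 h2 hT fH

/-- **(ed. 1.24b) pin (xiii″-s ⊗ b-s κ-mass) `PinSingularEndoscopicMass` for the anchored kit** (O7 WORD #56 (2) ∕ #60; (F-2)(i) ⊕ (F-1)(ii) ⊕ (β)): the ONE scalar is
`m_H := α(𝒪) · Cs (out 𝒪) a b γH`.  (i) `SJ_H(𝒪H, f^H) = m_H · f^H(γH ⊗ 1)` is ★ `anchoredSJH_eq_of_transfersTo` (`sjH_eq_of_transfersTo`).  (ii) for a `TransferH` pair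
`(f′, f^H) = (T.eval, TH.eval)`: the kit's tensor witnesses `(T₀, TH₀)` have the same `eval`s; `charpoly γ₀ = (X − a)²(X − b)` from the transferring pair
(★ `StableClassH.TransfersTo.charpoly_eq`); the hypotheses reach `out 𝒪` (★ `singularHyps_of_isStablyConj`, ★ `isStablyConj_out_of_eq`); the PATCHED kit
families `m^{G′,p}, m^{G′,p}_∞` have the same all-classes sum over `𝒞_𝐀(out 𝒪)` as the SINGULAR members (★ (β) `adelicStableOrbitalSum_ofLocalAdelic_congr_of_not_isRegularElt`,
non-regularity ★ `not_isRegularElt_of_mul_sub_eq_zero w.hH`), for which (κ-MASS) IS `Cs` — all three packaged as (F-1)'s `Cs_spec_kit`; the sum is a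
function of the stable class (★ `MatchingAdeleG₂.classes_eq_of_isStablyConj`), so ★ `kappaMass_of_spec_out` moves the identity from `out 𝒪` to `γ₀` with the
weight `α(𝒪)`. [cite: Rogawski1990, Lemma 14.5.2 (b) p. 238; Prop. 10.1.2 (a) p. 146; §5.4 (5.4.3) pp. 72–73; Prop. 8.2.1 (a) p. 117] [cite: Kottwitz1988, Thm. 1] -/
theorem pinSingularEndoscopicMass : w.kit.PinSingularEndoscopicMass := by
  letI : ∀ (v : HeightOneSpectrum (𝓞 ↥(maximalRealSubfield L))) (γ : (UnitaryGroup.cmDatum L 3 H).Local v),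
      MeasurableSpace ((UnitaryGroup.cmDatum L 3 H).Local v ⧸
        Subgroup.centralizer ({γ} : Set ((UnitaryGroup.cmDatum L 3 H).Local v))) := fun _ _ => borel _
  haveI : ∀ (v : HeightOneSpectrum (𝓞 ↥(maximalRealSubfield L))) (γ : (UnitaryGroup.cmDatum L 3 H).Local v),
      BorelSpace ((UnitaryGroup.cmDatum L 3 H).Local v ⧸
        Subgroup.centralizer ({γ} : Set ((UnitaryGroup.cmDatum L 3 H).Local v))) := fun _ _ => ⟨rfl⟩
  letI : ∀ g : GpAdelic L H, MeasurableSpace (GpAdelic L H ⧸ Subgroup.centralizer ({g} : Set (GpAdelic L H))) := fun _ => borel _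
  haveI : ∀ g : GpAdelic L H, BorelSpace (GpAdelic L H ⧸ Subgroup.centralizer ({g} : Set (GpAdelic L H))) := fun _ => ⟨rfl⟩
  letI : ∀ γ : GpInf L H, MeasurableSpace (GpInf L H ⧸ Subgroup.centralizer ({γ} : Set (GpInf L H))) := fun _ => borel _
  haveI : ∀ γ : GpInf L H, BorelSpace (GpInf L H ⧸ Subgroup.centralizer ({γ} : Set (GpInf L H))) := fun _ => ⟨rfl⟩
  letI : ∀ γ : GInf L, MeasurableSpace (GInf L ⧸ Subgroup.centralizer ({γ} : Set (GInf L))) := fun _ => borel _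
  haveI : ∀ γ : GInf L, BorelSpace (GInf L ⧸ Subgroup.centralizer ({γ} : Set (GInf L))) := fun _ => ⟨rfl⟩
  letI : ∀ (v : HeightOneSpectrum (𝓞 ↥(maximalRealSubfield L))) (a : HLocal L v),
      MeasurableSpace (HLocal L v ⧸ Subgroup.centralizer ({a} : Set (HLocal L v))) := fun _ _ => borel _
  haveI : ∀ (v : HeightOneSpectrum (𝓞 ↥(maximalRealSubfield L))) (a : HLocal L v),
      BorelSpace (HLocal L v ⧸ Subgroup.centralizer ({a} : Set (HLocal L v))) := fun _ _ => ⟨rfl⟩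
  letI : ∀ a : HInf L, MeasurableSpace (HInf L ⧸ Subgroup.centralizer ({a} : Set (HInf L))) := fun _ => borel _
  haveI : ∀ a : HInf L, BorelSpace (HInf L ⧸ Subgroup.centralizer ({a} : Set (HInf L))) := fun _ => ⟨rfl⟩
  letI : ∀ γ : GpAdelic L H, MeasurableSpace (↥(Subgroup.centralizer ({γ} : Set (GpAdelic L H))) ⧸
      ((UnitaryGroup.cmDatum L 3 H).quotientSubgroup ⊓ Subgroup.centralizer ({γ} : Set (GpAdelic L H))).subgroupOf
        (Subgroup.centralizer ({γ} : Set (GpAdelic L H)))) := fun _ => borel _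
  haveI : ∀ γ : GpAdelic L H, BorelSpace (↥(Subgroup.centralizer ({γ} : Set (GpAdelic L H))) ⧸
      ((UnitaryGroup.cmDatum L 3 H).quotientSubgroup ⊓ Subgroup.centralizer ({γ} : Set (GpAdelic L H))).subgroupOf
        (Subgroup.centralizer ({γ} : Set (GpAdelic L H)))) := fun _ => ⟨rfl⟩
  haveI hCcl : ∀ γ : GpAdelic L H, IsClosed ((Subgroup.centralizer ({γ} : Set (GpAdelic L H)) : Subgroup (GpAdelic L H)) : Set (GpAdelic L H)) :=
    fun γ => UnitaryGroup.isClosed_centralizer_cmDatum L 3 H γ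
  haveI : ∀ γ : GpAdelic L H, (Measure.count : Measure ↥(((UnitaryGroup.cmDatum L 3 H).quotientSubgroup ⊓
      Subgroup.centralizer ({γ} : Set (GpAdelic L H))).subgroupOf (Subgroup.centralizer ({γ} : Set (GpAdelic L H))))).IsHaarMeasure :=
    fun γ => UnitaryGroup.isHaarMeasure_count_quotientSubgroup_inf_centralizer_subgroupOf L 3 H γ
  haveI : ν.IsMulRightInvariant := by
    have h : ν.inv.IsMulRightInvariant := inferInstance
    rwa [Measure.inv_eq_self] at h
  intro 𝒪 γ₀ a b he hab hγ₀ hnc γH h1 h2 𝒪H heH hT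
  refine ⟨((w.α 𝒪 * w.Cs (Quotient.out (s := Literature.NumberTheory.Rogawski1990.stableConjSetoid _ _) 𝒪) a b γH : ℝ) : ℂ),
    fun fH => w.sjH_eq_of_transfersTo heH hab h1 h2 hT fH, ?_⟩
  intro f' fH hTr T TH hf' hfH
  obtain ⟨-, T₀, TH₀, ⟨hT₀, hTH₀u, hTH₀s, hTH₀a⟩, hf'₀, hfH₀, hloc₀, harch₀⟩ := hTr
  have hTe : T.eval = T₀.eval := hf'.symm.trans hf'₀
  have hTHe : TH.eval ((UnitaryGroup.cmDatum L 2 (splitForm L 2)).toAdelic γH.1, (UnitaryGroup.cmDatum L 1 (splitForm L 1)).toAdelic γH.2) =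
      TH₀.eval ((UnitaryGroup.cmDatum L 2 (splitForm L 2)).toAdelic γH.1, (UnitaryGroup.cmDatum L 1 (splitForm L 1)).toAdelic γH.2) := (congrFun hfH _).symm.trans (congrFun hfH₀ _)
  rw [hTe, hTHe]
  -- the stable class, its representative, the transferring pair ⇒ `charpoly γ₀ = (X − a)²(X − b)`
  have he' : 𝒪 = Literature.NumberTheory.Rogawski1990.stableClassOf (cmConjRingHom L) H γ₀ := he
  have heH' : 𝒪H = Literature.NumberTheory.Rogawski1990.stableClassHOf (cmConjRingHom L) (splitForm L 2) (splitForm L 1) γH := heH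
  have hc1 : ((γH.1.val : GL (Fin 2) L) : Matrix (Fin 2) (Fin 2) L).charpoly = (Polynomial.X - Polynomial.C a) ^ 2 := by
    rw [h1, Matrix.smul_one_eq_diagonal, Matrix.charpoly_diagonal, Finset.prod_const, Finset.card_univ, Fintype.card_fin]
  have hc2 : ((γH.2.val : GL (Fin 1) L) : Matrix (Fin 1) (Fin 1) L) 0 0 = b := by
    rw [h2, Matrix.smul_apply, Matrix.one_apply_eq, smul_eq_mul, mul_one]
  have hchar₀ : ((γ₀.val : GL (Fin 3) L) : Matrix (Fin 3) (Fin 3) L).charpoly = (Polynomial.X - Polynomial.C a) ^ 2 * (Polynomial.X - Polynomial.C b) := by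
    have h := Literature.NumberTheory.Rogawski1990.StableClassH.TransfersTo.charpoly_eq hT
    rw [he', heH'] at h
    simpa only [Literature.NumberTheory.Rogawski1990.StableClass.charpoly_stableClassOf, Literature.NumberTheory.Rogawski1990.StableClassH.fst_stableClassHOf,
      Literature.NumberTheory.Rogawski1990.StableClassH.sndVal_stableClassHOf, hc1, hc2] using h
  -- the hypotheses at the representative `out 𝒪` (stably conjugate to `γ₀`): `charpoly (out 𝒪) = charpoly γ₀`
  obtain ⟨hγδ, hncδ, hcharδ⟩ := Literature.NumberTheory.Rogawski1990.singularHyps_of_isStablyConj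
    (Literature.NumberTheory.Rogawski1990.isStablyConj_out_of_eq he').symm hγ₀ hnc
  -- (κ-MASS) IS `Cs` at `out 𝒪` for the KIT's (patched) families ((F-1) `Cs_spec_kit` = ★ `kappaConst_spec` ⊕ patch-safety ⊕ (β)); the all-classes sum is a
  -- function of the stable class, so ★ `kappaMass_of_spec_out` moves the identity to `γ₀` with the weight `α(𝒪)`
  exact Literature.NumberTheory.Rogawski1990.kappaMass_of_spec_out w.α w.Cs he'
    (Φ := fun γ => Literature.NumberTheory.Rogawski1990.adelicStableOrbitalSum (Literature.NumberTheory.Rogawski1990.MatchingAdeleG₂.classes L H H γ)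
      (UnitaryGroup.OrbitalMeasureFamily.ofLocalAdelic L 3 H w.mGp w.mGip) T₀.eval)
    (fun γ δ hγδ' => congrArg (fun S => Literature.NumberTheory.Rogawski1990.adelicStableOrbitalSum S
      (UnitaryGroup.OrbitalMeasureFamily.ofLocalAdelic L 3 H w.mGp w.mGip) T₀.eval) (Literature.NumberTheory.Rogawski1990.MatchingAdeleG₂.classes_eq_of_isStablyConj hγδ'))
    (w.Cs_spec_kit _ a b hab hγδ hncδ (hcharδ.trans hchar₀) γH h1 hc2 T₀ TH₀ hT₀ hTH₀u hTH₀s hTH₀a hloc₀ harch₀)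

/-- **pin (vii-c) for the anchored kit**: the field `hconjS`. [cite: Rogawski1990, §14.1 p. 232] -/
theorem pinPsiConj : w.kit.PinPsiConj := w.hconjS

/-- **pin (c-c) for the anchored kit** [Lemma 14.5.2 (c)]: `f^H = T^H.eval` for the `TransferH` tensor pair `(T, T^H)`; (S-c) of `hACS` kills `T^H.arch (γ_H ⊗ 1)`,
★ `PureTensor₂.eval_toAdelic_eq_zero_of_arch_eq_zero` kills the value. [cite: Rogawski1990, Lemma 14.5.2 (c) p. 238] -/
theorem pinCentralHVanish : w.kit.PinCentralHVanish := by
  intro f' fH hTr γH ζ h1 h2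
  obtain ⟨-, T, TH, ⟨hT, -, -, hTHa⟩, -, hfH, -, hΔ⟩ := hTr
  rw [show fH (((UnitaryGroup.cmDatum L 2 (splitForm L 2)).toAdelic γH.1, (UnitaryGroup.cmDatum L 1 (splitForm L 1)).toAdelic γH.2)) = TH.eval _ from
    congrFun hfH _]
  letI : ∀ γ : GpInf L H, MeasurableSpace (GpInf L H ⧸ Subgroup.centralizer ({γ} : Set (GpInf L H))) := fun _ => borel _
  haveI : ∀ γ : GpInf L H, BorelSpace (GpInf L H ⧸ Subgroup.centralizer ({γ} : Set (GpInf L H))) := fun _ => ⟨rfl⟩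
  letI : ∀ a : HInf L, MeasurableSpace (HInf L ⧸ Subgroup.centralizer ({a} : Set (HInf L))) := fun _ => borel _
  haveI : ∀ a : HInf L, BorelSpace (HInf L ⧸ Subgroup.centralizer ({a} : Set (HInf L))) := fun _ => ⟨rfl⟩
  exact TH.eval_toAdelic_eq_zero_of_arch_eq_zero γH.1 γH.2 (w.hACS.centralH_vanish TH.arch T.arch hTHa hT.2.2
    ((UnitaryGroup.isArchDeltaTransfer_iff_of_eqOn_regular L H Tinf w.mHi (fun c hc => w.mGip_of_isRegularElt c hc) _ _).2 hΔ) γH ζ h1 h2)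

/-- **pin (d-c) for the anchored kit** [§14.5 p. 239]: `f′ = T.eval`, `f = T′.eval` for the `Transfer` pair (`T′_v = T_v ∘ ψ_v⁻¹`, `hcorr′`); the finite factors
agree at `ζ•1` by ★ N3 and the archimedean ones by (S-d) of `hACS` — ★ `PureTensor.eval_toAdelic_eq_of_loc_comp_symm_of_central`. [cite: Rogawski1990, §14.5 p. 239] -/
theorem pinCentralValueTransfer : w.kit.PinCentralValueTransfer := by
  intro f' f hTr γ₀ γ ζ hγ₀ hγ
  letI : ∀ γ : GpInf L H, MeasurableSpace (GpInf L H ⧸ Subgroup.centralizer ({γ} : Set (GpInf L H))) := fun _ => borel _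
  haveI : ∀ γ : GpInf L H, BorelSpace (GpInf L H ⧸ Subgroup.centralizer ({γ} : Set (GpInf L H))) := fun _ => ⟨rfl⟩
  letI : ∀ γ : GInf L, MeasurableSpace (GInf L ⧸ Subgroup.centralizer ({γ} : Set (GInf L))) := fun _ => borel _
  haveI : ∀ γ : GInf L, BorelSpace (GInf L ⧸ Subgroup.centralizer ({γ} : Set (GInf L))) := fun _ => ⟨rfl⟩
  obtain ⟨T, T', ⟨hT, hT'⟩, hf', hf, hloc, harchI⟩ := hTr
  rw [show f ((UnitaryGroup.cmDatum L 3 (splitForm L 3)).toAdelic γ) = T'.eval _ from congrFun hf _,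
    show f' ((UnitaryGroup.cmDatum L 3 H).toAdelic γ₀) = T.eval _ from congrFun hf' _]
  exact T.eval_toAdelic_eq_of_loc_comp_symm_of_central T' w.ψ₀ w.hcorr' hloc hγ₀ hγ
    (w.hACS.central_value T.arch T'.arch hT.2.2 hT'.2.2
      ((UnitaryGroup.isArchInnerTransfer_iff_of_eqOn_regular L H (fun c hc => w.mGip_of_isRegularElt c hc)
        (fun c hc => w.mqip_of_isRegularElt c hc) _ _).2 harchI) γ₀ γ ζ hγ₀ hγ)

/-- pin (ix′-c) for the anchored kit: `kit.Transfer` IS the predicate. [cite: Rogawski1990, §14.2 (14.2.1) pp. 232–233] -/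
theorem pinTransferIff : w.kit.PinTransferIff := fun _ _ => Iff.rfl

open scoped Classical in
/-- pin (xi″-c) for the anchored kit: `kit.TransferH` IS the predicate with `S₁ := S₀ ∪ S_bad`. [cite: Rogawski1990, §14.3 pp. 233–234] -/
theorem pinTransferHIff : w.kit.PinTransferHIff Tinf := ⟨w.S₀ ∪ w.Sbad, fun _ _ => Iff.rfl⟩

/-- pin (xi-u) for the anchored kit: `hloc`'s unit-transfer clause off `S_bad`. [cite: Rogawski1990, §4.9 Prop. 4.9.1 (b) p. 55] -/
theorem pinLocalUnitTransferOff : w.kit.PinLocalUnitTransferOff := ⟨w.Sbad, fun v hv => (w.hlocP v).2.1 hv⟩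

/-- **(ed. 1.24) pin (viii⁵-s) for the anchored kit** — the β-socket `hβp` at the class (`eSt = id`; no hypothesis is needed: the socket holds at EVERY class).
[cite: Rogawski1990, §5.4 (5.4.1) p. 72; §14.5 p. 239] [cite: Kottwitz1988, Thm. 1] -/
theorem pinMuAShapeSingular : w.kit.PinMuAShapeSingular := by
  letI : ∀ g : GpAdelic L H, MeasurableSpace (GpAdelic L H ⧸ Subgroup.centralizer ({g} : Set (GpAdelic L H))) := fun _ => borel _
  haveI : ∀ g : GpAdelic L H, BorelSpace (GpAdelic L H ⧸ Subgroup.centralizer ({g} : Set (GpAdelic L H))) := fun _ => ⟨rfl⟩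
  letI : ∀ γ : GpInf L H, MeasurableSpace (GpInf L H ⧸ Subgroup.centralizer ({γ} : Set (GpInf L H))) := fun _ => borel _
  haveI : ∀ γ : GpInf L H, BorelSpace (GpInf L H ⧸ Subgroup.centralizer ({γ} : Set (GpInf L H))) := fun _ => ⟨rfl⟩
  letI : ∀ (v : HeightOneSpectrum (𝓞 ↥(maximalRealSubfield L))) (γ : (UnitaryGroup.cmDatum L 3 H).Local v),
      MeasurableSpace ((UnitaryGroup.cmDatum L 3 H).Local v ⧸
        Subgroup.centralizer ({γ} : Set ((UnitaryGroup.cmDatum L 3 H).Local v))) := fun _ _ => borel _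
  haveI : ∀ (v : HeightOneSpectrum (𝓞 ↥(maximalRealSubfield L))) (γ : (UnitaryGroup.cmDatum L 3 H).Local v),
      BorelSpace ((UnitaryGroup.cmDatum L 3 H).Local v ⧸
        Subgroup.centralizer ({γ} : Set ((UnitaryGroup.cmDatum L 3 H).Local v))) := fun _ _ => ⟨rfl⟩
  intro c _ _ _ _ _
  have hoc : Literature.NumberTheory.Rogawski1990.stableClassOf (cmConjRingHom L) H (Quotient.out c) =
      Literature.NumberTheory.Rogawski1990.StableClass.ofConjClass c := by
    conv_rhs => rw [← Quotient.out_eq c]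
    rfl
  show w.μA c = ENNReal.ofReal (w.α (Literature.NumberTheory.Rogawski1990.stableClassOf (cmConjRingHom L) H (Quotient.out c))) •
      UnitaryGroup.AdelicOrbitalMeasureFamily.ofLocal L 3 H w.mGp w.mGip c
  rw [hoc]
  exact w.hβP c

/-- **(ed. 1.24) pin (viii⁵-c) for the anchored kit** — `hβs` at the central class (not regular, ★ `not_isRegularElt_of_coe_eq_smul_one`) and (CEN) of the
singular package (`w.hS.2.2.1`). [cite: Rogawski1990, Prop. 10.1.2 (b)(2) p. 146; §14.5 p. 237] -/
theorem pinMuAMassCentral : w.kit.PinMuAMassCentral := by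
  letI : ∀ g : GpAdelic L H, MeasurableSpace (GpAdelic L H ⧸ Subgroup.centralizer ({g} : Set (GpAdelic L H))) := fun _ => borel _
  haveI : ∀ g : GpAdelic L H, BorelSpace (GpAdelic L H ⧸ Subgroup.centralizer ({g} : Set (GpAdelic L H))) := fun _ => ⟨rfl⟩
  letI : ∀ γ : GpInf L H, MeasurableSpace (GpInf L H ⧸ Subgroup.centralizer ({γ} : Set (GpInf L H))) := fun _ => borel _
  haveI : ∀ γ : GpInf L H, BorelSpace (GpInf L H ⧸ Subgroup.centralizer ({γ} : Set (GpInf L H))) := fun _ => ⟨rfl⟩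
  letI : ∀ (v : HeightOneSpectrum (𝓞 ↥(maximalRealSubfield L))) (γ : (UnitaryGroup.cmDatum L 3 H).Local v),
      MeasurableSpace ((UnitaryGroup.cmDatum L 3 H).Local v ⧸
        Subgroup.centralizer ({γ} : Set ((UnitaryGroup.cmDatum L 3 H).Local v))) := fun _ _ => borel _
  haveI : ∀ (v : HeightOneSpectrum (𝓞 ↥(maximalRealSubfield L))) (γ : (UnitaryGroup.cmDatum L 3 H).Local v),
      BorelSpace ((UnitaryGroup.cmDatum L 3 H).Local v ⧸
        Subgroup.centralizer ({γ} : Set ((UnitaryGroup.cmDatum L 3 H).Local v))) := fun _ _ => ⟨rfl⟩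
  intro c ζ hζ
  have hoc : Literature.NumberTheory.Rogawski1990.stableClassOf (cmConjRingHom L) H (Quotient.out c) =
      Literature.NumberTheory.Rogawski1990.StableClass.ofConjClass c := by
    conv_rhs => rw [← Quotient.out_eq c]
    rfl
  show w.μA c Set.univ = ENNReal.ofReal (w.α (Literature.NumberTheory.Rogawski1990.stableClassOf (cmConjRingHom L) H (Quotient.out c)))
  rw [hoc, w.hβs c (Literature.NumberTheory.Rogawski1990.not_isRegularElt_of_coe_eq_smul_one (Quotient.out c) hζ), Measure.smul_apply,
    w.hS.2.2.1 c ⟨ζ, hζ⟩, smul_eq_mul, mul_one]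

/-- **(ed. 1.24) pin (b-s arch) for the anchored kit**: the kit's transfer relation at the PATCHED archimedean families is the relation at the REGULAR ones (★
`isArchInnerTransfer_iff_of_eqOn_regular`), (ST-∞) of the singular package (`w.hS.2.2.2.2.1`) gives the signed identity for the SINGULAR members, and the patched
members ARE the singular ones on the stable classes of the non-regular `γ₀ ⊗ 1`, `γ ⊗ 1` (★ `stableOrbitalIntegralRel_congr_of_eqOn`, ★ `IsStablyConj.isRegularElt_iff`;
`γ₀` non-regular by ★ `not_isRegularElt_of_mul_sub_eq_zero` ∕ `not_isRegularElt_of_coe_eq_smul_one`). [cite: Rogawski1990, §14.2 (14.2.1) p. 232; Lemma 14.5.2 (b) p. 238]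
[cite: Kottwitz1988, Prop. 2] -/
theorem pinSingularArchInnerTransfer : w.kit.PinSingularArchInnerTransfer := by
  letI : ∀ γ : GpInf L H, MeasurableSpace (GpInf L H ⧸ Subgroup.centralizer ({γ} : Set (GpInf L H))) := fun _ => borel _
  haveI : ∀ γ : GpInf L H, BorelSpace (GpInf L H ⧸ Subgroup.centralizer ({γ} : Set (GpInf L H))) := fun _ => ⟨rfl⟩
  letI : ∀ γ : GInf L, MeasurableSpace (GInf L ⧸ Subgroup.centralizer ({γ} : Set (GInf L))) := fun _ => borel _
  haveI : ∀ γ : GInf L, BorelSpace (GInf L ⧸ Subgroup.centralizer ({γ} : Set (GInf L))) := fun _ => ⟨rfl⟩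
  intro T T' hT hT' htr γ₀ γ a b hγ hab hprod
  have hHd : H.det ≠ 0 := Literature.NumberTheory.Automorphic.Godement.det_ne_zero_of_anisotropic L H hanis
  have hn₀ : ¬ Literature.NumberTheory.Rogawski1990.IsRegularElt (γ₀.val : GL (Fin 3) L) := by
    by_cases hnc : ∃ ζ : L, ((γ₀.val : GL (Fin 3) L) : Matrix (Fin 3) (Fin 3) L) = ζ • (1 : Matrix (Fin 3) (Fin 3) L)
    · obtain ⟨ζ, hζ⟩ := hnc
      exact Literature.NumberTheory.Rogawski1990.not_isRegularElt_of_coe_eq_smul_one γ₀ hζ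
    · exact Literature.NumberTheory.Rogawski1990.not_isRegularElt_of_mul_sub_eq_zero w.hH hHd γ₀ hab hprod hnc
  have hn : ¬ Literature.NumberTheory.Rogawski1990.IsRegularElt (γ.val : GL (Fin 3) L) := fun h =>
    hn₀ ((Literature.NumberTheory.Rogawski1990.isRegularElt_iff_of_corresponds hγ).2 h)
  have htr' : Literature.NumberTheory.Rogawski1990.IsArchInnerTransfer L H w.mGi w.mqi T.arch T'.arch :=
    (UnitaryGroup.isArchInnerTransfer_iff_of_eqOn_regular L H (fun c hc => w.mGip_of_isRegularElt c hc)
      (fun c hc => w.mqip_of_isRegularElt c hc) _ _).2 htr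
  have hst := w.hS.2.2.2.2.1 T.arch T'.arch hT hT' htr' γ₀ γ a b hγ hab hprod
  have e₁ : Literature.NumberTheory.Rogawski1990.archStableOrbitalIntegral L 3 H w.kit.mGi
        (fun x => Literature.NumberTheory.Rogawski1990.kottwitzSignArchWeight L 3 H (ConjClasses.mk x) * T.arch x)
        (Literature.NumberTheory.Rogawski1990.cmRationalToArch L 3 H γ₀) =
      Literature.NumberTheory.Rogawski1990.archStableOrbitalIntegral L 3 H w.mGis
        (fun x => Literature.NumberTheory.Rogawski1990.kottwitzSignArchWeight L 3 H (ConjClasses.mk x) * T.arch x)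
        (Literature.NumberTheory.Rogawski1990.cmRationalToArch L 3 H γ₀) :=
    stableOrbitalIntegralRel_congr_of_eqOn (m := w.mGis) (m' := w.mGip) (fun c hc => w.mGip_of_not_isRegularElt c fun hreg =>
      UnitaryGroup.not_isRegularElt_cmRationalToArch L γ₀ hn₀ (hc.isRegularElt_iff.2 hreg)) _
  have e₂ : Literature.NumberTheory.Rogawski1990.archStableOrbitalIntegral L 3 (splitForm L 3) w.kit.mqi
        (fun y => Literature.NumberTheory.Rogawski1990.kottwitzSignArchWeight L 3 (splitForm L 3) (ConjClasses.mk y) * T'.arch y)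
        (Literature.NumberTheory.Rogawski1990.cmRationalToArch L 3 (splitForm L 3) γ) =
      Literature.NumberTheory.Rogawski1990.archStableOrbitalIntegral L 3 (splitForm L 3) w.mqis
        (fun y => Literature.NumberTheory.Rogawski1990.kottwitzSignArchWeight L 3 (splitForm L 3) (ConjClasses.mk y) * T'.arch y)
        (Literature.NumberTheory.Rogawski1990.cmRationalToArch L 3 (splitForm L 3) γ) :=
    stableOrbitalIntegralRel_congr_of_eqOn (m := w.mqis) (m' := w.mqip) (fun c hc => w.mqip_of_not_isRegularElt c fun hreg =>
      UnitaryGroup.not_isRegularElt_cmRationalToArch L γ hn (hc.isRegularElt_iff.2 hreg)) _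
  rw [e₁, e₂]
  exact hst

/-- **(ed. 1.24) rider (ix-adm) for the anchored kit's local families** (A-p16 (g21) v5 `hadmG′` text): at a NON-regular rational `γ₀` the patched family is
admissible on the local stable class of `(γ₀)_v` — (ADM) of the package moved by ★ `isAdmissibleOn_corresponds_local_of_eqOn_not_regular`. [cite: Rogawski1990, §14.5 p. 239] -/
theorem hadmG' : letI : ∀ (v : HeightOneSpectrum (𝓞 ↥(maximalRealSubfield L))) (γ : (UnitaryGroup.cmDatum L 3 H).Local v),
        MeasurableSpace ((UnitaryGroup.cmDatum L 3 H).Local v ⧸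
          Subgroup.centralizer ({γ} : Set ((UnitaryGroup.cmDatum L 3 H).Local v))) := fun _ _ => borel _;
    ∀ γ₀ : (UnitaryGroup.cmDatum L 3 H).Rational, ¬ Literature.NumberTheory.Rogawski1990.IsRegularElt (γ₀.val : GL (Fin 3) L) →
      ∀ v, (w.kit.mG v).IsAdmissibleOn fun x : (UnitaryGroup.cmDatum L 3 H).Local v =>
        Literature.NumberTheory.Rogawski1990.Corresponds (UnitaryGroup.conjLocal L (IsCMField.complexConj L) v)
          ((UnitaryGroup.adelicForm L 3 H).map (UnitaryGroup.adeleToLocal L v))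
          ((UnitaryGroup.adelicForm L 3 H).map (UnitaryGroup.adeleToLocal L v))
          ((UnitaryGroup.cmDatum L 3 H).toLocal v ((UnitaryGroup.cmDatum L 3 H).toAdelic γ₀)) x := by
  letI : ∀ (v : HeightOneSpectrum (𝓞 ↥(maximalRealSubfield L))) (γ : (UnitaryGroup.cmDatum L 3 H).Local v),
      MeasurableSpace ((UnitaryGroup.cmDatum L 3 H).Local v ⧸
        Subgroup.centralizer ({γ} : Set ((UnitaryGroup.cmDatum L 3 H).Local v))) := fun _ _ => borel _
  haveI : ∀ (v : HeightOneSpectrum (𝓞 ↥(maximalRealSubfield L))) (γ : (UnitaryGroup.cmDatum L 3 H).Local v),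
      BorelSpace ((UnitaryGroup.cmDatum L 3 H).Local v ⧸
        Subgroup.centralizer ({γ} : Set ((UnitaryGroup.cmDatum L 3 H).Local v))) := fun _ _ => ⟨rfl⟩
  intro γ₀ hγ₀ v
  show (w.mGp v).IsAdmissibleOn _
  exact UnitaryGroup.isAdmissibleOn_corresponds_local_of_eqOn_not_regular L v (fun c hc => w.mGp_of_not_isRegularElt v c hc) γ₀ hγ₀ ((w.hS.1 γ₀ hγ₀).1 v)

/-- **(ed. 1.24) rider (ix-admA)** (A-p16 v5 `hadmAG′` text): admissibility of the kit's `m^{G′}_∞` on the archimedean stable class of `γ₀ ⊗ 1`, `γ₀` non-regular.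
[cite: Rogawski1990, §14.2 (14.2.1) pp. 232–233; §14.5 p. 239] -/
theorem hadmAG' : letI : ∀ γ : GpInf L H, MeasurableSpace (GpInf L H ⧸ Subgroup.centralizer ({γ} : Set (GpInf L H))) := fun _ => borel _;
    ∀ γ₀ : (UnitaryGroup.cmDatum L 3 H).Rational, ¬ Literature.NumberTheory.Rogawski1990.IsRegularElt (γ₀.val : GL (Fin 3) L) →
      w.kit.mGi.IsAdmissibleOn fun x : GpInf L H =>
        Literature.NumberTheory.Rogawski1990.Corresponds (UnitaryGroup.conjMixed (↥(maximalRealSubfield L)) L (IsCMField.complexConj L)) (UnitaryGroup.archFormOf L 3 H)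
          (UnitaryGroup.archFormOf L 3 H) (Literature.NumberTheory.Rogawski1990.cmRationalToArch L 3 H γ₀) x := by
  letI : ∀ γ : GpInf L H, MeasurableSpace (GpInf L H ⧸ Subgroup.centralizer ({γ} : Set (GpInf L H))) := fun _ => borel _
  haveI : ∀ γ : GpInf L H, BorelSpace (GpInf L H ⧸ Subgroup.centralizer ({γ} : Set (GpInf L H))) := fun _ => ⟨rfl⟩
  intro γ₀ hγ₀
  show w.mGip.IsAdmissibleOn _
  exact UnitaryGroup.isAdmissibleOn_corresponds_arch_of_eqOn_not_regular L (fun c hc => w.mGip_of_not_isRegularElt c hc) γ₀ hγ₀ (w.hS.1 γ₀ hγ₀).2.1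

/-- **(ed. 1.24) rider (ix-admAq)** (A-p16 v5 `hadmAG` text): admissibility of the kit's `m_∞` on `G_∞ = U(Φ₃)_∞` at the classes corresponding to `γ₀ ⊗ 1`,
`γ₀` non-regular. [cite: Rogawski1990, §14.2 (14.2.1) pp. 232–233; §14.5 p. 239] -/
theorem hadmAG : letI : ∀ γ : GInf L, MeasurableSpace (GInf L ⧸ Subgroup.centralizer ({γ} : Set (GInf L))) := fun _ => borel _;
    ∀ γ₀ : (UnitaryGroup.cmDatum L 3 H).Rational, ¬ Literature.NumberTheory.Rogawski1990.IsRegularElt (γ₀.val : GL (Fin 3) L) →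
      w.kit.mqi.IsAdmissibleOn fun x : GInf L =>
        Literature.NumberTheory.Rogawski1990.Corresponds (UnitaryGroup.conjMixed (↥(maximalRealSubfield L)) L (IsCMField.complexConj L)) (UnitaryGroup.archFormOf L 3 H)
          (UnitaryGroup.archFormOf L 3 (Matrix.of fun i j : Fin 3 => if i.val + j.val + 1 = 3 then (1 : L) else 0)) (Literature.NumberTheory.Rogawski1990.cmRationalToArch L 3 H γ₀) x := by
  letI : ∀ γ : GInf L, MeasurableSpace (GInf L ⧸ Subgroup.centralizer ({γ} : Set (GInf L))) := fun _ => borel _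
  haveI : ∀ γ : GInf L, BorelSpace (GInf L ⧸ Subgroup.centralizer ({γ} : Set (GInf L))) := fun _ => ⟨rfl⟩
  intro γ₀ hγ₀
  show w.mqip.IsAdmissibleOn _
  exact UnitaryGroup.isAdmissibleOn_corresponds_arch_of_eqOn_not_regular' L (fun c hc => w.mqip_of_not_isRegularElt c hc) γ₀ hγ₀ (w.hS.1 γ₀ hγ₀).2.2

/-- **(ed. 1.24) rider (ix-norm)** (A-p16 v5 `hpin` text): the kit's local families are normalised off a finite set at every NON-regular rational `γ₀` — (NORM) of
the package moved by ★ `exists_isNormalisedOff_of_eqOn_not_regular`. [cite: Rogawski1990, §4.3 pp. 43–44; §14.5 p. 239] -/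
theorem hpin : letI : ∀ (v : HeightOneSpectrum (𝓞 ↥(maximalRealSubfield L))) (γ : (UnitaryGroup.cmDatum L 3 H).Local v),
        MeasurableSpace ((UnitaryGroup.cmDatum L 3 H).Local v ⧸
          Subgroup.centralizer ({γ} : Set ((UnitaryGroup.cmDatum L 3 H).Local v))) := fun _ _ => borel _;
    ∀ γ₀ : (UnitaryGroup.cmDatum L 3 H).Rational, ¬ Literature.NumberTheory.Rogawski1990.IsRegularElt (γ₀.val : GL (Fin 3) L) →
      ∃ S₀ : Finset (HeightOneSpectrum (𝓞 ↥(maximalRealSubfield L))),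
        UnitaryGroup.IsNormalisedOff L 3 H w.kit.mG ((UnitaryGroup.cmDatum L 3 H).toAdelic γ₀) S₀ := by
  letI : ∀ (v : HeightOneSpectrum (𝓞 ↥(maximalRealSubfield L))) (γ : (UnitaryGroup.cmDatum L 3 H).Local v),
      MeasurableSpace ((UnitaryGroup.cmDatum L 3 H).Local v ⧸
        Subgroup.centralizer ({γ} : Set ((UnitaryGroup.cmDatum L 3 H).Local v))) := fun _ _ => borel _
  haveI : ∀ (v : HeightOneSpectrum (𝓞 ↥(maximalRealSubfield L))) (γ : (UnitaryGroup.cmDatum L 3 H).Local v),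
      BorelSpace ((UnitaryGroup.cmDatum L 3 H).Local v ⧸
        Subgroup.centralizer ({γ} : Set ((UnitaryGroup.cmDatum L 3 H).Local v))) := fun _ _ => ⟨rfl⟩
  intro γ₀ hγ₀
  show ∃ S₀, UnitaryGroup.IsNormalisedOff L 3 H w.mGp ((UnitaryGroup.cmDatum L 3 H).toAdelic γ₀) S₀
  exact UnitaryGroup.exists_isNormalisedOff_of_eqOn_not_regular L (fun v c hc => w.mGp_of_not_isRegularElt v c hc) γ₀ hγ₀ (w.hS.2.1 γ₀ hγ₀)

/-- **(ed. 1.24b) the anchored kit satisfies (ix-s)**: the four riders `hadmG′ hadmAG′ hpin hadmAG` bundled. [cite: Rogawski1990, §4.3 pp. 43–44; §14.5 p. 239] -/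
theorem pinSingularFamilies : w.kit.PinSingularFamilies := fun γ₀ h =>
  ⟨w.hadmG' γ₀ h, w.hadmAG' γ₀ h, w.hpin γ₀ h, w.hadmAG γ₀ h⟩

/-- **(ed. 1.19b₀) THE KIT OF AN ANCHOR WITNESS IS PINNED** — pins (i)–(xii) of `IsPinned`, each read off a field: (i)∕(vii) ★ `diagTrace_hasSum_norm_sq` ∕
`diagTrace_im_eq_zero` ∕ `diagTrace_hasSum_inner`; (ii) ★ A2 `factT1a_multiplicityFinite`; (iii) `hμ₃`; (iv)∕(v) by `rfl`; (vi) with `S₀ ∪ S_bad`; (viii′)∕(viii″)∕(viii⁗)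
`hμA`, `rfl`, `hsupp`, `hα`; (ix′) `harch` (ed. 1.22: `Transfer`'s body IS the pin's, test-ness included); (x) `hcorr`, `hcorr′`; (xi‴) `hloc`, `hae`, `hpf`, `harch`; (xii) `⟨t′, t, t_H, hcoh⟩` (`det H ≠ 0` by
proof irrelevance in `hanis`); (xiv) `hnorm` (ed. 1.19b₁); (viii‴) from `hα`, `hβ`; (ed. 1.19c₁∕c₂) the SJ sockets `pinSJG`, `pinSJGFinite`, `pinTransfersTo`, `pinKappa`, `pinSJH`, `pinSJHFinite`, (ed. 1.20) `pinKappaValues`, (ed. 1.21) `pinStabilisationPackage`, (ed. 1.23) (viii⁵) `pinStableBeta`. (ed. ≤ 1.19a: the `refine` block of `anchoredKit_nonempty_of_stubs`.) [cite: Rogawski1990, §14.5 p. 237; §14.2 (14.2.1) p. 232] -/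
theorem isPinned : w.kit.IsPinned ν Tinf νH νG νGi νqi νHi := by
  classical
  have hfin := factT1a_multiplicityFinite L H μ hanis
  refine ⟨?_, fun P => ENat.coe_toNat (hfin P).ne, ?_, fun _ => Iff.rfl, fun _ => rfl,
    ⟨w.S₀ ∪ w.Sbad, fun v hv => w.hψ₀ v fun h => hv (Finset.mem_union_left _ h),
      fun _ _ ⟨T, T', _, h₁, h₂, h₃, _⟩ => ⟨T, T', h₁, h₂, fun v _ => h₃ v⟩, fun _ _ h => h.1⟩, ?_,
    ⟨w.hμA, ⟨fun _ _ => rfl, w.hsupp⟩, w.hα⟩, ⟨w.harchP.1, w.harchP.2.1, fun _ _ h => h⟩, ⟨w.hcorr, w.hcorr'⟩,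
    ⟨fun v => ⟨(w.hlocP v).1.1, (w.hlocP v).1.2.1, (w.hlocP v).1.2.2.1, (w.hlocP v).2.2.1, (w.hlocP v).2.2.2⟩, w.hae, w.hpf,
      w.harchP.2.2.1, w.harchP.1, fun _ _ h => h.2⟩,
    fun _ => ⟨w.t', w.t, w.tH, w.hcohP⟩, w.hnormP,
    fun c _ => ⟨w.α (Literature.NumberTheory.Rogawski1990.StableClass.ofConjClass c), w.hα _, w.hβP c⟩, w.pinSJG, w.pinSJGFinite, w.pinTransfersTo, w.pinKappa, w.pinSJH, w.pinSJHFinite, w.pinKappaValues, w.pinStabilisationPackage,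
    w.pinStableBeta, w.pinSJHCentralImage, w.pinSingularHRegularVanish, w.pinSJHOffSemisimple, w.pinCentralHVanish, w.pinCentralValueTransfer,
    w.pinPsiConj, w.pinMuAMassCentral, w.pinMuAShapeSingular, w.pinSingularArchInnerTransfer, w.pinSingularEndoscopicMass,
    w.pinSJGCentral, w.pinSJGSingular,
    w.pinTransferIff, w.pinTransferHIff, w.pinLocalUnitTransferOff, w.pinSingularFamilies⟩
  · intro f' F' hF ι _ b
    exact ⟨UnitaryGroup.diagTrace_hasSum_norm_sq L 3 H μ ν hanis f' F' hF b,
      UnitaryGroup.diagTrace_im_eq_zero L 3 H μ ν hanis f' F' hF⟩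
  · -- `w.kit.μG` is `w.μ₃` by `δ` only (`simpa` matches reducibly): restate over the field, then `exact`
    have h : (UnitaryGroup.cmDatum L 3 (splitForm L 3)).IsAutomorphicMeasure w.μ₃ := by simpa [splitForm_eq] using w.hμ₃
    exact h
  · intro g h F' hF' ι _ b
    exact UnitaryGroup.diagTrace_hasSum_inner L 3 H μ ν hanis g h F' hF' b

/-- **(ed. 1.19b₀) law T1g, `f^H`-half, for the kit of an anchor witness**: every smooth `f′ = T.eval` has a partner `f^H = T^H.eval` — a Δ_v-transfer at EVERY
finite `v` (`hloc`'s existence clause on `S₀ ∪ S_bad ∪ S′`, `f′_v ∈ C_c^∞` by `IsFinSmooth` ∕ ★ `isLocSmooth_indicator_cmLocalIntegralLevel`; the unit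
elsewhere by `hloc`'s fundamental-lemma clause), its archimedean factor THE Δ_∞-transfer of `T.arch` handed by `harch`, glued by ★
`UnitaryGroup.exists_globalTransferAwayH_loc_eq_arch_eq_of_smooth` (F0P3a-p01 (g2) L2); (ed. 1.22) its clauses `T^H.IsUnramified₂`, `T^H.S = S₀ ∪ S_bad ∪ T.S`,
`T^H.loc v = φ_v` (`φ_v ∈ C_c^∞` from `hloc`'s existence clause) and `T^H.arch = a_H` (`a_H ∈ ArchSmooth₂` from `harch`) discharge the pin's TEST-NESS block.
(ed. ≤ 1.19a: the `have hH` of `anchoredKit_nonempty_of_stubs`.) [cite: Rogawski1990, §14.3 pp. 233–234; §4.9 Prop. 4.9.1 p. 55] -/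
theorem transferH_partner : ∀ g : TestGp L H, w.kit.Smooth g → ∃ fH : TestH L, w.kit.TransferH g fH := by
  classical
  rintro g ⟨T, hT, hgT⟩
  have hex := fun v => (w.hlocP v).1.2.2.2
  have hFL := fun v => (w.hlocP v).2.1
  -- the archimedean factor of the partner is PRESCRIBED: the Δ_∞-transfer of `T.arch` handed by the fact
  obtain ⟨aH, haH, hrelH⟩ := w.harchP.2.2.2.2.2 T.arch hT.isArchTest
  have hsm : ∀ v, Literature.NumberTheory.Rogawski1990.IsLocSmooth (T.loc v) := by
    intro v
    by_cases hv : v ∈ T.S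
    · exact hT.isFinSmooth v hv
    · rw [T.loc_eq_indicator v hv, hT.isUnramified.K_eq hv]
      exact Literature.NumberTheory.Rogawski1990.isLocSmooth_indicator_cmLocalIntegralLevel L 3 H v
  choose φ hφs hφt using fun v => hex v (T.loc v) (hsm v)
  obtain ⟨TH, fH, hTH, hfH, hS, hφ, hunit, harchEq, hglob⟩ :=
    UnitaryGroup.exists_globalTransferAwayH_loc_eq_arch_eq_of_smooth L H (splitForm L 2) (splitForm L 1) (w.S₀ ∪ w.Sbad) g T hT hgT φ
      (fun v _ => hφs v) aH haH.continuous haH.hasCompactSupport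
  -- (ed. 1.22) the test-ness block: `hT`; `T^H` unramified with `T^H.loc v = φ_v ∈ C_c^∞` on `T^H.S = S₀ ∪ S_bad ∪ T.S` and `T^H.arch = a_H ∈ ArchSmooth₂`
  refine ⟨fH, hglob, T, TH, ⟨hT, hTH, fun v hv => ?_, by rw [harchEq]; exact haH⟩, hgT, hfH, fun v => ?_, by rw [harchEq]; exact hrelH⟩
  · rw [hS] at hv
    rw [hφ v hv]
    exact hφs v
  · by_cases hv : v ∈ w.S₀ ∪ w.Sbad ∪ T.S
    · rw [hφ v hv]
      exact hφt v
    · have hvS : v ∉ T.S := fun h => hv (Finset.mem_union_right _ h)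
      have hvb : v ∉ w.Sbad := fun h => hv (Finset.mem_union_left _ (Finset.mem_union_right _ h))
      rw [hunit v hv, T.loc_eq_indicator v hvS, hT.isUnramified.K_eq hvS]
      exact hFL v hvb

/-- **(ed. 1.19b₀) (ix′) for the kit of an anchor witness**: every smooth `f′ = T.eval` has an `IsTest` partner `T′` on `U(Φ₃)` with `T′.loc v = T.loc v ∘ ψ_v⁻¹` at
EVERY finite `v` and `T′.arch :=` THE archimedean inner transfer of `T.arch` handed by `harch` (★ p01 ed. 2 `exists_isTest_forall_loc_eq_comp_symm_arch_eq`).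
(ed. 1.22: the pin's test-ness slot is `⟨hT, hT′⟩`.) (ed. ≤ 1.19a: the `have hpart` of `anchoredKit_nonempty_of_stubs`.) [cite: Rogawski1990, §14.2 (14.2.1) pp. 232–233] -/
theorem transfer_partner : ∀ g : TestGp L H, w.kit.Smooth g →
    ∃ f : TestG L, (∃ T' : UnitaryGroup.PureTensor L 3 (splitForm L 3), T'.IsTest ∧ ⇑f = T'.eval) ∧ w.kit.Transfer g f := by
  rintro g ⟨T, hT, hgT⟩
  obtain ⟨a, ha, hrel⟩ := w.harchP.2.2.2.2.1 T.arch hT.isArchTest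
  obtain ⟨T', hT', -, hloc, harchEq⟩ :=
    UnitaryGroup.PureTensor.exists_isTest_forall_loc_eq_comp_symm_arch_eq L H w.ψ₀ w.S₀ w.hψ₀ T hT.isUnramified hT.isFinSmooth a ha
  refine ⟨T'.toCc hT'.isUnramified hT'.isArchTest.continuous_arch hT'.isArchTest.hasCompactSupport_arch
      (fun v _ => UnitaryGroup.PureTensor.continuous_loc hT'.isUnramified hT'.isFinSmooth v)
      (fun v _ => UnitaryGroup.PureTensor.hasCompactSupport_loc hT'.isUnramified hT'.isFinSmooth v),
    ⟨T', hT', rfl⟩, T, T', ⟨hT, hT'⟩, hgT, rfl, hloc, ?_⟩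
  rw [harchEq]
  exact hrel

/-- **(ed. 1.19b₀) law T1g `TransferExistence` for the kit of an anchor witness** (the two partner lemmas). [cite: Rogawski1990, §14.2 p. 233; §14.3 pp. 233–234] -/
theorem transferExistence : w.kit.TransferExistence := by
  intro f' hf'
  obtain ⟨f, -, hff⟩ := w.transfer_partner f' hf'
  obtain ⟨fH, hfH⟩ := w.transferH_partner f' hf'
  exact ⟨f, fH, hff, hfH⟩

/-- **(ed. 1.19b₀) law T1a `SimpleTraceFormula` for the kit of an anchor witness**: finiteness of the O-expansion in the stable classes (★
`StableClass.finite_support_orbitalSum` of `hsupp`) and `θ_{G′}(f′) = J_{G′}(f′)` (`hJeq`). [cite: Rogawski1990, §14.5 pp. 237–238] -/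
theorem simpleTraceFormula : w.kit.SimpleTraceFormula := by
  intro f'
  exact ⟨Literature.NumberTheory.Rogawski1990.StableClass.finite_support_orbitalSum _ (w.hsupp f'), w.hJeq f'⟩

/-- **(ed. 1.19b₀)** every smooth `f′` has a `Transfer`-partner that is moreover an `IsTest` pure tensor on `U(Φ₃)` (the nonvacuity half of the head).
[cite: Rogawski1990, §14.2 (14.2.1) pp. 232–233] -/
theorem smooth_partner : ∀ f' : TestGp L H, w.kit.Smooth f' → ∃ f : TestG L, w.kit.Transfer f' f ∧
    ∃ T' : UnitaryGroup.PureTensor L 3 (splitForm L 3), T'.IsTest ∧ ⇑f = T'.eval := by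
  intro f' hf'
  obtain ⟨f, hfT, hff⟩ := w.transfer_partner f' hf'
  exact ⟨f, hff, hfT⟩

end AnchorWitness

/-- **(J2′-a) THE ANCHOR WITNESS AT THE PACKAGE'S OWN WITNESS, WITH A RIDER `Q`** (ed. 1.23b, RULING #117; F0P3b (J2), REF1 R-21 (iii)): given the
ED. 5 fact ★ `GlobalTransferWithStabilisationPackageAnd L H T_∞.Δ ν_H ν_G Q` — the ED. 4 package AND a further clause bundle `Q Δ m_H m_G` on the SAME
witness [Rogawski1990, Prop. 4.9.1, (4.3.1)–(4.3.3), Prop. 13.1.4] — and ★ `ArchTransfersExistCanonical`, there is an anchor witness `w` whose transfer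
data `w.Δ, w.mH, w.mG` ARE that witness, so `Q w.Δ w.mH w.mG` (and `w.kit.Δ = w.Δ`, `w.kit.mH = w.mH`, `w.kit.mG = w.mG` by `rfl`).  This is the former body
of `anchorWitness_nonempty` verbatim with the rider threaded; `anchorWitness_nonempty` below is its `Q := ⊤` instance (statement unchanged).  The
`Q`-threaded kit-level export `anchoredKit_nonempty_of_stubsQ` is in the API file. [cite: Rogawski1990, §14.5 p. 237; §4.9 Prop. 4.9.1 p. 55; §13.1 Prop. 13.1.4 p. 199] -/
theorem anchorWitness_exists_of_packageAnd
    (νH : ∀ v : HeightOneSpectrum (𝓞 ↥(maximalRealSubfield L)), Measure (HLocal L v)) (νG : ∀ v : HeightOneSpectrum (𝓞 ↥(maximalRealSubfield L)), Measure (GpLocal L H v))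
    [∀ v, IsFiniteMeasureOnCompacts (νH v)] [∀ v, (νH v).IsMulRightInvariant]
    [∀ v, (νG v).IsHaarMeasure] [∀ v, (νG v).IsMulRightInvariant]
    (νGi : Measure (GpInf L H)) (νqi : Measure (GInf L)) (νHi : Measure (HInf L))
    [IsFiniteMeasureOnCompacts νGi] [νGi.IsMulRightInvariant] [IsFiniteMeasureOnCompacts νqi] [νqi.IsMulRightInvariant]
    [IsFiniteMeasureOnCompacts νHi] [νHi.IsMulRightInvariant]
    (h3 : StubT1cSplitFormAutomorphicMeasure L)
    (Tinf : Literature.NumberTheory.Rogawski1990.ArchTransferFactor L H)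
    (hK : ∀ v : HeightOneSpectrum (𝓞 ↥(maximalRealSubfield L)), νG v (UnitaryGroup.cmLocalIntegralLevel L 3 H v : Set (GpLocal L H v)) = 1)
    (hKH : ∀ v : HeightOneSpectrum (𝓞 ↥(maximalRealSubfield L)),
      νH v (((UnitaryGroup.cmLocalIntegralLevel L 2 (Matrix.of fun i j : Fin 2 => if i.val + j.val + 1 = 2 then (1 : L) else 0) v).prod
          (UnitaryGroup.cmLocalIntegralLevel L 1 (Matrix.of fun i j : Fin 1 => if i.val + j.val + 1 = 1 then (1 : L) else 0) v) :
            Subgroup (HLocal L v)) : Set (HLocal L v)) = 1)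
    {Q : letI : ∀ (v : HeightOneSpectrum (𝓞 ↥(maximalRealSubfield L))) (a : HLocal L v),
          MeasurableSpace (HLocal L v ⧸ Subgroup.centralizer ({a} : Set (HLocal L v))) := fun _ _ => borel _
      letI : ∀ (v : HeightOneSpectrum (𝓞 ↥(maximalRealSubfield L))) (γ : (UnitaryGroup.cmDatum L 3 H).Local v),
          MeasurableSpace ((UnitaryGroup.cmDatum L 3 H).Local v ⧸ Subgroup.centralizer ({γ} : Set ((UnitaryGroup.cmDatum L 3 H).Local v))) :=
        fun _ _ => borel _
      (∀ v : HeightOneSpectrum (𝓞 ↥(maximalRealSubfield L)), Literature.NumberTheory.Rogawski1990.LocalTransferFactor L H v) →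
      (∀ v : HeightOneSpectrum (𝓞 ↥(maximalRealSubfield L)), OrbitalMeasureFamily (HLocal L v)) →
      (∀ v : HeightOneSpectrum (𝓞 ↥(maximalRealSubfield L)), OrbitalMeasureFamily ((UnitaryGroup.cmDatum L 3 H).Local v)) → Prop}
    (hGTQ : Literature.NumberTheory.Rogawski1990.GlobalTransferWithStabilisationPackageAnd L H Tinf.Δ νH νG Q)
    (hAT₄ : Literature.NumberTheory.Rogawski1990.ArchTransfersExistCanonicalSingular L H Tinf νGi νqi νHi)
    (hSET :
      letI : ∀ (v : HeightOneSpectrum (𝓞 ↥(maximalRealSubfield L))) (γ : (UnitaryGroup.cmDatum L 3 H).Local v),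
        MeasurableSpace ((UnitaryGroup.cmDatum L 3 H).Local v ⧸
          Subgroup.centralizer ({γ} : Set ((UnitaryGroup.cmDatum L 3 H).Local v))) := fun _ _ => borel _;
      haveI : ∀ (v : HeightOneSpectrum (𝓞 ↥(maximalRealSubfield L))) (γ : (UnitaryGroup.cmDatum L 3 H).Local v),
        BorelSpace ((UnitaryGroup.cmDatum L 3 H).Local v ⧸
          Subgroup.centralizer ({γ} : Set ((UnitaryGroup.cmDatum L 3 H).Local v))) := fun _ _ => ⟨rfl⟩;
      letI : ∀ g : GpAdelic L H, MeasurableSpace (GpAdelic L H ⧸ Subgroup.centralizer ({g} : Set (GpAdelic L H))) := fun _ => borel _;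
      haveI : ∀ g : GpAdelic L H, BorelSpace (GpAdelic L H ⧸ Subgroup.centralizer ({g} : Set (GpAdelic L H))) := fun _ => ⟨rfl⟩;
      letI : ∀ γ : GpInf L H, MeasurableSpace (GpInf L H ⧸ Subgroup.centralizer ({γ} : Set (GpInf L H))) := fun _ => borel _;
      haveI : ∀ γ : GpInf L H, BorelSpace (GpInf L H ⧸ Subgroup.centralizer ({γ} : Set (GpInf L H))) := fun _ => ⟨rfl⟩;
      letI : ∀ γ : GInf L, MeasurableSpace (GInf L ⧸ Subgroup.centralizer ({γ} : Set (GInf L))) := fun _ => borel _;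
      haveI : ∀ γ : GInf L, BorelSpace (GInf L ⧸ Subgroup.centralizer ({γ} : Set (GInf L))) := fun _ => ⟨rfl⟩;
      letI : ∀ (v : HeightOneSpectrum (𝓞 ↥(maximalRealSubfield L))) (a : HLocal L v),
        MeasurableSpace (HLocal L v ⧸ Subgroup.centralizer ({a} : Set (HLocal L v))) := fun _ _ => borel _;
      haveI : ∀ (v : HeightOneSpectrum (𝓞 ↥(maximalRealSubfield L))) (a : HLocal L v),
        BorelSpace (HLocal L v ⧸ Subgroup.centralizer ({a} : Set (HLocal L v))) := fun _ _ => ⟨rfl⟩;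
      letI : ∀ a : HInf L, MeasurableSpace (HInf L ⧸ Subgroup.centralizer ({a} : Set (HInf L))) := fun _ => borel _;
      haveI : ∀ a : HInf L, BorelSpace (HInf L ⧸ Subgroup.centralizer ({a} : Set (HInf L))) := fun _ => ⟨rfl⟩;
      letI : ∀ γ : GpAdelic L H, MeasurableSpace (↥(Subgroup.centralizer ({γ} : Set (GpAdelic L H))) ⧸
        ((UnitaryGroup.cmDatum L 3 H).quotientSubgroup ⊓ Subgroup.centralizer ({γ} : Set (GpAdelic L H))).subgroupOf
          (Subgroup.centralizer ({γ} : Set (GpAdelic L H)))) := fun _ => borel _;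
      haveI : ∀ γ : GpAdelic L H, BorelSpace (↥(Subgroup.centralizer ({γ} : Set (GpAdelic L H))) ⧸
        ((UnitaryGroup.cmDatum L 3 H).quotientSubgroup ⊓ Subgroup.centralizer ({γ} : Set (GpAdelic L H))).subgroupOf
          (Subgroup.centralizer ({γ} : Set (GpAdelic L H)))) := fun _ => ⟨rfl⟩;
      haveI hCcl : ∀ γ : GpAdelic L H, IsClosed ((Subgroup.centralizer ({γ} : Set (GpAdelic L H)) : Subgroup (GpAdelic L H)) : Set (GpAdelic L H)) :=
        fun γ => UnitaryGroup.isClosed_centralizer_cmDatum L 3 H γ;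
      haveI : ∀ γ : GpAdelic L H, (Measure.count : Measure ↥(((UnitaryGroup.cmDatum L 3 H).quotientSubgroup ⊓
        Subgroup.centralizer ({γ} : Set (GpAdelic L H))).subgroupOf (Subgroup.centralizer ({γ} : Set (GpAdelic L H))))).IsHaarMeasure :=
        fun γ => UnitaryGroup.isHaarMeasure_count_quotientSubgroup_inf_centralizer_subgroupOf L 3 H γ;
      haveI : ν.IsMulRightInvariant := by
        have h : ν.inv.IsMulRightInvariant := inferInstance
        rwa [Measure.inv_eq_self] at h;
      Literature.NumberTheory.Rogawski1990.SingularEllipticTransferCanonical L H Tinf νH νG νGi νqi νHi ν)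
    (hanis : IsAnisotropic L H) (hherm : IsHermitianCM L H) :
    ∃ w : AnchorWitness L H μ ν νH νG νGi νqi νHi Tinf hanis, Q w.Δ w.mH w.mG := by
  classical
  -- (x)∕(vii-c) (ed. 1.24a (F-0)): ONE family `ψ_v` — matrix conjugations, class-preserving both ways, level-matching off `S₀`
  obtain ⟨ψ₀, S₀, hconjS, hcorr, hcorr', hψ₀⟩ := UnitaryGroup.exists_psi_conj_corresponds_forall_levelMatching L H hanis hherm
  -- (xi′)∕(xi‴)∕(xv) + rider `Q` (ed. 1.23b, (J2′-a)): the JOINT canonical fact WITH STABILISATION PACKAGE AND `Q` (ED. 5 over ED. 4 `hGT₄`) [Rogawski1990, Prop. 4.9.1, (4.3.1)–(4.3.3), Prop. 3.3.1, (5.4.5)] — data, clause bundle, package at `hanis`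
  obtain ⟨Sbad, Δ, mH, mG, hloc, hae, hpf, hpkg, hq⟩ := hGTQ hK hKH
  -- (ix′)∕(xi″)∕(xii) at `∞`: the GUARDED archimedean canonical fact — data, six clauses, the torus coherence kept WHOLE [Rogawski1990, (14.2.1), §14.3 p. 234]
  -- (ed. 1.24a (F-0) ∕ 1.24b (F-1)) `hAT₄` = ★ `ArchTransfersExistCanonicalSingular` through its MATRIX ★ `ArchCanonicalSingularMatrix`, kept WHOLE (`hACS`: the (F-0)
  -- field and `hSET`'s archimedean argument); ED. 3's thirteen conjuncts destructured for the ED ≤ 1.23 fields, (S-c)(S-d) read only through `w.hACS`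
  obtain ⟨mpi, mqi, mHi, t', t, tH, hACS⟩ :=
    Literature.NumberTheory.Rogawski1990.ArchTransfersExistCanonicalSingular.exists_archCanonicalSingularMatrix L H hAT₄ hherm hanis
  obtain ⟨h₁, h₂, h₃, h₄, h₅, h₆, hW', hW, hWH, hC', hC, hC'G, hCH, -, -⟩ := id hACS
  have hcoh : ArchTorusCoherence L H hanis mpi mqi mHi νGi νqi νHi t' t tH := ⟨hW', hW, hWH, hC', hC, hC'G, hCH⟩
  obtain ⟨μ₃, hμ₃⟩ := h3 3 le_rfl
  -- (xiv) (ed. 1.19b₁): `mG` normalised off a finite set at every REGULAR rational class — ★ `exists_isNormalisedOff_of_isConj_toAdelic` on the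
  -- canonicity (xi‴), the centralizer compact cores inside `K′_v` a.e. (★ `compactCoreCentralizerLevelAE_of_hermitian`, `det H ≠ 0` from `hanis`) at
  -- `y = toAdelic (out c)` itself; regularity of the local representatives by `isRegularElt_toLocal_toAdelic` + `isRegularElt_out_mk_local` [Rogawski1990, §4.3 pp. 43–44]
  have hHd : H.det ≠ 0 := Literature.NumberTheory.Automorphic.Godement.det_ne_zero_of_anisotropic L H hanis
  have hnorm : letI : ∀ (v : HeightOneSpectrum (𝓞 ↥(maximalRealSubfield L))) (γ : (UnitaryGroup.cmDatum L 3 H).Local v),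
          MeasurableSpace ((UnitaryGroup.cmDatum L 3 H).Local v ⧸
            Subgroup.centralizer ({γ} : Set ((UnitaryGroup.cmDatum L 3 H).Local v))) := fun _ _ => borel _;
      ∀ c : ConjClasses (UnitaryGroup.cmDatum L 3 H).Rational,
        Literature.NumberTheory.Rogawski1990.IsRegularElt ((Quotient.out c).val : GL (Fin 3) L) →
          ∃ S₀ : Finset (HeightOneSpectrum (𝓞 ↥(maximalRealSubfield L))),
            UnitaryGroup.IsNormalisedOff L 3 H mG ((UnitaryGroup.cmDatum L 3 H).toAdelic (Quotient.out c)) S₀ := by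
    letI : ∀ (v : HeightOneSpectrum (𝓞 ↥(maximalRealSubfield L))) (γ : (UnitaryGroup.cmDatum L 3 H).Local v),
        MeasurableSpace ((UnitaryGroup.cmDatum L 3 H).Local v ⧸
          Subgroup.centralizer ({γ} : Set ((UnitaryGroup.cmDatum L 3 H).Local v))) := fun _ _ => borel _
    haveI : ∀ (v : HeightOneSpectrum (𝓞 ↥(maximalRealSubfield L))) (γ : (UnitaryGroup.cmDatum L 3 H).Local v),
        BorelSpace ((UnitaryGroup.cmDatum L 3 H).Local v ⧸
          Subgroup.centralizer ({γ} : Set ((UnitaryGroup.cmDatum L 3 H).Local v))) := fun _ _ => ⟨rfl⟩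
    intro c hc
    exact UnitaryGroup.exists_isNormalisedOff_of_isConj_toAdelic L 3 H
      (fun v γ => Literature.NumberTheory.Rogawski1990.IsRegularElt (γ.val : GL (Fin 3) (UnitaryGroup.LocalRing L v))) νG mG hK
      (fun v => (hloc v).2.2.2) (UnitaryGroup.compactCoreCentralizerLevelAE_of_hermitian L 3 H hherm hHd) (Quotient.out c) hc
      ((UnitaryGroup.cmDatum L 3 H).toAdelic (Quotient.out c)) (IsConj.refl _)
      (fun v => Literature.NumberTheory.Rogawski1990.isRegularElt_out_mk_toLocal_toAdelic L H (Quotient.out c) hc v)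
  -- (xv-s) (ed. 1.24b (F-1)): the SINGULAR MEMBERS of ★ `SingularEllipticTransferCanonical` for THIS global∕archimedean datum (ED. 3 matrix `⟨hloc, hae, hpf⟩` + `hACS`)
  letI : ∀ (v : HeightOneSpectrum (𝓞 ↥(maximalRealSubfield L))) (γ : (UnitaryGroup.cmDatum L 3 H).Local v),
      MeasurableSpace ((UnitaryGroup.cmDatum L 3 H).Local v ⧸
        Subgroup.centralizer ({γ} : Set ((UnitaryGroup.cmDatum L 3 H).Local v))) := fun _ _ => borel _
  haveI : ∀ (v : HeightOneSpectrum (𝓞 ↥(maximalRealSubfield L))) (γ : (UnitaryGroup.cmDatum L 3 H).Local v),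
      BorelSpace ((UnitaryGroup.cmDatum L 3 H).Local v ⧸
        Subgroup.centralizer ({γ} : Set ((UnitaryGroup.cmDatum L 3 H).Local v))) := fun _ _ => ⟨rfl⟩
  letI : ∀ g : GpAdelic L H, MeasurableSpace (GpAdelic L H ⧸ Subgroup.centralizer ({g} : Set (GpAdelic L H))) := fun _ => borel _
  haveI : ∀ g : GpAdelic L H, BorelSpace (GpAdelic L H ⧸ Subgroup.centralizer ({g} : Set (GpAdelic L H))) := fun _ => ⟨rfl⟩
  letI : ∀ γ : GpInf L H, MeasurableSpace (GpInf L H ⧸ Subgroup.centralizer ({γ} : Set (GpInf L H))) := fun _ => borel _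
  haveI : ∀ γ : GpInf L H, BorelSpace (GpInf L H ⧸ Subgroup.centralizer ({γ} : Set (GpInf L H))) := fun _ => ⟨rfl⟩
  letI : ∀ γ : GInf L, MeasurableSpace (GInf L ⧸ Subgroup.centralizer ({γ} : Set (GInf L))) := fun _ => borel _
  haveI : ∀ γ : GInf L, BorelSpace (GInf L ⧸ Subgroup.centralizer ({γ} : Set (GInf L))) := fun _ => ⟨rfl⟩
  letI : ∀ (v : HeightOneSpectrum (𝓞 ↥(maximalRealSubfield L))) (a : HLocal L v),
      MeasurableSpace (HLocal L v ⧸ Subgroup.centralizer ({a} : Set (HLocal L v))) := fun _ _ => borel _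
  haveI : ∀ (v : HeightOneSpectrum (𝓞 ↥(maximalRealSubfield L))) (a : HLocal L v),
      BorelSpace (HLocal L v ⧸ Subgroup.centralizer ({a} : Set (HLocal L v))) := fun _ _ => ⟨rfl⟩
  letI : ∀ a : HInf L, MeasurableSpace (HInf L ⧸ Subgroup.centralizer ({a} : Set (HInf L))) := fun _ => borel _
  haveI : ∀ a : HInf L, BorelSpace (HInf L ⧸ Subgroup.centralizer ({a} : Set (HInf L))) := fun _ => ⟨rfl⟩
  letI : ∀ γ : GpAdelic L H, MeasurableSpace (↥(Subgroup.centralizer ({γ} : Set (GpAdelic L H))) ⧸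
      ((UnitaryGroup.cmDatum L 3 H).quotientSubgroup ⊓ Subgroup.centralizer ({γ} : Set (GpAdelic L H))).subgroupOf
        (Subgroup.centralizer ({γ} : Set (GpAdelic L H)))) := fun _ => borel _
  haveI : ∀ γ : GpAdelic L H, BorelSpace (↥(Subgroup.centralizer ({γ} : Set (GpAdelic L H))) ⧸
      ((UnitaryGroup.cmDatum L 3 H).quotientSubgroup ⊓ Subgroup.centralizer ({γ} : Set (GpAdelic L H))).subgroupOf
        (Subgroup.centralizer ({γ} : Set (GpAdelic L H)))) := fun _ => ⟨rfl⟩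
  haveI hCcl : ∀ γ : GpAdelic L H, IsClosed ((Subgroup.centralizer ({γ} : Set (GpAdelic L H)) : Subgroup (GpAdelic L H)) : Set (GpAdelic L H)) :=
    fun γ => UnitaryGroup.isClosed_centralizer_cmDatum L 3 H γ
  haveI : ∀ γ : GpAdelic L H, (Measure.count : Measure ↥(((UnitaryGroup.cmDatum L 3 H).quotientSubgroup ⊓
      Subgroup.centralizer ({γ} : Set (GpAdelic L H))).subgroupOf (Subgroup.centralizer ({γ} : Set (GpAdelic L H))))).IsHaarMeasure :=
    fun γ => UnitaryGroup.isHaarMeasure_count_quotientSubgroup_inf_centralizer_subgroupOf L 3 H γ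
  haveI : ν.IsMulRightInvariant := by
    have h : ν.inv.IsMulRightInvariant := inferInstance
    rwa [Measure.inv_eq_self] at h
  obtain ⟨mGs, mGis, mqis, hS⟩ := hSET.exists_singularTransferMembers hanis Sbad Δ mH mG ⟨hloc, hae, hpf⟩ mpi mqi mHi t' t tH hACS
  -- (viii′-2)∕(viii″)∕(viii⁗)∕(viii⁵)∕(viii⁵-s) (ed. 1.24b (F-1)): the absorbed adelic family ANCHORED to `ofLocal` of the PATCHED families at EVERY class —
  -- ★ `UnitaryGroup.exists_absorbedFamily_ofLocal_patched` ((A-s) p822250 + patch-safety p823212; `hstab_s` = (K7-s) of the package) [Rogawski1990, §14.5 p. 239; Kottwitz1988 Thm. 1]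
  obtain ⟨μA, hμA, hsupp, hJeq, α, hα, hβp, hβ, hβs⟩ :=
    UnitaryGroup.exists_absorbedFamily_ofLocal_patched L 3 H hanis hherm hHd νG hK mG (fun v => (hloc v).2.2.2) (fun v => (hloc v).1.2.2.1) hnorm
      mpi νGi t' hcoh.1 hcoh.2.2.2.1 h₁ mGs mGis (fun γ₀ hγ₀ v => (hS.1 γ₀ hγ₀).1 v) (fun γ₀ hγ₀ => (hS.1 γ₀ hγ₀).2.1) hS.2.1 ν μ hS.2.2.2.1
      (fun v c' => if Literature.NumberTheory.Rogawski1990.IsRegularElt ((Quotient.out c').val : GL (Fin 3) (UnitaryGroup.LocalRing L v)) then mG v c' else mGs v c')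
      (fun c' => if Literature.NumberTheory.Rogawski1990.IsRegularElt ((Quotient.out c').val : GL (Fin 3) (NumberField.mixedEmbedding.mixedSpace L)) then mpi c' else mGis c')
      (fun v c' hc => if_pos hc) (fun v c' hc => if_neg hc) (fun c' hc => if_pos hc) (fun c' hc => if_neg hc)
  -- (structure-instance fields are `sepByIndent`: continuation lines at the column of the first field)
  exact ⟨{ ψ₀ := ψ₀, S₀ := S₀, Sbad := Sbad, Δ := Δ, mH := mH, mG := mG, mHi := mHi, mGi := mpi, mqi := mqi, t' := t', t := t, tH := tH,
           μ₃ := μ₃, μA := μA, hμ₃ := hμ₃, hcorr := hcorr, hcorr' := hcorr', hψ₀ := hψ₀, hloc := hloc, hae := hae, hpf := hpf, hpkg := hpkg hanis,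
           harch := ⟨h₁, h₂, h₃, h₄, h₅, h₆⟩, hcoh := hcoh, hμA := hμA, hsupp := hsupp, hJeq := hJeq, hnorm := hnorm, α := α, hα := hα, hβ := hβ,
           hconjS := hconjS, hACS := hACS,
           mGs := mGs, mGis := mGis, mqis := mqis, hS := hS, hβp := hβp, hβs := hβs, hH := hherm }, hq⟩


/-- **(ed. 1.19b₀) AN ANCHOR WITNESS EXISTS** for anisotropic hermitian `H`, from stub S3, ★ (Ψ) `UnitaryGroup.exists_psi_corresponds_forall_levelMatching` and
the printed transfer facts taken as hypotheses (bodies destructured one level), the normalisation and the absorbed adelic family anchored to `ofLocal` (edition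
history: companion § ed. 1.24b). [cite: Rogawski1990, §14.1–14.2 p. 232; §14.5 p. 237] -/
theorem anchorWitness_nonempty
    (νH : ∀ v : HeightOneSpectrum (𝓞 ↥(maximalRealSubfield L)), Measure (HLocal L v)) (νG : ∀ v : HeightOneSpectrum (𝓞 ↥(maximalRealSubfield L)), Measure (GpLocal L H v))
    [∀ v, IsFiniteMeasureOnCompacts (νH v)] [∀ v, (νH v).IsMulRightInvariant]
    [∀ v, (νG v).IsHaarMeasure] [∀ v, (νG v).IsMulRightInvariant]
    (νGi : Measure (GpInf L H)) (νqi : Measure (GInf L)) (νHi : Measure (HInf L))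
    [IsFiniteMeasureOnCompacts νGi] [νGi.IsMulRightInvariant] [IsFiniteMeasureOnCompacts νqi] [νqi.IsMulRightInvariant]
    [IsFiniteMeasureOnCompacts νHi] [νHi.IsMulRightInvariant]
    (h3 : StubT1cSplitFormAutomorphicMeasure L)
    (Tinf : Literature.NumberTheory.Rogawski1990.ArchTransferFactor L H)
    (hK : ∀ v : HeightOneSpectrum (𝓞 ↥(maximalRealSubfield L)), νG v (UnitaryGroup.cmLocalIntegralLevel L 3 H v : Set (GpLocal L H v)) = 1)
    (hKH : ∀ v : HeightOneSpectrum (𝓞 ↥(maximalRealSubfield L)),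
      νH v (((UnitaryGroup.cmLocalIntegralLevel L 2 (Matrix.of fun i j : Fin 2 => if i.val + j.val + 1 = 2 then (1 : L) else 0) v).prod
          (UnitaryGroup.cmLocalIntegralLevel L 1 (Matrix.of fun i j : Fin 1 => if i.val + j.val + 1 = 1 then (1 : L) else 0) v) :
            Subgroup (HLocal L v)) : Set (HLocal L v)) = 1)
    (hGT : Literature.NumberTheory.Rogawski1990.GlobalTransferWithStabilisationPackage L H Tinf.Δ νH νG)
    (hAT₄ : Literature.NumberTheory.Rogawski1990.ArchTransfersExistCanonicalSingular L H Tinf νGi νqi νHi)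
    (hSET :
      letI : ∀ (v : HeightOneSpectrum (𝓞 ↥(maximalRealSubfield L))) (γ : (UnitaryGroup.cmDatum L 3 H).Local v),
        MeasurableSpace ((UnitaryGroup.cmDatum L 3 H).Local v ⧸
          Subgroup.centralizer ({γ} : Set ((UnitaryGroup.cmDatum L 3 H).Local v))) := fun _ _ => borel _;
      haveI : ∀ (v : HeightOneSpectrum (𝓞 ↥(maximalRealSubfield L))) (γ : (UnitaryGroup.cmDatum L 3 H).Local v),
        BorelSpace ((UnitaryGroup.cmDatum L 3 H).Local v ⧸
          Subgroup.centralizer ({γ} : Set ((UnitaryGroup.cmDatum L 3 H).Local v))) := fun _ _ => ⟨rfl⟩;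
      letI : ∀ g : GpAdelic L H, MeasurableSpace (GpAdelic L H ⧸ Subgroup.centralizer ({g} : Set (GpAdelic L H))) := fun _ => borel _;
      haveI : ∀ g : GpAdelic L H, BorelSpace (GpAdelic L H ⧸ Subgroup.centralizer ({g} : Set (GpAdelic L H))) := fun _ => ⟨rfl⟩;
      letI : ∀ γ : GpInf L H, MeasurableSpace (GpInf L H ⧸ Subgroup.centralizer ({γ} : Set (GpInf L H))) := fun _ => borel _;
      haveI : ∀ γ : GpInf L H, BorelSpace (GpInf L H ⧸ Subgroup.centralizer ({γ} : Set (GpInf L H))) := fun _ => ⟨rfl⟩;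
      letI : ∀ γ : GInf L, MeasurableSpace (GInf L ⧸ Subgroup.centralizer ({γ} : Set (GInf L))) := fun _ => borel _;
      haveI : ∀ γ : GInf L, BorelSpace (GInf L ⧸ Subgroup.centralizer ({γ} : Set (GInf L))) := fun _ => ⟨rfl⟩;
      letI : ∀ (v : HeightOneSpectrum (𝓞 ↥(maximalRealSubfield L))) (a : HLocal L v),
        MeasurableSpace (HLocal L v ⧸ Subgroup.centralizer ({a} : Set (HLocal L v))) := fun _ _ => borel _;
      haveI : ∀ (v : HeightOneSpectrum (𝓞 ↥(maximalRealSubfield L))) (a : HLocal L v),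
        BorelSpace (HLocal L v ⧸ Subgroup.centralizer ({a} : Set (HLocal L v))) := fun _ _ => ⟨rfl⟩;
      letI : ∀ a : HInf L, MeasurableSpace (HInf L ⧸ Subgroup.centralizer ({a} : Set (HInf L))) := fun _ => borel _;
      haveI : ∀ a : HInf L, BorelSpace (HInf L ⧸ Subgroup.centralizer ({a} : Set (HInf L))) := fun _ => ⟨rfl⟩;
      letI : ∀ γ : GpAdelic L H, MeasurableSpace (↥(Subgroup.centralizer ({γ} : Set (GpAdelic L H))) ⧸
        ((UnitaryGroup.cmDatum L 3 H).quotientSubgroup ⊓ Subgroup.centralizer ({γ} : Set (GpAdelic L H))).subgroupOf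
          (Subgroup.centralizer ({γ} : Set (GpAdelic L H)))) := fun _ => borel _;
      haveI : ∀ γ : GpAdelic L H, BorelSpace (↥(Subgroup.centralizer ({γ} : Set (GpAdelic L H))) ⧸
        ((UnitaryGroup.cmDatum L 3 H).quotientSubgroup ⊓ Subgroup.centralizer ({γ} : Set (GpAdelic L H))).subgroupOf
          (Subgroup.centralizer ({γ} : Set (GpAdelic L H)))) := fun _ => ⟨rfl⟩;
      haveI hCcl : ∀ γ : GpAdelic L H, IsClosed ((Subgroup.centralizer ({γ} : Set (GpAdelic L H)) : Subgroup (GpAdelic L H)) : Set (GpAdelic L H)) :=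
        fun γ => UnitaryGroup.isClosed_centralizer_cmDatum L 3 H γ;
      haveI : ∀ γ : GpAdelic L H, (Measure.count : Measure ↥(((UnitaryGroup.cmDatum L 3 H).quotientSubgroup ⊓
        Subgroup.centralizer ({γ} : Set (GpAdelic L H))).subgroupOf (Subgroup.centralizer ({γ} : Set (GpAdelic L H))))).IsHaarMeasure :=
        fun γ => UnitaryGroup.isHaarMeasure_count_quotientSubgroup_inf_centralizer_subgroupOf L 3 H γ;
      haveI : ν.IsMulRightInvariant := by
        have h : ν.inv.IsMulRightInvariant := inferInstance
        rwa [Measure.inv_eq_self] at h;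
      Literature.NumberTheory.Rogawski1990.SingularEllipticTransferCanonical L H Tinf νH νG νGi νqi νHi ν)
    (hanis : IsAnisotropic L H) (hherm : IsHermitianCM L H) :
    Nonempty (AnchorWitness L H μ ν νH νG νGi νqi νHi Tinf hanis) := by
  obtain ⟨w, -⟩ := anchorWitness_exists_of_packageAnd L H μ ν νH νG νGi νqi νHi h3 Tinf hK hKH (Q := fun _ _ _ => True)
    (fun hK' hKH' => by
      obtain ⟨Sbad, Δ, mH, mG, hloc, hae, hpf, hpkg⟩ := hGT hK' hKH'
      exact ⟨Sbad, Δ, mH, mG, hloc, hae, hpf, hpkg, trivial⟩)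
    hAT₄ hSET hanis hherm
  exact ⟨w⟩
end Anchor

/-! ### §5.2 The anchored kit exists; the head -/

/-- **The anchored interface is REALISABLE from the three stubs** (existence stated separately from the interface): for anisotropic hermitian `H`
there is a PINNED kit — the composition of `AnchorWitness.kit`∕`.isPinned`∕`.transferExistence`∕`.simpleTraceFormula`∕`.smooth_partner` with
`anchorWitness_nonempty`, the printed transfer facts as HYPOTHESES.  PLACEHOLDERS, recorded: the `Sθ`∕`M`-terms and packet data of the anchored kit are
junk values that acquire content only through `LawsT1` (full text: companion § ed. 1.24b). [cite: Rogawski1990, §14.1–14.2 p. 232; §14.5 p. 237] [cite: Gelbart1975,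
(9.11) and Lemma 10.6] -/
theorem anchoredKit_nonempty_of_stubs
    [∀ v : HeightOneSpectrum (𝓞 ↥(maximalRealSubfield L)), MeasurableSpace (HLocal L v)] [∀ v : HeightOneSpectrum (𝓞 ↥(maximalRealSubfield L)), BorelSpace (HLocal L v)]
    [∀ v : HeightOneSpectrum (𝓞 ↥(maximalRealSubfield L)), MeasurableSpace (GpLocal L H v)] [∀ v : HeightOneSpectrum (𝓞 ↥(maximalRealSubfield L)), BorelSpace (GpLocal L H v)]
    [MeasurableSpace (GpInf L H)] [BorelSpace (GpInf L H)] [MeasurableSpace (GInf L)] [BorelSpace (GInf L)]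
    [MeasurableSpace (HInf L)] [BorelSpace (HInf L)]
    (νH : ∀ v : HeightOneSpectrum (𝓞 ↥(maximalRealSubfield L)), Measure (HLocal L v)) (νG : ∀ v : HeightOneSpectrum (𝓞 ↥(maximalRealSubfield L)), Measure (GpLocal L H v))
    [∀ v, IsFiniteMeasureOnCompacts (νH v)] [∀ v, (νH v).IsMulRightInvariant]
    [∀ v, (νG v).IsHaarMeasure] [∀ v, (νG v).IsMulRightInvariant]
    (νGi : Measure (GpInf L H)) (νqi : Measure (GInf L)) (νHi : Measure (HInf L))
    [IsFiniteMeasureOnCompacts νGi] [νGi.IsMulRightInvariant] [IsFiniteMeasureOnCompacts νqi] [νqi.IsMulRightInvariant]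
    [IsFiniteMeasureOnCompacts νHi] [νHi.IsMulRightInvariant]
    (h3 : StubT1cSplitFormAutomorphicMeasure L)
    (Tinf : Literature.NumberTheory.Rogawski1990.ArchTransferFactor L H)
    (hK : ∀ v : HeightOneSpectrum (𝓞 ↥(maximalRealSubfield L)), νG v (UnitaryGroup.cmLocalIntegralLevel L 3 H v : Set (GpLocal L H v)) = 1)
    (hKH : ∀ v : HeightOneSpectrum (𝓞 ↥(maximalRealSubfield L)),
      νH v (((UnitaryGroup.cmLocalIntegralLevel L 2 (Matrix.of fun i j : Fin 2 => if i.val + j.val + 1 = 2 then (1 : L) else 0) v).prod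
          (UnitaryGroup.cmLocalIntegralLevel L 1 (Matrix.of fun i j : Fin 1 => if i.val + j.val + 1 = 1 then (1 : L) else 0) v) :
            Subgroup (HLocal L v)) : Set (HLocal L v)) = 1)
    (hGT : Literature.NumberTheory.Rogawski1990.GlobalTransferWithStabilisationPackage L H Tinf.Δ νH νG)
    (hAT₄ : Literature.NumberTheory.Rogawski1990.ArchTransfersExistCanonicalSingular L H Tinf νGi νqi νHi)
    (hSET :
      letI : ∀ (v : HeightOneSpectrum (𝓞 ↥(maximalRealSubfield L))) (γ : (UnitaryGroup.cmDatum L 3 H).Local v),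
        MeasurableSpace ((UnitaryGroup.cmDatum L 3 H).Local v ⧸
          Subgroup.centralizer ({γ} : Set ((UnitaryGroup.cmDatum L 3 H).Local v))) := fun _ _ => borel _;
      haveI : ∀ (v : HeightOneSpectrum (𝓞 ↥(maximalRealSubfield L))) (γ : (UnitaryGroup.cmDatum L 3 H).Local v),
        BorelSpace ((UnitaryGroup.cmDatum L 3 H).Local v ⧸
          Subgroup.centralizer ({γ} : Set ((UnitaryGroup.cmDatum L 3 H).Local v))) := fun _ _ => ⟨rfl⟩;
      letI : ∀ g : GpAdelic L H, MeasurableSpace (GpAdelic L H ⧸ Subgroup.centralizer ({g} : Set (GpAdelic L H))) := fun _ => borel _;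
      haveI : ∀ g : GpAdelic L H, BorelSpace (GpAdelic L H ⧸ Subgroup.centralizer ({g} : Set (GpAdelic L H))) := fun _ => ⟨rfl⟩;
      letI : ∀ γ : GpInf L H, MeasurableSpace (GpInf L H ⧸ Subgroup.centralizer ({γ} : Set (GpInf L H))) := fun _ => borel _;
      haveI : ∀ γ : GpInf L H, BorelSpace (GpInf L H ⧸ Subgroup.centralizer ({γ} : Set (GpInf L H))) := fun _ => ⟨rfl⟩;
      letI : ∀ γ : GInf L, MeasurableSpace (GInf L ⧸ Subgroup.centralizer ({γ} : Set (GInf L))) := fun _ => borel _;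
      haveI : ∀ γ : GInf L, BorelSpace (GInf L ⧸ Subgroup.centralizer ({γ} : Set (GInf L))) := fun _ => ⟨rfl⟩;
      letI : ∀ (v : HeightOneSpectrum (𝓞 ↥(maximalRealSubfield L))) (a : HLocal L v),
        MeasurableSpace (HLocal L v ⧸ Subgroup.centralizer ({a} : Set (HLocal L v))) := fun _ _ => borel _;
      haveI : ∀ (v : HeightOneSpectrum (𝓞 ↥(maximalRealSubfield L))) (a : HLocal L v),
        BorelSpace (HLocal L v ⧸ Subgroup.centralizer ({a} : Set (HLocal L v))) := fun _ _ => ⟨rfl⟩;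
      letI : ∀ a : HInf L, MeasurableSpace (HInf L ⧸ Subgroup.centralizer ({a} : Set (HInf L))) := fun _ => borel _;
      haveI : ∀ a : HInf L, BorelSpace (HInf L ⧸ Subgroup.centralizer ({a} : Set (HInf L))) := fun _ => ⟨rfl⟩;
      letI : ∀ γ : GpAdelic L H, MeasurableSpace (↥(Subgroup.centralizer ({γ} : Set (GpAdelic L H))) ⧸
        ((UnitaryGroup.cmDatum L 3 H).quotientSubgroup ⊓ Subgroup.centralizer ({γ} : Set (GpAdelic L H))).subgroupOf
          (Subgroup.centralizer ({γ} : Set (GpAdelic L H)))) := fun _ => borel _;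
      haveI : ∀ γ : GpAdelic L H, BorelSpace (↥(Subgroup.centralizer ({γ} : Set (GpAdelic L H))) ⧸
        ((UnitaryGroup.cmDatum L 3 H).quotientSubgroup ⊓ Subgroup.centralizer ({γ} : Set (GpAdelic L H))).subgroupOf
          (Subgroup.centralizer ({γ} : Set (GpAdelic L H)))) := fun _ => ⟨rfl⟩;
      haveI hCcl : ∀ γ : GpAdelic L H, IsClosed ((Subgroup.centralizer ({γ} : Set (GpAdelic L H)) : Subgroup (GpAdelic L H)) : Set (GpAdelic L H)) :=
        fun γ => UnitaryGroup.isClosed_centralizer_cmDatum L 3 H γ;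
      haveI : ∀ γ : GpAdelic L H, (Measure.count : Measure ↥(((UnitaryGroup.cmDatum L 3 H).quotientSubgroup ⊓
        Subgroup.centralizer ({γ} : Set (GpAdelic L H))).subgroupOf (Subgroup.centralizer ({γ} : Set (GpAdelic L H))))).IsHaarMeasure :=
        fun γ => UnitaryGroup.isHaarMeasure_count_quotientSubgroup_inf_centralizer_subgroupOf L 3 H γ;
      haveI : ν.IsMulRightInvariant := by
        have h : ν.inv.IsMulRightInvariant := inferInstance
        rwa [Measure.inv_eq_self] at h;
      Literature.NumberTheory.Rogawski1990.SingularEllipticTransferCanonical L H Tinf νH νG νGi νqi νHi ν)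
    (hanis : IsAnisotropic L H) (hherm : IsHermitianCM L H) :
    ∃ 𝔨 : ComparisonKit L H μ, 𝔨.IsPinned ν Tinf νH νG νGi νqi νHi ∧ 𝔨.TransferExistence ∧ 𝔨.SimpleTraceFormula ∧
      ∀ f' : TestGp L H, 𝔨.Smooth f' → ∃ f : TestG L, 𝔨.Transfer f' f ∧
        ∃ T' : UnitaryGroup.PureTensor L 3 (splitForm L 3), T'.IsTest ∧ ⇑f = T'.eval := by
  obtain ⟨w⟩ := anchorWitness_nonempty L H μ ν νH νG νGi νqi νHi h3 Tinf hK hKH hGT hAT₄ hSET hanis hherm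
  exact ⟨w.kit, w.isPinned, w.transferExistence, w.simpleTraceFormula, w.smooth_partner⟩

omit [MeasurableSpace (UnitaryGroup.cmDatum L 3 H).Adelic] [BorelSpace (UnitaryGroup.cmDatum L 3 H).Adelic] in
/-- **The inner form's automorphic measure EXISTS** (ed. 1.11, by name): for anisotropic `H` the quotient `U(H)(L⁺)\U(H)(𝔸_{L⁺})` is compact
(Godement) and carries an automorphic measure (Borel 1963 §5) — ★ `UnitaryGroup.exists_isAutomorphicMeasure_cmDatum`; so the line's ambient
`(μ) [IsAutomorphicMeasure μ]` is instantiable. [cite: Borel1963, §5] [cite: Godement1964, §5 Theorem 4] -/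
theorem gp_automorphicMeasure_nonempty (hanis : IsAnisotropic L H) :
    ∃ μ' : Measure (UnitaryGroup.cmDatum L 3 H).automorphicQuotient, (UnitaryGroup.cmDatum L 3 H).IsAutomorphicMeasure μ' :=
  UnitaryGroup.exists_isAutomorphicMeasure_cmDatum L 3 H hanis

/-- **THE LINE'S `_of` COMPOSITION**: from the stubs (all ★ CLOSED since ed. 1.10), for anisotropic hermitian `H` and Haar measures of print's convention
normalised by `hK`, `hKH` [Rogawski1990, (4.3.1), §1.7, §1.4], GIVEN the printed transfer facts as HYPOTHESES (an unproved printed theorem is a hypothesis,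
never an axiom or a sorry; their names are the antecedents of the first conjunct [Rogawski1990, Prop. 4.9.1; §14.2–14.3], edition history in the card
§ «Edition log»), a PINNED kit exists which
satisfies law T1g `TransferExistence` and law T1a `SimpleTraceFormula` with pure-smooth-tensor partners on `U(Φ₃)`; and for EVERY pinned kit satisfying the
seven printed laws T1a–T1g the head `InnerFormStableTraceIdentity` (14.6.1) holds non-vacuously.  `sorry`: NONE (full text: companion § ed. 1.24b).
[cite: Rogawski1990, Thm. 14.6.1 p. 241] -/
theorem engineT1_of_stubs
    [∀ v : HeightOneSpectrum (𝓞 ↥(maximalRealSubfield L)), MeasurableSpace (HLocal L v)] [∀ v : HeightOneSpectrum (𝓞 ↥(maximalRealSubfield L)), BorelSpace (HLocal L v)]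
    [∀ v : HeightOneSpectrum (𝓞 ↥(maximalRealSubfield L)), MeasurableSpace (GpLocal L H v)] [∀ v : HeightOneSpectrum (𝓞 ↥(maximalRealSubfield L)), BorelSpace (GpLocal L H v)]
    [MeasurableSpace (GpInf L H)] [BorelSpace (GpInf L H)] [MeasurableSpace (GInf L)] [BorelSpace (GInf L)]
    [MeasurableSpace (HInf L)] [BorelSpace (HInf L)]
    (νH : ∀ v : HeightOneSpectrum (𝓞 ↥(maximalRealSubfield L)), Measure (HLocal L v)) (νG : ∀ v : HeightOneSpectrum (𝓞 ↥(maximalRealSubfield L)), Measure (GpLocal L H v))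
    [∀ v, IsFiniteMeasureOnCompacts (νH v)] [∀ v, (νH v).IsMulRightInvariant]
    [∀ v, (νG v).IsHaarMeasure] [∀ v, (νG v).IsMulRightInvariant]
    (νGi : Measure (GpInf L H)) (νqi : Measure (GInf L)) (νHi : Measure (HInf L))
    [IsFiniteMeasureOnCompacts νGi] [νGi.IsMulRightInvariant] [IsFiniteMeasureOnCompacts νqi] [νqi.IsMulRightInvariant]
    [IsFiniteMeasureOnCompacts νHi] [νHi.IsMulRightInvariant]
    (Tinf : Literature.NumberTheory.Rogawski1990.ArchTransferFactor L H) (hanis : IsAnisotropic L H) (hherm : IsHermitianCM L H)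
    (hK : ∀ v : HeightOneSpectrum (𝓞 ↥(maximalRealSubfield L)), νG v (UnitaryGroup.cmLocalIntegralLevel L 3 H v : Set (GpLocal L H v)) = 1)
    (hKH : ∀ v : HeightOneSpectrum (𝓞 ↥(maximalRealSubfield L)),
      νH v (((UnitaryGroup.cmLocalIntegralLevel L 2 (Matrix.of fun i j : Fin 2 => if i.val + j.val + 1 = 2 then (1 : L) else 0) v).prod
          (UnitaryGroup.cmLocalIntegralLevel L 1 (Matrix.of fun i j : Fin 1 => if i.val + j.val + 1 = 1 then (1 : L) else 0) v) :
            Subgroup (HLocal L v)) : Set (HLocal L v)) = 1) :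
    (Literature.NumberTheory.Rogawski1990.GlobalTransferWithStabilisationPackage L H Tinf.Δ νH νG →
      Literature.NumberTheory.Rogawski1990.ArchTransfersExistCanonicalSingular L H Tinf νGi νqi νHi →
      (letI : ∀ (v : HeightOneSpectrum (𝓞 ↥(maximalRealSubfield L))) (γ : (UnitaryGroup.cmDatum L 3 H).Local v),
        MeasurableSpace ((UnitaryGroup.cmDatum L 3 H).Local v ⧸
          Subgroup.centralizer ({γ} : Set ((UnitaryGroup.cmDatum L 3 H).Local v))) := fun _ _ => borel _;
      haveI : ∀ (v : HeightOneSpectrum (𝓞 ↥(maximalRealSubfield L))) (γ : (UnitaryGroup.cmDatum L 3 H).Local v),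
        BorelSpace ((UnitaryGroup.cmDatum L 3 H).Local v ⧸
          Subgroup.centralizer ({γ} : Set ((UnitaryGroup.cmDatum L 3 H).Local v))) := fun _ _ => ⟨rfl⟩;
      letI : ∀ g : GpAdelic L H, MeasurableSpace (GpAdelic L H ⧸ Subgroup.centralizer ({g} : Set (GpAdelic L H))) := fun _ => borel _;
      haveI : ∀ g : GpAdelic L H, BorelSpace (GpAdelic L H ⧸ Subgroup.centralizer ({g} : Set (GpAdelic L H))) := fun _ => ⟨rfl⟩;
      letI : ∀ γ : GpInf L H, MeasurableSpace (GpInf L H ⧸ Subgroup.centralizer ({γ} : Set (GpInf L H))) := fun _ => borel _;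
      haveI : ∀ γ : GpInf L H, BorelSpace (GpInf L H ⧸ Subgroup.centralizer ({γ} : Set (GpInf L H))) := fun _ => ⟨rfl⟩;
      letI : ∀ γ : GInf L, MeasurableSpace (GInf L ⧸ Subgroup.centralizer ({γ} : Set (GInf L))) := fun _ => borel _;
      haveI : ∀ γ : GInf L, BorelSpace (GInf L ⧸ Subgroup.centralizer ({γ} : Set (GInf L))) := fun _ => ⟨rfl⟩;
      letI : ∀ (v : HeightOneSpectrum (𝓞 ↥(maximalRealSubfield L))) (a : HLocal L v),
        MeasurableSpace (HLocal L v ⧸ Subgroup.centralizer ({a} : Set (HLocal L v))) := fun _ _ => borel _;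
      haveI : ∀ (v : HeightOneSpectrum (𝓞 ↥(maximalRealSubfield L))) (a : HLocal L v),
        BorelSpace (HLocal L v ⧸ Subgroup.centralizer ({a} : Set (HLocal L v))) := fun _ _ => ⟨rfl⟩;
      letI : ∀ a : HInf L, MeasurableSpace (HInf L ⧸ Subgroup.centralizer ({a} : Set (HInf L))) := fun _ => borel _;
      haveI : ∀ a : HInf L, BorelSpace (HInf L ⧸ Subgroup.centralizer ({a} : Set (HInf L))) := fun _ => ⟨rfl⟩;
      letI : ∀ γ : GpAdelic L H, MeasurableSpace (↥(Subgroup.centralizer ({γ} : Set (GpAdelic L H))) ⧸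
        ((UnitaryGroup.cmDatum L 3 H).quotientSubgroup ⊓ Subgroup.centralizer ({γ} : Set (GpAdelic L H))).subgroupOf
          (Subgroup.centralizer ({γ} : Set (GpAdelic L H)))) := fun _ => borel _;
      haveI : ∀ γ : GpAdelic L H, BorelSpace (↥(Subgroup.centralizer ({γ} : Set (GpAdelic L H))) ⧸
        ((UnitaryGroup.cmDatum L 3 H).quotientSubgroup ⊓ Subgroup.centralizer ({γ} : Set (GpAdelic L H))).subgroupOf
          (Subgroup.centralizer ({γ} : Set (GpAdelic L H)))) := fun _ => ⟨rfl⟩;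
      haveI hCcl : ∀ γ : GpAdelic L H, IsClosed ((Subgroup.centralizer ({γ} : Set (GpAdelic L H)) : Subgroup (GpAdelic L H)) : Set (GpAdelic L H)) :=
        fun γ => UnitaryGroup.isClosed_centralizer_cmDatum L 3 H γ;
      haveI : ∀ γ : GpAdelic L H, (Measure.count : Measure ↥(((UnitaryGroup.cmDatum L 3 H).quotientSubgroup ⊓
        Subgroup.centralizer ({γ} : Set (GpAdelic L H))).subgroupOf (Subgroup.centralizer ({γ} : Set (GpAdelic L H))))).IsHaarMeasure :=
        fun γ => UnitaryGroup.isHaarMeasure_count_quotientSubgroup_inf_centralizer_subgroupOf L 3 H γ;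
      haveI : ν.IsMulRightInvariant := by
        have h : ν.inv.IsMulRightInvariant := inferInstance
        rwa [Measure.inv_eq_self] at h;
      Literature.NumberTheory.Rogawski1990.SingularEllipticTransferCanonical L H Tinf νH νG νGi νqi νHi ν) →
      ∃ 𝔨 : ComparisonKit L H μ, 𝔨.IsPinned ν Tinf νH νG νGi νqi νHi ∧ 𝔨.TransferExistence ∧ 𝔨.SimpleTraceFormula ∧
        ∀ f' : TestGp L H, 𝔨.Smooth f' → ∃ f : TestG L, 𝔨.Transfer f' f ∧
          ∃ T' : UnitaryGroup.PureTensor L 3 (splitForm L 3), T'.IsTest ∧ ⇑f = T'.eval) ∧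
    (∀ 𝔨 : ComparisonKit L H μ, 𝔨.IsPinned ν Tinf νH νG νGi νqi νHi → 𝔨.LawsT1 →
      𝔨.InnerFormStableTraceIdentity ∧ 𝔨.InnerFormStableTraceIdentityNonvacuous) :=
  ⟨fun hGT hAT₄ hSET => anchoredKit_nonempty_of_stubs L H μ ν νH νG νGi νqi νHi (stub_T1c_splitFormAutomorphicMeasure L) Tinf hK hKH hGT hAT₄ hSET hanis hherm,
    fun 𝔨 _ hl => ⟨𝔨.innerFormStableTraceIdentity_of_laws hl, 𝔨.nonvacuous_of_laws hl⟩⟩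

end Summit.HodgeConjecture.HodgeConjecture.Cruxes.H413.F0T1InnerFormTraceIdentity
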